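import Summits.AtomisticToContinuum.HydrodynamicLimit.Theses.LambertianContactSwap
import Summits.AtomisticToContinuum.HydrodynamicLimit.Theorems.LambertianContactSwapSwapGapStubSwapGapOfSmoothTest
import Summits.AtomisticToContinuum.HydrodynamicLimit.Theorems.LambertianContactSwapSwapGapStubSwapGapConstTest
import Summits.AtomisticToContinuum.HydrodynamicLimit.Theorems.LambertianContactSwapSwapGapStubLambertianEulerOfSwapGap
import Summits.AtomisticToContinuum.HydrodynamicLimit.Theorems.LambertianContactSwapSwapGapStubFieldConcentrationSmoothOfLinear
import Summits.AtomisticToContinuum.HydrodynamicLimit.Theorems.LambertianContactSwapSwapGapStubFieldConcentrationOfSmoothTest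
import Summits.AtomisticToContinuum.HydrodynamicLimit.Theorems.LambertianContactSwapSwapGapStubEnergyTightnessLambda
import Summits.AtomisticToContinuum.HydrodynamicLimit.Theorems.LambertianContactSwapSwapGapStubSwapGapOfSmoothObservable
import Summits.AtomisticToContinuum.HydrodynamicLimit.Theorems.LambertianContactSwapSwapGapStubLinearConcentrationOfFourierModes
import Summits.AtomisticToContinuum.HydrodynamicLimit.Theses.LindebergRandomFuture
import Summits.AtomisticToContinuum.HydrodynamicLimit.Theorems.LambertianContactSwapSwapGapEntropyTransfer
import Summits.AtomisticToContinuum.HydrodynamicLimit.Theorems.LambertianContactSwapSwapGapFieldConcentrationOfLD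
import Summits.AtomisticToContinuum.HydrodynamicLimit.Theorems.LambertianContactSwapSwapGapRelEntBudget
import Summits.AtomisticToContinuum.HydrodynamicLimit.Theorems.LambertianContactSwapLambertianEulerEntropyBudget
import Summits.AtomisticToContinuum.HydrodynamicLimit.Theorems.LambertianContactSwapLambertianEulerIterate
import Summits.AtomisticToContinuum.HydrodynamicLimit.Theorems.LambertianContactSwapLambertianEulerWindow
import Summits.AtomisticToContinuum.HydrodynamicLimit.Theorems.LambertianContactSwapLambertianEulerMarkov
import Summits.AtomisticToContinuum.HydrodynamicLimit.Theorems.LambertianContactSwapSwapGapStubFieldRelEntSwapOfRelEntSwap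
import Summits.AtomisticToContinuum.HydrodynamicLimit.Theorems.LambertianContactSwapSwapGapStubSwapGapOfFieldRelEntSwap
import Summits.AtomisticToContinuum.HydrodynamicLimit.Theorems.LambertianContactSwapSwapGapStubLDOfEulerOfFieldConcentration
import Summits.AtomisticToContinuum.HydrodynamicLimit.Theorems.LambertianContactSwapSwapGapStubFieldConcentrationStatic
import Summits.AtomisticToContinuum.HydrodynamicLimit.Theorems.LambertianContactSwapSwapGapStubRelEntSwapEquilibrium
import Summits.AtomisticToContinuum.HydrodynamicLimit.Theorems.LambertianContactSwapSwapGapStubFieldConcentrationEquilibrium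
import Summits.AtomisticToContinuum.HydrodynamicLimit.Theorems.LambertianContactSwapSwapGapRelEntSwapTimeZero
import Summits.AtomisticToContinuum.HydrodynamicLimit.Theorems.LambertianContactSwapMergingTransfer
import Summits.AtomisticToContinuum.HydrodynamicLimit.Theses.TwoClocks
import Summits.AtomisticToContinuum.HydrodynamicLimit.Theorems.LambertianContactSwapSwapGapOfHydrodynamicLimit
import Summits.AtomisticToContinuum.HydrodynamicLimit.Theorems.LambertianContactSwapLocalGibbsProbability
import Summits.AtomisticToContinuum.HydrodynamicLimit.Theorems.TwoClocksEntropyToHydro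
import Literature.Analysis.FunctionSpaces.FlatTorus
import HarnessLib

/-!
# Line `Sketch` for crux `LambertianContactSwap.SwapGap` (stmt-AtomisticToContinuum-11850) — the lead's skeleton, v15 (cycle 8, after wave 9; sorries = the 4 research stubs only)

Lead prover-line-stmt-AtomisticToContinuum-11850-c7-0 (continuation of c0–c6).  Direction: POSITIVE — `swapGap_of_stubs` /
`swapGap_of_stubs_via_fields` / `SwapGap_proof` conclude the crux decl
`Summit.AtomisticToContinuum.HydrodynamicLimit.Theses.LambertianContactSwap.SwapGap` (and its byte-identical copy
`…Theses.LindebergRandomFuture.SwapGap`) BY NAME from the registered stubs, which carry the only `sorry`s of the file.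

THE LINE (card `entropy-relative-to-lambertian-law`): Yau's relative entropy method with the COMPARISON GAS'S OWN LAW as reference.
`P_N` the local Gibbs law, `p_t := (Φ_t)_* P_N` (deterministic law), `q_t := (Λ_t)_* (P_N ⊗ γ^ℕ)` (Lambertian law).

v14 (cycle 8, lead c7).  (a) WAVE 9 — first independent verdicts on the two research stubs of the reversed line (§12),
signatures audited clean (no junk, no vacuity loophole, no D-0032 packing loophole): S1ʳ′ `stub_echoMeanReturn` →
`stub-blocked: Literature.MathematicalPhysics.KineticTheory.HydrodynamicLimit` (its irreducible p-side content is the hs-Euler limit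
of the DETERMINISTIC gas run from the velocity-reversed time-`t` data — backward Euler to the initial profile; no Λ-fact plus statics
supplies it; size corrected to `deficit_N(t) ≍ Kn = Θ(N^{-1/3})` because the Λ-production term `a_N` is itself `Θ(Kn)`);
S2ʳ `stub_detFieldConcentration` → `stub-blocked: none` (speed-`N` DYNAMICAL large-deviation upper bound for deterministic hard
spheres over macroscopic time; no inventory item implies it; the Gibbs-domination route `dp_t/dG_N = exp(L_N∘Φ_{-t})`,
`|L_N| ≤ A(N+1) + b·KE` reaches only events of `G_N`-rate `> A`, never small `δ` about a moving mean).  Both reversed stubs are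
therefore EXACT twins in strength of the forward pair (S1 conjunct-strength, S2 LD-strength): the reversed line buys explicitness
(S1ʳ′ is typed, numerically falsifiable) but no reduction in difficulty.  (b) STRUCTURAL SNAG recorded for the planner (wave 9):
every statement of this family is `∀ profiles ∃ σ₀ ∀ σ < σ₀ …` with an OPAQUE `σ₀(a₀,θ₀,u₀)`, so no ingredient can be re-applied
to the time-`t` (or velocity-reversed) profiles at the already-fixed `σ` — any restart / time-stepping / echo argument needs
PROFILE-CLASS-UNIFORM `σ₀` (the packing-guarded form of D-0032: one `σ₀` for all profiles with `ρσ³ < η₀`); promoted items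
should be filed in that form.  (c) NUMERICS (kit jobs j020904–j020908, `work/md/hsmd.py`): event-resolved MD of the two gases
from identical local Gibbs microstates (shear wave `u₀ = (0, sin 2πx₁, 0)`, an exact stationary smooth Euler solution; `σ = 0.3`,
`N = 10⁴ … 10⁶`, paired samples) measuring the crux's gap for `χ ∈ {cos, sin}(2πkx₁)`, `F` = coordinate projections — the first
quantitative test of the routes' `why_might_fail` (coherent accumulation of the `O(Kn)` transport difference); expected gap
`∝ Kn ∝ N^{-1/3}`.  RESULTS (NUMERICS.md in `Cruxes/SwapGap/`, jobs j021016/j021018/j021019, N = 10⁴/10⁵/3·10⁵, 200/31/12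
pairs): the gases differ macroscopically only through a transport ratio `r = γ_Λ/γ_Φ = 1.060/1.075/1.087` (prediction 16/15 = 1.067);
the swap gap of the shear mode is the DIFFERENCE OF THE TWO VISCOUS DECREMENTS, `gap(0.3) = 0.0114/0.0111/0.0103 ≈ ½(r−1)(γ_Φt)e^{−γ_Φt}`
within 10 %, 4–8 % of Φ's own decrement; no anomalous channel (equal collision rates, conserved/odd modes gap-free); the `N^{-1/3}`
decay is NOT yet visible at fixed t in this range (crossover: `x e^{-x}` falls while `r_N − 1` rises) — forecast 0.008 at 10⁶ (jobs
j026864–j026868 pending, `--workitem`, auto-attached).  (c′) DICE GLUE LANDED p168923 (`…Theorems/LambertianContactSwapSwapGapOfDice`):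
`swapGap_of_dice : DiceContinuity (8723) → RareDiceEuler (8722) → LambertianEuler (11854) → SwapGap` — crux-strategist s2's
alternative line `dice-transfer`, whose composition the lead landed verbatim (registered stub `swapGap_of_dice`).  (d) FARM / v15: the gate build backlog
cleared at ≈01:00Z — the eight landed interface-stub modules T1 p127615, T3 p127472, T4 p127782, T5 p127332, T7 p127506, T9 p128287,
T13 p128776, T15 p129668 (+ tools p128997) are now IMPORTED and their registered names below are one-line theorems of this file
(`_root_.Summit.AtomisticToContinuum.HydrodynamicLimit.Theorems.<name>`); the file's `sorry`s are EXACTLY the four research stubs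
S1 `stub_relEntSwap`, S2 `stub_fieldConcentration`, S1ʳ′ `stub_echoMeanReturn`, S2ʳ `stub_detFieldConcentration` (12 → 4).

v12 (cycle 7, lead c6).  (a) BUILD: the route file `Theses/LambertianContactSwap.lean` has not elaborated since the D-0032 re-type of
the conjunct (21:23Z; `closes` `intro`s an `∃ η₀` goal — verified rc 1 on a verbatim copy); a 3-line repair
(`refine _root_.HydrodynamicLimit.of_unguarded ?_`) is verified (rc 0) and attached as evidence `closes-fixed-LambertianContactSwap.lean`
+ `BUILD-BLOCKER.md` for the planner; until it is applied no olean of this cone can be rebuilt, which is why the bodies of the LANDED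
stubs T1 p127615, T3 p127472, T4 p127782, T5 p127332, T7 p127506, T9 p128287, T13 p128776, T15 (tools p128997, main p129668 pending)
are still annotated `sorry` below; the D-0032-broken proof of record of `Assembly` (stmt-11856) is repaired (p130565, accepted).
(b) MATHEMATICS — §12 THE REVERSED ENTROPY LINE (new): in the direction `KL(q_t ‖ p_t)` the unknown Lambertian density drops out,
because `dp_t/dG_N = (dP_N/dG_N) ∘ Φ_{-t}` EXACTLY; T16 `stub_reversedDecomposition` (PROVED here and in
`…Theorems/…SwapGapReversedRelEnt.lean`): `KL(q_t ‖ p_t) + [KL(P_N ‖ G_N) − KL(q_t ‖ G_N)] = E_{P_N} L_N − E L_N(Φ_{-t} Λ_t)`,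
`L_N = llr P_N G_N` an explicit additive one-particle statistic — the ECHO DEFICIT of one observable, both brackets `≥ 0`.  Hence the
p-side research obligation becomes EXPLICIT and typable today: S1ʳ′ `stub_echoMeanReturn` (deficit/(N+1) → 0 pre-shock) ⟹ S1ʳ
`KL(q_t ‖ p_t) = o(N)` (T18 `stub_revRelEntSwap_of_echoMeanReturn`, PROVED) and ⟹ Λ-adiabaticity; the price is that the transfer now
runs from `q_t` to `p_t` and consumes speed-`N` concentration of the DETERMINISTIC gas, S2ʳ `stub_detFieldConcentration` (research):
T17 `stub_swapGap_of_revRelEntSwap_of_detFieldConcentration` (S1ʳ ∧ S2ʳ ⟹ SwapGap, provable now, wave 8) and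
`swapGap_of_stubs_reversed : SwapGap`.  Rungs (wave 8): T19/T20 (S1ʳ′ exact at `t = 0` / at equilibrium), T21/T22 (S2ʳ at `t = 0` /
at equilibrium, from R0).  Forward line unchanged: S1, S2 research (PROMOTE.md).
v13 (same cycle, after wave 8): ALL FIVE wave-8 stubs LANDED — T17 p131474, T19 p131409, T20 p131327, T21 p131628, T22 p131463 — and
T16+T18 landed as `…Theorems/LambertianContactSwapSwapGapReversedRelEnt.lean` p131129; their proofs are INLINED below (their modules cannot
be served until the route file is repaired), so §12 is kernel-closed inside this file modulo exactly the two research stubs S1ʳ′, S2ʳ: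
`swapGap_of_stubs_reversed : SwapGap` from `stub_echoMeanReturn` ∧ `stub_detFieldConcentration`.  Sorries: 12 nominal = 4 research
(S1, S2, S1ʳ′, S2ʳ) + 8 landed-but-unbuilt interface stubs of cycles 5–6 (T1 T3 T4 T5 T7 T9 T13 T15).

v11 (cycle 6, lead c5, wave 7).  Three NEW provable interface stubs (§11): T9 `stub_energyTightnessLambda` (exponential tightness of the
kinetic energy along `Λ` at EVERY rate, uniformly in `t` — ingredient (i) of any LD upper bound for `Λ`), T13 `stub_swapGap_of_smoothObservable`
(smooth compactly supported observables `F` suffice, given smooth tests; with T1: `swapGap_of_smoothObservable`), T15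
`stub_linearConcentration_of_fourierModes` (on the Λ-side the countable family of Fourier modes suffices; with T5, T7:
`fieldConcentration_of_fourierModes` — S2 ⟸ speed-`N` self-averaging of `(N+1)⁻¹∑ᵢ e_k(xᵢ)(1, vᵢ, ‖vᵢ‖²/2)`, `k ∈ ℤ³`).

v10 (cycle 6, lead c5, after wave 6).  LANDED this cycle: T1 `stub_swapGap_of_smoothTest` p127615, T3 `stub_swapGap_constTest` p127472,
T5 `stub_fieldConcentration_smooth_of_linear` p127332, T7 `stub_fieldConcentration_of_smoothTest` p127506 (their bodies below stay `sorry`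
ONLY until the farm serves those oleans — build backlog during the D-0032 rebuild — then become one-line imports); T4 RESHAPED (wave-6
verdict `stub-misstated`): the summit conjunct `_root_.HydrodynamicLimit` was RE-TYPED at 21:23Z (D-0032, packing guard `ρ_t(x)σ³ < η₀`),
so the mirror of `closes` is stated over the UNGUARDED Literature conjunct `Literature.MathematicalPhysics.KineticTheory.HydrodynamicLimit`
(= the conclusion type of the route's `MergingTransfer`, stmt-12099) — proof ready (wave 6), landed after this registration; §7 and the
§9 iff are restated over the Literature conjunct and proved WITHOUT the route file's `closes` (whose pre-retype proof term will not survive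
the rebuild: it `intro`s an `∃ η₀` goal) from `mergingTransfer_proof` + `localGibbsProbability_proof` + `swapGap_of_hydrodynamicLimit`.
NOTE FOR THE PLANNER/GATE: after the rebuild, `Theses/LambertianContactSwap.lean::closes` needs `HydrodynamicLimit.of_unguarded ∘
mergingTransfer_proof localGibbsProbability_proof`; p125008 (`…StubSwapGapIffHydrodynamicLimit`, `_root_`-typed) breaks and is superseded
by §7 here.  The crux `SwapGap` itself is untouched by D-0032 (the Euler solution enters it only through the `t = 0` hypothesis and the
time range), and so are S1, S2, T1–T3, T5, T7, G1–G3, R0–R3, T2, §8, §8b.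

v9 (cycle 6, lead c5).  T2 `stub_swapGap_of_rates` LANDED (p127011; its proof is copied here verbatim, and R3 p124782 stays re-proved from R0, until those oleans are served); §8b
`swapGap_of_relEntropyVanishing_of_lambertianEuler` (p126998: the crux from the EXISTING items stmt-0766 `TwoClocks.RelEntropyVanishing`
∧ stmt-11854) recorded.  Open `sorry`s: research S1, S2; c4's interface stubs T1, T3, T4 (provable now, wave 6); and two NEW Λ-side
interface stubs (§10, provable now, wave 6) that put S2 in the form a dynamical large/moderate-deviation proof for `Λ` would produce:
  - T5 `stub_fieldConcentration_smooth_of_linear` — for smooth `χ`, S2's concentration of EVERY bounded 1-Lipschitz statistic `F` of the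
    field triple follows from speed-`N` self-averaging of the FIVE LINEAR (additive) statistics `ρ_χ, m_χ ∈ V3, e_χ` of `Λ_t` about their
    means (`F` is 1-Lipschitz for the sup metric of `ℝ × V3 × ℝ`; union bound; `expConc_sub_integral_of_expConc_sub_const`);
  - T7 `stub_fieldConcentration_of_smoothTest` — S2 follows from S2 restricted to smooth `χ` (density of smooth functions in `C(𝕋³)`,
    the field triple is `‖χ − χ'‖_∞(1 + 2·KE)`-close, kinetic energy per particle does not increase along `Λ`
    (`configEnergy_lambertFlow_le`) and is exponentially concentrated under `P_N` (R0 / stmt-14445 with `χ ≡ 1`)).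
  Composition `fieldConcentration_of_linearSmooth`: LIN-smooth ⟹ S2, i.e. the Λ-side research obligation is exactly "speed-`N`
  concentration of `(N+1)⁻¹∑ᵢ χ(xᵢ)(1, vᵢ, ‖vᵢ‖²/2)` along the Lambertian gas for smooth `χ`" — additive functionals and smooth tests,
  the objects of an exponential-martingale / Feynman–Kac LD upper bound.

v8 (cycle 5, lead c4).  (a) Every stub that has LANDED is now IMPORTED and its registered name is a one-line theorem of this file
(v7 was a registration copy with sorried bodies): G1 p123753, G2 p123546, G3 p123586, R0 p124393, R1 p123936, R2 p124771, R3 p124782,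
§7 p125008.  The file's `sorry`s are exactly the two RESEARCH stubs S1 `stub_relEntSwap`, S2 `stub_fieldConcentration` (both
crux-sized, PROMOTE.md; given stmt-11854 the crux is EQUIVALENT to the conjunct, §7) plus the four NEW INTERFACE stubs of §9, all
provable now and fanned out to workers this cycle:
  - T1 `stub_swapGap_of_smoothTest`  — `SwapGap` follows from its restriction to test functions `χ` with smooth periodic lift
    (`Torus.IsSmooth χ`): Fourier density on `𝕋³` + the uniform kinetic-energy bound under local Gibbs laws + energy conservation /
    non-increase along `Φ` / `Λ` (the route's own "smooth-vs-continuous χ" layer-2 support, listed provable-now in the thesis);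
  - T2 `stub_swapGap_of_rates`       — the entropy transfer at MATCHED RATES: `KL(p_t‖q_t) = o(r_N)` and Lambertian deviation
    probabilities `≤ C e^{-r_N/C}` for one and the same `r_N → ∞` already give `SwapGap` (p106427 is `r_N = N + 1`); with the size
    heuristic `KL(p_t‖q_t) ≍ N·Kn² = Θ(N^{1/3})` (CORE_ANALYSIS.md) this lets a planner file the Λ-side at any speed above `N^{1/3}`
    (moderate deviations) instead of speed `N` (large deviations);
  - T3 `stub_swapGap_constTest`      — the crux's two integrals AGREE EXACTLY, for every `N`, when `χ` is constant (conserved modes: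
    mass, momentum, kinetic energy are invariants of both gases and `γ^ℕ` is a probability measure) — unit test of the normalisations;
  - T4 `stub_lambertianEuler_of_swapGap_of_hydrodynamicLimit` — mirror of the route's deciding theorem `closes`: `SwapGap` and the
    conjunct give stmt-11854; with `closes` and §7, UNDER `SwapGap` THE CONJUNCT AND stmt-11854 ARE EQUIVALENT.
(b) §8 `swapGap_of_randomFutureTransfer`: the crux from the EXISTING items stmt-11851 ∧ stmt-11852 ∧ stmt-11853 of route
LindebergRandomFuture (its `RandomFutureTransfer` is literally `SlabMomentumClosure → SlabEnergyClosure → SwapGap` and the two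
`SwapGap` copies are the same term).

STATE CARRIED OVER (all landed): composition `SwapGap ⇐ S1 ∧ S2` (p106427, c0); `S2 ⇐ LD` (p106600, c0); t = 0 instances (p106360, c0);
Λ-Liouville invariance S0 (p116909, c2); exact decomposition `k_N = a_N + b_N`, `O(N)` budget uniformly in `t`, echo form (p110251, p112072,
p112263, p115313, c1); Λ-adiabaticity `a_N → 0 ⇐ LambertianEuler ∧ DiluteSelfConsistency ∧ StaticBookkeeping` (p117295, p119962, c2);
`S1 ⇐ S1a ∧ UP`, `UP ⇐ S1` (p120224, c2); G1–G3, R0–R3, §7 (c3).  Research diagnosis (crux NOTES.md, CORE_ANALYSIS.md, PROMOTE.md):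
S1 needs the card's contact-flux production identity (a contact-trace API for N-body laws, not in the tree) + ContactAngleEquidistribution
(stmt-12097) + CollisionMomentBound (stmt-12102) + Λ-anisotropy locality; S2 needs a dynamical large-deviation (after T2: moderate-deviation)
upper bound for Λ (nothing in print at fixed reduced density).  Disproof used: none on file (`ledger crux ls`, 2026-08-16T21:00Z; again 23:10Z — payload disproof_path not mounted, no `Disproof.lean` in `Cruxes/SwapGap/`).
-/

noncomputable section

open MeasureTheory Filter Set Topology InformationTheory
open scoped ENNReal

namespace Summit.AtomisticToContinuum.HydrodynamicLimit.Cruxes.SwapGap.EntropyLine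

open Literature.Analysis.FluidPDE Literature.MathematicalPhysics.KineticTheory
open Summit.AtomisticToContinuum.HydrodynamicLimit.Theses.LambertianContactSwap
open Summit.AtomisticToContinuum.HydrodynamicLimit.Theorems
open Summit.AtomisticToContinuum.HydrodynamicLimit.Theorems.LambertianContactSwapSwapGapRelEntBudget
open Summit.AtomisticToContinuum.HydrodynamicLimit.Theorems.LambertianContactSwapLambertianEulerGibbsInvariance
open Summit.AtomisticToContinuum.HydrodynamicLimit.Theorems.LambertianContactSwapLambertianEulerEntropyBudget
open Summit.AtomisticToContinuum.HydrodynamicLimit.Theorems.LambertianContactSwapLambertianEulerWindow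
open Summit.AtomisticToContinuum.HydrodynamicLimit.Theorems.LambertianContactSwapLambertianEulerMarkov
open Summit.AtomisticToContinuum.HydrodynamicLimit.Theorems.LambertianContactSwapLambertianEulerIterate
open Summit.AtomisticToContinuum.HydrodynamicLimit.Theorems.LambertianContactSwapSwapGapGibbsDomination
open Summit.AtomisticToContinuum.HydrodynamicLimit.Theorems.LambertianContactSwapSwapGapDominatedKL

/-! ## §0 The sibling crux over the named Lambertian API (definitional restatement) -/

/-- The sibling crux `LambertianEuler` with its inline `let` block replaced by the tree's named Lambertian API
(`lambertFlow (Torus.geometry (Fin 3)) (hsDiameter σ N)`, `lambertNoise (Fin 3)`); definitionally the same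
statement (`lambertianEuler_iff_named`; copied from the sibling skeleton `Cruxes/LambertianEuler/Lines/Sketch.lean`). -/
def LambertianEulerNamed : Prop :=
  ∀ (a₀ θ₀ : T3 → ℝ) (u₀ : T3 → V3), Continuous a₀ → Continuous θ₀ → Continuous u₀ →
    (∀ x, 0 < a₀ x) → (∀ x, 0 < θ₀ x) →
    ∃ σ₀ : ℝ, 0 < σ₀ ∧ ∀ σ : ℝ, 0 < σ → σ < σ₀ →
      ∀ (T : ℝ) (ρ θ : ℝ → T3 → ℝ) (u : ℝ → T3 → V3), IsHardSphereEulerSolution σ T ρ u θ →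
        ∀ Φ : (N : ℕ) → HardSphereFlow (Torus.geometry (Fin 3)) (hsDiameter σ N) (N + 1),
          TendstoHydroFieldsAt (fun N => localGibbsLaw σ a₀ u₀ θ₀ N (Φ N)) Φ ρ u θ 0 →
            ∀ t ∈ Set.Ico 0 T, ∀ χ : T3 → ℝ, Continuous χ → ∀ δ > (0 : ℝ),
              Tendsto (fun N : ℕ => ((localGibbsLaw σ a₀ u₀ θ₀ N (Φ N)).prod (lambertNoise (Fin 3)))
                {p | δ < |empiricalDensityField
                  (lambertFlow (Torus.geometry (Fin 3)) (hsDiameter σ N) p.2 p.1 t) χ -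
                    ∫ x, χ x * ρ t x|}) atTop (nhds 0) ∧
              Tendsto (fun N : ℕ => ((localGibbsLaw σ a₀ u₀ θ₀ N (Φ N)).prod (lambertNoise (Fin 3)))
                {p | δ < ‖empiricalMomentumField
                  (lambertFlow (Torus.geometry (Fin 3)) (hsDiameter σ N) p.2 p.1 t) χ -
                    ∫ x, (χ x * ρ t x) • u t x‖}) atTop (nhds 0) ∧
              Tendsto (fun N : ℕ => ((localGibbsLaw σ a₀ u₀ θ₀ N (Φ N)).prod (lambertNoise (Fin 3)))
                {p | δ < |empiricalEnergyField
                  (lambertFlow (Torus.geometry (Fin 3)) (hsDiameter σ N) p.2 p.1 t) χ -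
                    ∫ x, χ x * totalEnergyDensity (ρ t x) (u t x) (θ t x)|}) atTop (nhds 0)

/-- The route decl and its named-API form are the same term. -/
theorem lambertianEuler_iff_named : LambertianEuler ↔ LambertianEulerNamed := Iff.rfl

/-! ## §1 Closed stub S0 (theorem of the tree) -/

/-- **S0 · `Λ`-INVARIANCE OF `liouville ⊗ γ^ℕ`** — CLOSED (p116909, `…SwapGapLiouvilleInvarianceLambda.stub_liouvilleInvarianceLambda`;
re-derived here from the sibling line's landed ITERATE/WINDOW/MARKOV so that the skeleton does not wait for that olean). -/
theorem stub_liouvilleInvarianceLambda :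
    ∀ ε : ℝ, 0 < ε → ε < 2⁻¹ → ∀ (N : ℕ) (t : ℝ), 0 ≤ t →
      ((liouville (Torus.geometry (Fin 3)) N ε).prod (lambertNoise (Fin 3))).map
          (fun p => lambertFlow (Torus.geometry (Fin 3)) ε p.2 p.1 t) =
        liouville (Torus.geometry (Fin 3)) N ε :=
  fun _ hε hε' _ t ht =>
    (stub_iterateLambda hε hε' (fun hV hδ hr hch => stub_windowLambda hε hV hδ hr hch)
      (fun z s hs _ r hr _ hQ _ hH => stub_markovLambda hε hε' z s hs r hr hQ hH)).1 t ht

/-! ## §2 The registered RESEARCH stubs (v6): S1 and S2 -/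

/-- **S1 · RELATIVE ENTROPY SWAP** (`stub_relEntSwap`; c0's stub, verbatim; THE CORE of the line — open, crux-sized): with the crux's
quantifier prefix, `KL(p_t ‖ q_t)/(N+1) → 0` in `ℝ≥0∞` for every `t ∈ [0, T)` (pre-shock): the deterministic law and the Lambertian
law started from the same local Gibbs data are `o(N)`-close in relative entropy.  Finite and `O(N)` uniformly in `t` for every `N`
(`klDiv_map_flow_map_lambertFlow_decomposition`); `= a_N + b_N` with `a_N → 0` a theorem modulo LD ∧ DSC (`lambdaAdiabaticity_of`,
p117295 + p119962), so modulo those it is EQUIVALENT to the one-sided likelihood gap UP (`likelihoodGapUpper_of_stubs` below, and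
`relEntSwap_of_upper`, p120224).  Echo form: `KL(P_N ‖ (Φ_{−t})_* q_t)/(N+1) → 0` (`klDiv_map_flow_map_lambertFlow_eq_echo`).
Strictly STRONGER than what the transfer consumes (S1″ below, `stub_fieldRelEntSwap_of_relEntSwap`). -/
theorem stub_relEntSwap :
    ∀ (a₀ θ₀ : T3 → ℝ) (u₀ : T3 → V3), Continuous a₀ → Continuous θ₀ → Continuous u₀ →
      (∀ x, 0 < a₀ x) → (∀ x, 0 < θ₀ x) →
      ∃ σ₀ : ℝ, 0 < σ₀ ∧ ∀ σ : ℝ, 0 < σ → σ < σ₀ →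
        ∀ (T : ℝ) (ρ θ : ℝ → T3 → ℝ) (u : ℝ → T3 → V3), IsHardSphereEulerSolution σ T ρ u θ →
          ∀ Φ : (N : ℕ) → HardSphereFlow (Torus.geometry (Fin 3)) (hsDiameter σ N) (N + 1),
            TendstoHydroFieldsAt (fun N => localGibbsLaw σ a₀ u₀ θ₀ N (Φ N)) Φ ρ u θ 0 →
              ∀ t ∈ Set.Ico 0 T,
                Tendsto (fun N : ℕ =>
                  klDiv ((localGibbsLaw σ a₀ u₀ θ₀ N (Φ N)).map ((Φ N).flow t))
                    (((localGibbsLaw σ a₀ u₀ θ₀ N (Φ N)).prod (lambertNoise (Fin 3))).map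
                      (fun p => lambertFlow (Torus.geometry (Fin 3)) (hsDiameter σ N) p.2 p.1 t)) /
                  ((N : ℝ≥0∞) + 1)) atTop (𝓝 0) := by
  sorry

/-- **S2 · FIELD CONCENTRATION FOR THE LAMBERTIAN GAS** (`stub_fieldConcentration`; c0's stub S2, verbatim the second hypothesis of
the landed composition `swapGap_of_relEntSwap_of_fieldConcentration`, p106427 — open, crux-sized, Λ ONLY and EULER-FREE): with the
crux's quantifier prefix, for every continuous `χ`, every 1-Lipschitz `F : ℝ × V3 × ℝ → ℝ` bounded by `1` and every `δ > 0` there is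
`C > 0` such that for all `N` the `P_N ⊗ γ^ℕ`-probability that `F` of the `χ`-tested field triple of `Λ_t` deviates by more than `δ`
from ITS OWN MEAN is at most `C e^{-(N+1)/C}` (speed-`N` self-averaging; no hydrodynamic equation is mentioned).  Relations
(kernel-checked): `S2 ⇐ LD` (`fieldConcentration_of_LD`, p106600) and `LD ⇐ LambertianEuler ∧ S2` (`stub_LD_of_euler_of_fieldConcentration`),
i.e. given the sibling crux stmt-11854, S2 ⟺ v5's exponential-rate Euler for Λ.  Status: c0's wave-1 worker verdict `stub-blocked`
(no dynamical large-deviation upper bound for Λ in print or in the tree) stands. -/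
theorem stub_fieldConcentration :
    ∀ (a₀ θ₀ : T3 → ℝ) (u₀ : T3 → V3), Continuous a₀ → Continuous θ₀ → Continuous u₀ →
      (∀ x, 0 < a₀ x) → (∀ x, 0 < θ₀ x) →
      ∃ σ₀ : ℝ, 0 < σ₀ ∧ ∀ σ : ℝ, 0 < σ → σ < σ₀ →
        ∀ (T : ℝ) (ρ θ : ℝ → T3 → ℝ) (u : ℝ → T3 → V3), IsHardSphereEulerSolution σ T ρ u θ →
          ∀ Φ : (N : ℕ) → HardSphereFlow (Torus.geometry (Fin 3)) (hsDiameter σ N) (N + 1),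
            TendstoHydroFieldsAt (fun N => localGibbsLaw σ a₀ u₀ θ₀ N (Φ N)) Φ ρ u θ 0 →
              ∀ t ∈ Set.Ico 0 T, ∀ χ : T3 → ℝ, Continuous χ →
                ∀ F : ℝ × V3 × ℝ → ℝ, LipschitzWith 1 F → (∀ y, |F y| ≤ 1) → ∀ δ : ℝ, 0 < δ →
                  ∃ C : ℝ, 0 < C ∧ ∀ N : ℕ,
                    ((localGibbsLaw σ a₀ u₀ θ₀ N (Φ N)).prod (lambertNoise (Fin 3)))
                      {p | δ < |F (empiricalDensityField
                              (lambertFlow (Torus.geometry (Fin 3)) (hsDiameter σ N) p.2 p.1 t) χ,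
                            empiricalMomentumField
                              (lambertFlow (Torus.geometry (Fin 3)) (hsDiameter σ N) p.2 p.1 t) χ,
                            empiricalEnergyField
                              (lambertFlow (Torus.geometry (Fin 3)) (hsDiameter σ N) p.2 p.1 t) χ) -
                          ∫ q, F (empiricalDensityField
                              (lambertFlow (Torus.geometry (Fin 3)) (hsDiameter σ N) q.2 q.1 t) χ,
                            empiricalMomentumField
                              (lambertFlow (Torus.geometry (Fin 3)) (hsDiameter σ N) q.2 q.1 t) χ,
                            empiricalEnergyField
                              (lambertFlow (Torus.geometry (Fin 3)) (hsDiameter σ N) q.2 q.1 t) χ)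
                            ∂((localGibbsLaw σ a₀ u₀ θ₀ N (Φ N)).prod (lambertNoise (Fin 3)))|} ≤
                      ENNReal.ofReal (C * Real.exp (-(C⁻¹ * ((N : ℝ) + 1)))) := by
  sorry

/-! ## §3 The glue stubs of v6 — LANDED (wave 4: p123586, p123546, p123753) and IMPORTED (v8), kept under their registered names -/

/-- **G3 · S1 ⟹ S1″** (`stub_fieldRelEntSwap_of_relEntSwap`; glue — LANDED p123586, here a one-line consequence of `…Theorems.stub_fieldRelEntSwap_of_relEntSwap`): the `o(N)` relative entropy of the full
`N`-body laws (S1) gives the `o(N)` relative entropy of the laws of the `χ`-tested field triple (S1″ = `FieldRelEntSwap`), by the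
data-processing inequality for the measurable map `z ↦ (ρ_χ, m_χ, e_χ)(z)` (`Literature.Probability.Entropy.klDiv_comp_le` with a
deterministic kernel; the phase space is standard Borel, `standardBorelSpace_config`) and `Measure.map_map`. [folklore] -/
theorem stub_fieldRelEntSwap_of_relEntSwap
    (hS1 :
    ∀ (a₀ θ₀ : T3 → ℝ) (u₀ : T3 → V3), Continuous a₀ → Continuous θ₀ → Continuous u₀ →
      (∀ x, 0 < a₀ x) → (∀ x, 0 < θ₀ x) →
      ∃ σ₀ : ℝ, 0 < σ₀ ∧ ∀ σ : ℝ, 0 < σ → σ < σ₀ →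
        ∀ (T : ℝ) (ρ θ : ℝ → T3 → ℝ) (u : ℝ → T3 → V3), IsHardSphereEulerSolution σ T ρ u θ →
          ∀ Φ : (N : ℕ) → HardSphereFlow (Torus.geometry (Fin 3)) (hsDiameter σ N) (N + 1),
            TendstoHydroFieldsAt (fun N => localGibbsLaw σ a₀ u₀ θ₀ N (Φ N)) Φ ρ u θ 0 →
              ∀ t ∈ Set.Ico 0 T,
                Tendsto (fun N : ℕ =>
                  klDiv ((localGibbsLaw σ a₀ u₀ θ₀ N (Φ N)).map ((Φ N).flow t))
                    (((localGibbsLaw σ a₀ u₀ θ₀ N (Φ N)).prod (lambertNoise (Fin 3))).map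
                      (fun p => lambertFlow (Torus.geometry (Fin 3)) (hsDiameter σ N) p.2 p.1 t)) /
                  ((N : ℝ≥0∞) + 1)) atTop (𝓝 0)) :
    ∀ (a₀ θ₀ : T3 → ℝ) (u₀ : T3 → V3), Continuous a₀ → Continuous θ₀ → Continuous u₀ →
      (∀ x, 0 < a₀ x) → (∀ x, 0 < θ₀ x) →
      ∃ σ₀ : ℝ, 0 < σ₀ ∧ ∀ σ : ℝ, 0 < σ → σ < σ₀ →
        ∀ (T : ℝ) (ρ θ : ℝ → T3 → ℝ) (u : ℝ → T3 → V3), IsHardSphereEulerSolution σ T ρ u θ →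
          ∀ Φ : (N : ℕ) → HardSphereFlow (Torus.geometry (Fin 3)) (hsDiameter σ N) (N + 1),
            TendstoHydroFieldsAt (fun N => localGibbsLaw σ a₀ u₀ θ₀ N (Φ N)) Φ ρ u θ 0 →
              ∀ t ∈ Set.Ico 0 T, ∀ χ : T3 → ℝ, Continuous χ →
                Tendsto (fun N : ℕ =>
                  klDiv
                    ((localGibbsLaw σ a₀ u₀ θ₀ N (Φ N)).map (fun z =>
                      (empiricalDensityField ((Φ N).flow t z) χ,
                        empiricalMomentumField ((Φ N).flow t z) χ,
                        empiricalEnergyField ((Φ N).flow t z) χ)))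
                    (((localGibbsLaw σ a₀ u₀ θ₀ N (Φ N)).prod (lambertNoise (Fin 3))).map (fun p =>
                      (empiricalDensityField
                          (lambertFlow (Torus.geometry (Fin 3)) (hsDiameter σ N) p.2 p.1 t) χ,
                        empiricalMomentumField
                          (lambertFlow (Torus.geometry (Fin 3)) (hsDiameter σ N) p.2 p.1 t) χ,
                        empiricalEnergyField
                          (lambertFlow (Torus.geometry (Fin 3)) (hsDiameter σ N) p.2 p.1 t) χ))) /
                  ((N : ℝ≥0∞) + 1)) atTop (𝓝 0) :=
  _root_.Summit.AtomisticToContinuum.HydrodynamicLimit.Theorems.stub_fieldRelEntSwap_of_relEntSwap hS1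

/-- **G2 · S1″ ∧ S2 ⟹ SwapGap** (`stub_swapGap_of_fieldRelEntSwap_of_fieldConcentration`; glue — LANDED p123546, `…Theorems.stub_swapGap_of_fieldRelEntSwap_of_fieldConcentration`): the transfer of the
line run on `ℝ × V3 × ℝ` instead of the `N`-body phase space — with `μ_N`, `ν_N` the laws of the field triple at time `t` under the
deterministic and the Lambertian gas, `G := F`, `m_N := ∫ F dν_N` (= the crux's Lambertian term by `integral_map`), S2 gives
`ν_N{δ < |F − m_N|} ≤ C e^{−(N+1)/C}`, S1″ gives `KL(μ_N ‖ ν_N)/(N+1) → 0`, the entropy inequality for events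
(`tendsto_measure_of_klDiv_div_tendsto_zero`, arbitrary measurable spaces) gives `P_N{δ < |F(fld(Φ_t z)) − m_N|} = μ_N{…} → 0`, and
`tendsto_integral_sub_of_tendsto_measure` gives the merging of the means; cf. the `N`-body version p106427.
[cite: KipnisLandim1999, Ch. 6 §1] -/
theorem stub_swapGap_of_fieldRelEntSwap_of_fieldConcentration
    (h1 :
    ∀ (a₀ θ₀ : T3 → ℝ) (u₀ : T3 → V3), Continuous a₀ → Continuous θ₀ → Continuous u₀ →
      (∀ x, 0 < a₀ x) → (∀ x, 0 < θ₀ x) →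
      ∃ σ₀ : ℝ, 0 < σ₀ ∧ ∀ σ : ℝ, 0 < σ → σ < σ₀ →
        ∀ (T : ℝ) (ρ θ : ℝ → T3 → ℝ) (u : ℝ → T3 → V3), IsHardSphereEulerSolution σ T ρ u θ →
          ∀ Φ : (N : ℕ) → HardSphereFlow (Torus.geometry (Fin 3)) (hsDiameter σ N) (N + 1),
            TendstoHydroFieldsAt (fun N => localGibbsLaw σ a₀ u₀ θ₀ N (Φ N)) Φ ρ u θ 0 →
              ∀ t ∈ Set.Ico 0 T, ∀ χ : T3 → ℝ, Continuous χ →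
                Tendsto (fun N : ℕ =>
                  klDiv
                    ((localGibbsLaw σ a₀ u₀ θ₀ N (Φ N)).map (fun z =>
                      (empiricalDensityField ((Φ N).flow t z) χ,
                        empiricalMomentumField ((Φ N).flow t z) χ,
                        empiricalEnergyField ((Φ N).flow t z) χ)))
                    (((localGibbsLaw σ a₀ u₀ θ₀ N (Φ N)).prod (lambertNoise (Fin 3))).map (fun p =>
                      (empiricalDensityField
                          (lambertFlow (Torus.geometry (Fin 3)) (hsDiameter σ N) p.2 p.1 t) χ,
                        empiricalMomentumField
                          (lambertFlow (Torus.geometry (Fin 3)) (hsDiameter σ N) p.2 p.1 t) χ,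
                        empiricalEnergyField
                          (lambertFlow (Torus.geometry (Fin 3)) (hsDiameter σ N) p.2 p.1 t) χ))) /
                  ((N : ℝ≥0∞) + 1)) atTop (𝓝 0)) 
    (h2 :
    ∀ (a₀ θ₀ : T3 → ℝ) (u₀ : T3 → V3), Continuous a₀ → Continuous θ₀ → Continuous u₀ →
      (∀ x, 0 < a₀ x) → (∀ x, 0 < θ₀ x) →
      ∃ σ₀ : ℝ, 0 < σ₀ ∧ ∀ σ : ℝ, 0 < σ → σ < σ₀ →
        ∀ (T : ℝ) (ρ θ : ℝ → T3 → ℝ) (u : ℝ → T3 → V3), IsHardSphereEulerSolution σ T ρ u θ →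
          ∀ Φ : (N : ℕ) → HardSphereFlow (Torus.geometry (Fin 3)) (hsDiameter σ N) (N + 1),
            TendstoHydroFieldsAt (fun N => localGibbsLaw σ a₀ u₀ θ₀ N (Φ N)) Φ ρ u θ 0 →
              ∀ t ∈ Set.Ico 0 T, ∀ χ : T3 → ℝ, Continuous χ →
                ∀ F : ℝ × V3 × ℝ → ℝ, LipschitzWith 1 F → (∀ y, |F y| ≤ 1) → ∀ δ : ℝ, 0 < δ →
                  ∃ C : ℝ, 0 < C ∧ ∀ N : ℕ,
                    ((localGibbsLaw σ a₀ u₀ θ₀ N (Φ N)).prod (lambertNoise (Fin 3)))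
                      {p | δ < |F (empiricalDensityField
                              (lambertFlow (Torus.geometry (Fin 3)) (hsDiameter σ N) p.2 p.1 t) χ,
                            empiricalMomentumField
                              (lambertFlow (Torus.geometry (Fin 3)) (hsDiameter σ N) p.2 p.1 t) χ,
                            empiricalEnergyField
                              (lambertFlow (Torus.geometry (Fin 3)) (hsDiameter σ N) p.2 p.1 t) χ) -
                          ∫ q, F (empiricalDensityField
                              (lambertFlow (Torus.geometry (Fin 3)) (hsDiameter σ N) q.2 q.1 t) χ,
                            empiricalMomentumField
                              (lambertFlow (Torus.geometry (Fin 3)) (hsDiameter σ N) q.2 q.1 t) χ,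
                            empiricalEnergyField
                              (lambertFlow (Torus.geometry (Fin 3)) (hsDiameter σ N) q.2 q.1 t) χ)
                            ∂((localGibbsLaw σ a₀ u₀ θ₀ N (Φ N)).prod (lambertNoise (Fin 3)))|} ≤
                      ENNReal.ofReal (C * Real.exp (-(C⁻¹ * ((N : ℝ) + 1))))) :
    SwapGap :=
  _root_.Summit.AtomisticToContinuum.HydrodynamicLimit.Theorems.stub_swapGap_of_fieldRelEntSwap_of_fieldConcentration h1 h2

/-- **G1 · LambertianEuler ∧ S2 ⟹ LD** (`stub_LD_of_euler_of_fieldConcentration`; glue — LANDED p123753, `…Theorems.stub_LD_of_euler_of_fieldConcentration`): convergence in probability of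
Λ's fields to the Euler values (the sibling crux stmt-11854 in its named form, written out) upgrades to the exponential rate of v5's
`stub_lambertianEulerLD` as soon as the fields self-average at speed `N` (S2): for the density field take the fixed 1-Lipschitz,
`[−1,1]`-valued `F(d, m, e) := max (−1) (min 1 (d − ∫χρ_t))` (the Euler value does not depend on `N`); LambertianEuler gives
`m_N := ∫ F(fld(Λ_t)) d(P_N ⊗ γ^ℕ) → 0` (bounded convergence in probability on probability spaces), so for `N ≥ N₀`,
`{δ < |d − ∫χρ_t|} ⊆ {δ₁/2 < |F − m_N|}` with `δ₁ := min δ 2⁻¹`, and S2 at `(F, δ₁/2)` gives the bound; the finitely many `N < N₀` are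
absorbed into the constant (`UniformLGC.Kexp_le_Kexp`, cf. `expConc_sub_integral_of_expConc_sub_const`); likewise momentum
(`F := min 1 ‖m − ∫χρ_t u_t‖`) and energy. [folklore] -/
theorem stub_LD_of_euler_of_fieldConcentration
    (hL :
  ∀ (a₀ θ₀ : T3 → ℝ) (u₀ : T3 → V3), Continuous a₀ → Continuous θ₀ → Continuous u₀ →
    (∀ x, 0 < a₀ x) → (∀ x, 0 < θ₀ x) →
    ∃ σ₀ : ℝ, 0 < σ₀ ∧ ∀ σ : ℝ, 0 < σ → σ < σ₀ →
      ∀ (T : ℝ) (ρ θ : ℝ → T3 → ℝ) (u : ℝ → T3 → V3), IsHardSphereEulerSolution σ T ρ u θ →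
        ∀ Φ : (N : ℕ) → HardSphereFlow (Torus.geometry (Fin 3)) (hsDiameter σ N) (N + 1),
          TendstoHydroFieldsAt (fun N => localGibbsLaw σ a₀ u₀ θ₀ N (Φ N)) Φ ρ u θ 0 →
            ∀ t ∈ Set.Ico 0 T, ∀ χ : T3 → ℝ, Continuous χ → ∀ δ > (0 : ℝ),
              Tendsto (fun N : ℕ => ((localGibbsLaw σ a₀ u₀ θ₀ N (Φ N)).prod (lambertNoise (Fin 3)))
                {p | δ < |empiricalDensityField
                  (lambertFlow (Torus.geometry (Fin 3)) (hsDiameter σ N) p.2 p.1 t) χ -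
                    ∫ x, χ x * ρ t x|}) atTop (nhds 0) ∧
              Tendsto (fun N : ℕ => ((localGibbsLaw σ a₀ u₀ θ₀ N (Φ N)).prod (lambertNoise (Fin 3)))
                {p | δ < ‖empiricalMomentumField
                  (lambertFlow (Torus.geometry (Fin 3)) (hsDiameter σ N) p.2 p.1 t) χ -
                    ∫ x, (χ x * ρ t x) • u t x‖}) atTop (nhds 0) ∧
              Tendsto (fun N : ℕ => ((localGibbsLaw σ a₀ u₀ θ₀ N (Φ N)).prod (lambertNoise (Fin 3)))
                {p | δ < |empiricalEnergyField
                  (lambertFlow (Torus.geometry (Fin 3)) (hsDiameter σ N) p.2 p.1 t) χ -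
                    ∫ x, χ x * totalEnergyDensity (ρ t x) (u t x) (θ t x)|}) atTop (nhds 0)) 
    (h2 :
    ∀ (a₀ θ₀ : T3 → ℝ) (u₀ : T3 → V3), Continuous a₀ → Continuous θ₀ → Continuous u₀ →
      (∀ x, 0 < a₀ x) → (∀ x, 0 < θ₀ x) →
      ∃ σ₀ : ℝ, 0 < σ₀ ∧ ∀ σ : ℝ, 0 < σ → σ < σ₀ →
        ∀ (T : ℝ) (ρ θ : ℝ → T3 → ℝ) (u : ℝ → T3 → V3), IsHardSphereEulerSolution σ T ρ u θ →
          ∀ Φ : (N : ℕ) → HardSphereFlow (Torus.geometry (Fin 3)) (hsDiameter σ N) (N + 1),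
            TendstoHydroFieldsAt (fun N => localGibbsLaw σ a₀ u₀ θ₀ N (Φ N)) Φ ρ u θ 0 →
              ∀ t ∈ Set.Ico 0 T, ∀ χ : T3 → ℝ, Continuous χ →
                ∀ F : ℝ × V3 × ℝ → ℝ, LipschitzWith 1 F → (∀ y, |F y| ≤ 1) → ∀ δ : ℝ, 0 < δ →
                  ∃ C : ℝ, 0 < C ∧ ∀ N : ℕ,
                    ((localGibbsLaw σ a₀ u₀ θ₀ N (Φ N)).prod (lambertNoise (Fin 3)))
                      {p | δ < |F (empiricalDensityField
                              (lambertFlow (Torus.geometry (Fin 3)) (hsDiameter σ N) p.2 p.1 t) χ,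
                            empiricalMomentumField
                              (lambertFlow (Torus.geometry (Fin 3)) (hsDiameter σ N) p.2 p.1 t) χ,
                            empiricalEnergyField
                              (lambertFlow (Torus.geometry (Fin 3)) (hsDiameter σ N) p.2 p.1 t) χ) -
                          ∫ q, F (empiricalDensityField
                              (lambertFlow (Torus.geometry (Fin 3)) (hsDiameter σ N) q.2 q.1 t) χ,
                            empiricalMomentumField
                              (lambertFlow (Torus.geometry (Fin 3)) (hsDiameter σ N) q.2 q.1 t) χ,
                            empiricalEnergyField
                              (lambertFlow (Torus.geometry (Fin 3)) (hsDiameter σ N) q.2 q.1 t) χ)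
                            ∂((localGibbsLaw σ a₀ u₀ θ₀ N (Φ N)).prod (lambertNoise (Fin 3)))|} ≤
                      ENNReal.ofReal (C * Real.exp (-(C⁻¹ * ((N : ℝ) + 1))))) :
    ∀ (a₀ θ₀ : T3 → ℝ) (u₀ : T3 → V3), Continuous a₀ → Continuous θ₀ → Continuous u₀ →
      (∀ x, 0 < a₀ x) → (∀ x, 0 < θ₀ x) →
      ∃ σ₀ : ℝ, 0 < σ₀ ∧ ∀ σ : ℝ, 0 < σ → σ < σ₀ →
        ∀ (T : ℝ) (ρ θ : ℝ → T3 → ℝ) (u : ℝ → T3 → V3), IsHardSphereEulerSolution σ T ρ u θ →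
          ∀ Φ : (N : ℕ) → HardSphereFlow (Torus.geometry (Fin 3)) (hsDiameter σ N) (N + 1),
            TendstoHydroFieldsAt (fun N => localGibbsLaw σ a₀ u₀ θ₀ N (Φ N)) Φ ρ u θ 0 →
              ∀ t ∈ Set.Ico 0 T, ∀ χ : T3 → ℝ, Continuous χ → ∀ δ : ℝ, 0 < δ →
                ∃ C : ℝ, 0 < C ∧ ∀ N : ℕ,
                  ((localGibbsLaw σ a₀ u₀ θ₀ N (Φ N)).prod (lambertNoise (Fin 3)))
                      {p | δ < |empiricalDensityField
                          (lambertFlow (Torus.geometry (Fin 3)) (hsDiameter σ N) p.2 p.1 t) χ -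
                        ∫ x, χ x * ρ t x|} ≤
                    ENNReal.ofReal (C * Real.exp (-(C⁻¹ * ((N : ℝ) + 1)))) ∧
                  ((localGibbsLaw σ a₀ u₀ θ₀ N (Φ N)).prod (lambertNoise (Fin 3)))
                      {p | δ < ‖empiricalMomentumField
                          (lambertFlow (Torus.geometry (Fin 3)) (hsDiameter σ N) p.2 p.1 t) χ -
                        ∫ x, (χ x * ρ t x) • u t x‖} ≤
                    ENNReal.ofReal (C * Real.exp (-(C⁻¹ * ((N : ℝ) + 1)))) ∧
                  ((localGibbsLaw σ a₀ u₀ θ₀ N (Φ N)).prod (lambertNoise (Fin 3)))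
                      {p | δ < |empiricalEnergyField
                          (lambertFlow (Torus.geometry (Fin 3)) (hsDiameter σ N) p.2 p.1 t) χ -
                        ∫ x, χ x * totalEnergyDensity (ρ t x) (u t x) (θ t x)|} ≤
                    ENNReal.ofReal (C * Real.exp (-(C⁻¹ * ((N : ℝ) + 1)))) :=
  _root_.Summit.AtomisticToContinuum.HydrodynamicLimit.Theorems.stub_LD_of_euler_of_fieldConcentration hL h2

/-! ## §4 Derived statements (proved) -/

/-- **Exponential-rate Euler for `Λ` gives Euler for `Λ`** (`C e^{-(N+1)/C} → 0`). [folklore] -/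
theorem lambertianEulerNamed_of_LD
    (hLD : ∀ (a₀ θ₀ : T3 → ℝ) (u₀ : T3 → V3), Continuous a₀ → Continuous θ₀ → Continuous u₀ →
      (∀ x, 0 < a₀ x) → (∀ x, 0 < θ₀ x) →
      ∃ σ₀ : ℝ, 0 < σ₀ ∧ ∀ σ : ℝ, 0 < σ → σ < σ₀ →
        ∀ (T : ℝ) (ρ θ : ℝ → T3 → ℝ) (u : ℝ → T3 → V3), IsHardSphereEulerSolution σ T ρ u θ →
          ∀ Φ : (N : ℕ) → HardSphereFlow (Torus.geometry (Fin 3)) (hsDiameter σ N) (N + 1),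
            TendstoHydroFieldsAt (fun N => localGibbsLaw σ a₀ u₀ θ₀ N (Φ N)) Φ ρ u θ 0 →
              ∀ t ∈ Set.Ico 0 T, ∀ χ : T3 → ℝ, Continuous χ → ∀ δ : ℝ, 0 < δ →
                ∃ C : ℝ, 0 < C ∧ ∀ N : ℕ,
                  ((localGibbsLaw σ a₀ u₀ θ₀ N (Φ N)).prod (lambertNoise (Fin 3)))
                      {p | δ < |empiricalDensityField
                          (lambertFlow (Torus.geometry (Fin 3)) (hsDiameter σ N) p.2 p.1 t) χ -
                        ∫ x, χ x * ρ t x|} ≤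
                    ENNReal.ofReal (C * Real.exp (-(C⁻¹ * ((N : ℝ) + 1)))) ∧
                  ((localGibbsLaw σ a₀ u₀ θ₀ N (Φ N)).prod (lambertNoise (Fin 3)))
                      {p | δ < ‖empiricalMomentumField
                          (lambertFlow (Torus.geometry (Fin 3)) (hsDiameter σ N) p.2 p.1 t) χ -
                        ∫ x, (χ x * ρ t x) • u t x‖} ≤
                    ENNReal.ofReal (C * Real.exp (-(C⁻¹ * ((N : ℝ) + 1)))) ∧
                  ((localGibbsLaw σ a₀ u₀ θ₀ N (Φ N)).prod (lambertNoise (Fin 3)))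
                      {p | δ < |empiricalEnergyField
                          (lambertFlow (Torus.geometry (Fin 3)) (hsDiameter σ N) p.2 p.1 t) χ -
                        ∫ x, χ x * totalEnergyDensity (ρ t x) (u t x) (θ t x)|} ≤
                    ENNReal.ofReal (C * Real.exp (-(C⁻¹ * ((N : ℝ) + 1))))) :
    LambertianEulerNamed := by
  intro a₀ θ₀ u₀ ha hθ hu ha0 hθ0
  obtain ⟨σ₀, hσ₀, h⟩ := hLD a₀ θ₀ u₀ ha hθ hu ha0 hθ0
  refine ⟨σ₀, hσ₀, ?_⟩
  intro σ hσ hσlt T ρ θ u hE Φ h0 t ht χ hχ δ hδ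
  obtain ⟨C, hC, hN⟩ := h σ hσ hσlt T ρ θ u hE Φ h0 t ht χ hχ δ hδ
  have hexp : Tendsto (fun N : ℕ => ENNReal.ofReal (C * Real.exp (-(C⁻¹ * ((N : ℝ) + 1)))))
      atTop (𝓝 0) := by
    have h := ENNReal.tendsto_ofReal (tendsto_const_mul_exp_neg_succ C hC)
    rwa [ENNReal.ofReal_zero] at h
  exact ⟨tendsto_of_tendsto_of_tendsto_of_le_of_le tendsto_const_nhds hexp (fun _ => zero_le)
      fun N => (hN N).1,
    tendsto_of_tendsto_of_tendsto_of_le_of_le tendsto_const_nhds hexp (fun _ => zero_le)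
      fun N => (hN N).2.1,
    tendsto_of_tendsto_of_tendsto_of_le_of_le tendsto_const_nhds hexp (fun _ => zero_le)
      fun N => (hN N).2.2⟩

/-- **S2 ⟸ LD** — the landed reduction `fieldConcentration_of_lambertianEulerLD` (p106600), restated over the registered signatures. -/
theorem fieldConcentration_of_LD
    (hLD :
    ∀ (a₀ θ₀ : T3 → ℝ) (u₀ : T3 → V3), Continuous a₀ → Continuous θ₀ → Continuous u₀ →
      (∀ x, 0 < a₀ x) → (∀ x, 0 < θ₀ x) →
      ∃ σ₀ : ℝ, 0 < σ₀ ∧ ∀ σ : ℝ, 0 < σ → σ < σ₀ →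
        ∀ (T : ℝ) (ρ θ : ℝ → T3 → ℝ) (u : ℝ → T3 → V3), IsHardSphereEulerSolution σ T ρ u θ →
          ∀ Φ : (N : ℕ) → HardSphereFlow (Torus.geometry (Fin 3)) (hsDiameter σ N) (N + 1),
            TendstoHydroFieldsAt (fun N => localGibbsLaw σ a₀ u₀ θ₀ N (Φ N)) Φ ρ u θ 0 →
              ∀ t ∈ Set.Ico 0 T, ∀ χ : T3 → ℝ, Continuous χ → ∀ δ : ℝ, 0 < δ →
                ∃ C : ℝ, 0 < C ∧ ∀ N : ℕ,
                  ((localGibbsLaw σ a₀ u₀ θ₀ N (Φ N)).prod (lambertNoise (Fin 3)))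
                      {p | δ < |empiricalDensityField
                          (lambertFlow (Torus.geometry (Fin 3)) (hsDiameter σ N) p.2 p.1 t) χ -
                        ∫ x, χ x * ρ t x|} ≤
                    ENNReal.ofReal (C * Real.exp (-(C⁻¹ * ((N : ℝ) + 1)))) ∧
                  ((localGibbsLaw σ a₀ u₀ θ₀ N (Φ N)).prod (lambertNoise (Fin 3)))
                      {p | δ < ‖empiricalMomentumField
                          (lambertFlow (Torus.geometry (Fin 3)) (hsDiameter σ N) p.2 p.1 t) χ -
                        ∫ x, (χ x * ρ t x) • u t x‖} ≤
                    ENNReal.ofReal (C * Real.exp (-(C⁻¹ * ((N : ℝ) + 1)))) ∧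
                  ((localGibbsLaw σ a₀ u₀ θ₀ N (Φ N)).prod (lambertNoise (Fin 3)))
                      {p | δ < |empiricalEnergyField
                          (lambertFlow (Torus.geometry (Fin 3)) (hsDiameter σ N) p.2 p.1 t) χ -
                        ∫ x, χ x * totalEnergyDensity (ρ t x) (u t x) (θ t x)|} ≤
                    ENNReal.ofReal (C * Real.exp (-(C⁻¹ * ((N : ℝ) + 1))))) :
    ∀ (a₀ θ₀ : T3 → ℝ) (u₀ : T3 → V3), Continuous a₀ → Continuous θ₀ → Continuous u₀ →
      (∀ x, 0 < a₀ x) → (∀ x, 0 < θ₀ x) →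
      ∃ σ₀ : ℝ, 0 < σ₀ ∧ ∀ σ : ℝ, 0 < σ → σ < σ₀ →
        ∀ (T : ℝ) (ρ θ : ℝ → T3 → ℝ) (u : ℝ → T3 → V3), IsHardSphereEulerSolution σ T ρ u θ →
          ∀ Φ : (N : ℕ) → HardSphereFlow (Torus.geometry (Fin 3)) (hsDiameter σ N) (N + 1),
            TendstoHydroFieldsAt (fun N => localGibbsLaw σ a₀ u₀ θ₀ N (Φ N)) Φ ρ u θ 0 →
              ∀ t ∈ Set.Ico 0 T, ∀ χ : T3 → ℝ, Continuous χ →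
                ∀ F : ℝ × V3 × ℝ → ℝ, LipschitzWith 1 F → (∀ y, |F y| ≤ 1) → ∀ δ : ℝ, 0 < δ →
                  ∃ C : ℝ, 0 < C ∧ ∀ N : ℕ,
                    ((localGibbsLaw σ a₀ u₀ θ₀ N (Φ N)).prod (lambertNoise (Fin 3)))
                      {p | δ < |F (empiricalDensityField
                              (lambertFlow (Torus.geometry (Fin 3)) (hsDiameter σ N) p.2 p.1 t) χ,
                            empiricalMomentumField
                              (lambertFlow (Torus.geometry (Fin 3)) (hsDiameter σ N) p.2 p.1 t) χ,
                            empiricalEnergyField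
                              (lambertFlow (Torus.geometry (Fin 3)) (hsDiameter σ N) p.2 p.1 t) χ) -
                          ∫ q, F (empiricalDensityField
                              (lambertFlow (Torus.geometry (Fin 3)) (hsDiameter σ N) q.2 q.1 t) χ,
                            empiricalMomentumField
                              (lambertFlow (Torus.geometry (Fin 3)) (hsDiameter σ N) q.2 q.1 t) χ,
                            empiricalEnergyField
                              (lambertFlow (Torus.geometry (Fin 3)) (hsDiameter σ N) q.2 q.1 t) χ)
                            ∂((localGibbsLaw σ a₀ u₀ θ₀ N (Φ N)).prod (lambertNoise (Fin 3)))|} ≤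
                      ENNReal.ofReal (C * Real.exp (-(C⁻¹ * ((N : ℝ) + 1)))) :=
  fieldConcentration_of_lambertianEulerLD hLD

/-- **LD ⟸ LambertianEuler ∧ S2** — v5's Λ-stub from the sibling crux decl (stmt-11854) and S2, through G1; with
`fieldConcentration_of_LD` and `lambertianEulerNamed_of_LD` this is the kernel-checked equivalence LD ⟺ LambertianEuler ∧ S2. -/
theorem lambertianEulerLD_of_lambertianEuler (hL : LambertianEuler) :
    ∀ (a₀ θ₀ : T3 → ℝ) (u₀ : T3 → V3), Continuous a₀ → Continuous θ₀ → Continuous u₀ →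
      (∀ x, 0 < a₀ x) → (∀ x, 0 < θ₀ x) →
      ∃ σ₀ : ℝ, 0 < σ₀ ∧ ∀ σ : ℝ, 0 < σ → σ < σ₀ →
        ∀ (T : ℝ) (ρ θ : ℝ → T3 → ℝ) (u : ℝ → T3 → V3), IsHardSphereEulerSolution σ T ρ u θ →
          ∀ Φ : (N : ℕ) → HardSphereFlow (Torus.geometry (Fin 3)) (hsDiameter σ N) (N + 1),
            TendstoHydroFieldsAt (fun N => localGibbsLaw σ a₀ u₀ θ₀ N (Φ N)) Φ ρ u θ 0 →
              ∀ t ∈ Set.Ico 0 T, ∀ χ : T3 → ℝ, Continuous χ → ∀ δ : ℝ, 0 < δ →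
                ∃ C : ℝ, 0 < C ∧ ∀ N : ℕ,
                  ((localGibbsLaw σ a₀ u₀ θ₀ N (Φ N)).prod (lambertNoise (Fin 3)))
                      {p | δ < |empiricalDensityField
                          (lambertFlow (Torus.geometry (Fin 3)) (hsDiameter σ N) p.2 p.1 t) χ -
                        ∫ x, χ x * ρ t x|} ≤
                    ENNReal.ofReal (C * Real.exp (-(C⁻¹ * ((N : ℝ) + 1)))) ∧
                  ((localGibbsLaw σ a₀ u₀ θ₀ N (Φ N)).prod (lambertNoise (Fin 3)))
                      {p | δ < ‖empiricalMomentumField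
                          (lambertFlow (Torus.geometry (Fin 3)) (hsDiameter σ N) p.2 p.1 t) χ -
                        ∫ x, (χ x * ρ t x) • u t x‖} ≤
                    ENNReal.ofReal (C * Real.exp (-(C⁻¹ * ((N : ℝ) + 1)))) ∧
                  ((localGibbsLaw σ a₀ u₀ θ₀ N (Φ N)).prod (lambertNoise (Fin 3)))
                      {p | δ < |empiricalEnergyField
                          (lambertFlow (Torus.geometry (Fin 3)) (hsDiameter σ N) p.2 p.1 t) χ -
                        ∫ x, χ x * totalEnergyDensity (ρ t x) (u t x) (θ t x)|} ≤
                    ENNReal.ofReal (C * Real.exp (-(C⁻¹ * ((N : ℝ) + 1)))) :=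
  stub_LD_of_euler_of_fieldConcentration (lambertianEuler_iff_named.1 hL) stub_fieldConcentration

/-- **S1″ · FIELD-LEVEL RELATIVE ENTROPY SWAP** (derived: S1 through G3) — the weakest entropy statement the line's transfer consumes. -/
theorem fieldRelEntSwap_of_stubs :
    ∀ (a₀ θ₀ : T3 → ℝ) (u₀ : T3 → V3), Continuous a₀ → Continuous θ₀ → Continuous u₀ →
      (∀ x, 0 < a₀ x) → (∀ x, 0 < θ₀ x) →
      ∃ σ₀ : ℝ, 0 < σ₀ ∧ ∀ σ : ℝ, 0 < σ → σ < σ₀ →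
        ∀ (T : ℝ) (ρ θ : ℝ → T3 → ℝ) (u : ℝ → T3 → V3), IsHardSphereEulerSolution σ T ρ u θ →
          ∀ Φ : (N : ℕ) → HardSphereFlow (Torus.geometry (Fin 3)) (hsDiameter σ N) (N + 1),
            TendstoHydroFieldsAt (fun N => localGibbsLaw σ a₀ u₀ θ₀ N (Φ N)) Φ ρ u θ 0 →
              ∀ t ∈ Set.Ico 0 T, ∀ χ : T3 → ℝ, Continuous χ →
                Tendsto (fun N : ℕ =>
                  klDiv
                    ((localGibbsLaw σ a₀ u₀ θ₀ N (Φ N)).map (fun z =>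
                      (empiricalDensityField ((Φ N).flow t z) χ,
                        empiricalMomentumField ((Φ N).flow t z) χ,
                        empiricalEnergyField ((Φ N).flow t z) χ)))
                    (((localGibbsLaw σ a₀ u₀ θ₀ N (Φ N)).prod (lambertNoise (Fin 3))).map (fun p =>
                      (empiricalDensityField
                          (lambertFlow (Torus.geometry (Fin 3)) (hsDiameter σ N) p.2 p.1 t) χ,
                        empiricalMomentumField
                          (lambertFlow (Torus.geometry (Fin 3)) (hsDiameter σ N) p.2 p.1 t) χ,
                        empiricalEnergyField
                          (lambertFlow (Torus.geometry (Fin 3)) (hsDiameter σ N) p.2 p.1 t) χ))) /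
                  ((N : ℝ≥0∞) + 1)) atTop (𝓝 0) :=
  stub_fieldRelEntSwap_of_relEntSwap stub_relEntSwap

/-- **UP from S1** (c2's registered one-sided likelihood-gap stub of v3/v4, now DERIVED): `b_N = k_N − a_N ≤ k_N` since `a_N ≥ 0`
(data processing through the independent redraws, `klDiv_lambertFlow_le`, with `G_N ⊗ γ^ℕ` `Λ_t`-invariant by `stub_gibbsInvariance`
fed with S0), and `k_N → 0` (S1) in `ℝ≥0∞` with finite terms gives the real convergence.  (Landed separately as
`…SwapGapRelEntSwapOfUpper.likelihoodGapUpper_of_relEntSwap`, p120224; re-proved here over the built imports.) [folklore] -/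
theorem likelihoodGapUpper_of_stubs :

    ∀ (a₀ θ₀ : T3 → ℝ) (u₀ : T3 → V3), Continuous a₀ → Continuous θ₀ → Continuous u₀ →
      (∀ x, 0 < a₀ x) → (∀ x, 0 < θ₀ x) →
      ∃ σ₀ : ℝ, 0 < σ₀ ∧ ∀ σ : ℝ, 0 < σ → σ < σ₀ →
        ∀ (T : ℝ) (ρ θ : ℝ → T3 → ℝ) (u : ℝ → T3 → V3), IsHardSphereEulerSolution σ T ρ u θ →
          ∀ Φ : (N : ℕ) → HardSphereFlow (Torus.geometry (Fin 3)) (hsDiameter σ N) (N + 1),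
            TendstoHydroFieldsAt (fun N => localGibbsLaw σ a₀ u₀ θ₀ N (Φ N)) Φ ρ u θ 0 →
              ∀ t ∈ Set.Ico 0 T, ∀ η : ℝ, 0 < η → ∀ᶠ N : ℕ in atTop,
                ((∫ z, llr (((localGibbsLaw σ a₀ u₀ θ₀ N (Φ N)).prod (lambertNoise (Fin 3))).map
                      (fun p => lambertFlow (Torus.geometry (Fin 3)) (hsDiameter σ N) p.2 p.1 t))
                    (localGibbsLaw σ (fun _ => 1) (fun _ => 0) (fun _ => 1) N (Φ N)) z
                    ∂(((localGibbsLaw σ a₀ u₀ θ₀ N (Φ N)).prod (lambertNoise (Fin 3))).map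
                      (fun p => lambertFlow (Torus.geometry (Fin 3)) (hsDiameter σ N) p.2 p.1 t))) -
                  ∫ z, llr (((localGibbsLaw σ a₀ u₀ θ₀ N (Φ N)).prod (lambertNoise (Fin 3))).map
                      (fun p => lambertFlow (Torus.geometry (Fin 3)) (hsDiameter σ N) p.2 p.1 t))
                    (localGibbsLaw σ (fun _ => 1) (fun _ => 0) (fun _ => 1) N (Φ N)) z
                    ∂((localGibbsLaw σ a₀ u₀ θ₀ N (Φ N)).map ((Φ N).flow t))) /
                  ((N : ℝ) + 1) ≤ η := by
  intro a₀ θ₀ u₀ ha hθ hu ha0 hθ0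
  obtain ⟨σ₁, hσ₁, h1⟩ := stub_relEntSwap a₀ θ₀ u₀ ha hθ hu ha0 hθ0
  refine ⟨min 2⁻¹ σ₁, lt_min (by norm_num) hσ₁, ?_⟩
  intro σ hσ hσlt T ρ θ u hE Φ hT0 t ht η hη
  have hσhalf : σ < 2⁻¹ := hσlt.trans_le (min_le_left _ _)
  have hσ₁' : σ < σ₁ := hσlt.trans_le (min_le_right _ _)
  have hσ2 : σ ≤ 1 / 2 := by rw [one_div]; exact hσhalf.le
  have hlim := h1 σ hσ hσ₁' T ρ θ u hE Φ hT0 t ht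
  obtain ⟨A, b, -, -, hdec⟩ := klDiv_map_flow_map_lambertFlow_decomposition
    stub_liouvilleInvarianceLambda ha hθ hu ha0 hθ0 hσ hσhalf
  set P : (N : ℕ) → Measure (Config (N + 1) (Fin 3) T3) := fun N => localGibbsLaw σ a₀ u₀ θ₀ N (Φ N)
    with hPdef
  set Gr : (N : ℕ) → Measure (Config (N + 1) (Fin 3) T3) :=
    fun N => localGibbsLaw σ (fun _ => (1 : ℝ)) (fun _ => (0 : V3)) (fun _ => (1 : ℝ)) N (Φ N) with hGdef
  set pt : (N : ℕ) → Measure (Config (N + 1) (Fin 3) T3) := fun N => (P N).map ((Φ N).flow t) with hpdef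
  set qt : (N : ℕ) → Measure (Config (N + 1) (Fin 3) T3) := fun N =>
    ((P N).prod (lambertNoise (Fin 3))).map
      (fun p => lambertFlow (Torus.geometry (Fin 3)) (hsDiameter σ N) p.2 p.1 t) with hqdef
  have hΛ : ∀ N, Measurable fun p : Config (N + 1) (Fin 3) T3 × (ℕ → V3) =>
      lambertFlow (Torus.geometry (Fin 3)) (hsDiameter σ N) p.2 p.1 t :=
    fun N => measurable_lambertFlow_hsDiameter hσ.le hσhalf N t
  have hPN : ∀ N, IsProbabilityMeasure (P N) := fun N =>
    isProbabilityMeasure_localGibbsLaw ha hθ hu ha0 hθ0 hσ2 N (Φ N)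
  have hGN : ∀ N, IsProbabilityMeasure (Gr N) := fun N =>
    isProbabilityMeasure_localGibbsLaw (a₀ := fun _ => (1 : ℝ)) (θ₀ := fun _ => (1 : ℝ))
      (u₀ := fun _ => (0 : V3)) continuous_const continuous_const continuous_const
      (fun _ => one_pos) (fun _ => one_pos) hσ2 N (Φ N)
  have hfinq : ∀ N : ℕ, klDiv (qt N) (Gr N) ≠ ∞ := fun N => (hdec N (Φ N) t ht.1).2.1
  -- data processing: `a_N ≥ 0`
  have ha_nonneg : ∀ N : ℕ, 0 ≤ (klDiv (P N) (Gr N)).toReal - (klDiv (qt N) (Gr N)).toReal := by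
    intro N
    haveI := hPN N
    haveI := hGN N
    have hle : klDiv (qt N) (Gr N) ≤ klDiv (P N) (Gr N) :=
      klDiv_lambertFlow_le σ N t (P N) (Gr N) (hΛ N)
        (stub_gibbsInvariance stub_liouvilleInvarianceLambda σ hσ hσhalf N 1 1 0 one_pos one_pos (Φ N) t ht.1)
    have hfinP : klDiv (P N) (Gr N) ≠ ∞ :=
      ne_top_of_le_ne_top ENNReal.ofReal_ne_top (hdec N (Φ N) t ht.1).2.2.2.2.2.2.1
    exact sub_nonneg.2 ((ENNReal.toReal_le_toReal (hfinq N) hfinP).2 hle)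
  -- the real sequence `KL(p_t ‖ q_t).toReal/(N+1)` tends to `0`
  have hreal : Tendsto (fun N : ℕ => (klDiv (pt N) (qt N)).toReal / ((N : ℝ) + 1)) atTop (𝓝 0) := by
    have h := (ENNReal.tendsto_toReal ENNReal.zero_ne_top).comp hlim
    rw [ENNReal.toReal_zero] at h
    refine h.congr fun N => ?_
    simp only [Function.comp_def]
    rw [ENNReal.toReal_div, ENNReal.toReal_add (ENNReal.natCast_ne_top N) ENNReal.one_ne_top,
      ENNReal.toReal_natCast, ENNReal.toReal_one]
  -- `b_N = k_N − a_N ≤ k_N < η` eventually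
  obtain ⟨N₀, hN₀⟩ := (Metric.tendsto_atTop.1 hreal) η hη
  refine eventually_atTop.2 ⟨N₀, fun N hN => ?_⟩
  have hk := hN₀ N hN
  rw [Real.dist_eq, sub_zero, abs_lt] at hk
  obtain ⟨-, -, -, -, h5, h6, -, -⟩ := hdec N (Φ N) t ht.1
  have hbk : ((∫ z, llr (qt N) (Gr N) z ∂(qt N)) - ∫ z, llr (qt N) (Gr N) z ∂(pt N)) / ((N : ℝ) + 1) =
      (klDiv (pt N) (qt N)).toReal / ((N : ℝ) + 1) -
        ((klDiv (P N) (Gr N)).toReal - (klDiv (qt N) (Gr N)).toReal) / ((N : ℝ) + 1) := by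
    rw [h5, h6]
    ring
  rw [hbk]
  have hdiv : 0 ≤ ((klDiv (P N) (Gr N)).toReal - (klDiv (qt N) (Gr N)).toReal) / ((N : ℝ) + 1) :=
    div_nonneg (ha_nonneg N) (by positivity)
  linarith [hk.2]

/-! ## §6 Rungs of the research stubs (registered helper stubs of v7 — ALL LANDED and IMPORTED in v8: R0 p124393, R1 p123936, R2 p124771, R3 p124782): where S1 and S2 are already TRUE -/

/-- **R0 · STATIC FIELD CONCENTRATION UNDER LOCAL GIBBS LAWS** (`stub_fieldConcentration_static`; helper stub — LANDED p124393 — from the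
landed η₀-uniform exponential law of large numbers `uniformLocalGibbsConcentration_proof`, stmt-14445): for continuous profiles there is
`σ₀ > 0` such that for `0 < σ < σ₀`, every continuous `χ`, every 1-Lipschitz `F` bounded by `1` and every `δ > 0` there is `C > 0` with
`P_N{δ < |F(fld(z, χ)) − ∫ F(fld) dP_N|} ≤ C e^{−(N+1)/C}` for ALL `N` and ALL flows `Φ` (union bound over the three fields around the
static limits `∫χρ₀, ∫χρ₀u₀, ∫χE₀`, then `expConc_sub_integral_of_expConc_sub_const`).  The common source of R2 and R3. [folklore] -/
theorem stub_fieldConcentration_static :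
    ∀ (a₀ θ₀ : T3 → ℝ) (u₀ : T3 → V3), Continuous a₀ → Continuous θ₀ → Continuous u₀ →
      (∀ x, 0 < a₀ x) → (∀ x, 0 < θ₀ x) →
      ∃ σ₀ : ℝ, 0 < σ₀ ∧ ∀ σ : ℝ, 0 < σ → σ < σ₀ →
        ∀ χ : T3 → ℝ, Continuous χ → ∀ F : ℝ × V3 × ℝ → ℝ, LipschitzWith 1 F → (∀ y, |F y| ≤ 1) →
          ∀ δ : ℝ, 0 < δ → ∃ C : ℝ, 0 < C ∧
            ∀ (N : ℕ) (Φ : HardSphereFlow (Torus.geometry (Fin 3)) (hsDiameter σ N) (N + 1)),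
              (localGibbsLaw σ a₀ u₀ θ₀ N Φ)
                  {z | δ < |F (empiricalDensityField z χ, empiricalMomentumField z χ, empiricalEnergyField z χ) -
                    ∫ w, F (empiricalDensityField w χ, empiricalMomentumField w χ, empiricalEnergyField w χ)
                      ∂(localGibbsLaw σ a₀ u₀ θ₀ N Φ)|} ≤
                ENNReal.ofReal (C * Real.exp (-(C⁻¹ * ((N : ℝ) + 1)))) :=
  _root_.Summit.AtomisticToContinuum.HydrodynamicLimit.Theorems.stub_fieldConcentration_static

/-- **R1 · EQUILIBRIUM RUNG OF S1** (`stub_relEntSwap_equilibrium`; helper stub — LANDED p123936): for constant profiles the homogeneous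
Gibbs law `G_N` is invariant under every hard-sphere flow (`map_flow_localGibbsLaw_const`) and under `Λ` in law
(`gibbsInvarianceLambda_holds`), so `p_t = q_t = G_N` and `KL(p_t ‖ q_t) = 0`: S1 holds exactly at equilibrium, for every `N`, `Φ`,
`t ≥ 0` — no equilibrium witness can refute it. [folklore] -/
theorem stub_relEntSwap_equilibrium :
    ∀ σ : ℝ, 0 < σ → σ < 2⁻¹ → ∀ (a θ : ℝ) (u : V3), 0 < a → 0 < θ →
      ∀ (N : ℕ) (Φ : HardSphereFlow (Torus.geometry (Fin 3)) (hsDiameter σ N) (N + 1)) (t : ℝ), 0 ≤ t →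
        klDiv ((localGibbsLaw σ (fun _ => a) (fun _ => u) (fun _ => θ) N Φ).map (Φ.flow t))
          (((localGibbsLaw σ (fun _ => a) (fun _ => u) (fun _ => θ) N Φ).prod (lambertNoise (Fin 3))).map
            (fun p => lambertFlow (Torus.geometry (Fin 3)) (hsDiameter σ N) p.2 p.1 t)) = 0 :=
  _root_.Summit.AtomisticToContinuum.HydrodynamicLimit.Theorems.stub_relEntSwap_equilibrium

/-- **R2 · EQUILIBRIUM RUNG OF S2** (`stub_fieldConcentration_equilibrium`; helper stub — LANDED p124771, from R0): for constant profiles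
`a, θ > 0`, `u` and small `σ`, the law of `Λ_t` under `G_N ⊗ γ^ℕ` is `G_N` (`gibbsInvarianceLambda_holds`), so S2's deviation
probability is the STATIC one of R0, uniformly in `N`, in the flow and in `t ≥ 0`: S2 holds on the equilibrium rung. [folklore] -/
theorem stub_fieldConcentration_equilibrium :
    ∀ (a θ : ℝ) (u : V3), 0 < a → 0 < θ → ∃ σ₀ : ℝ, 0 < σ₀ ∧ ∀ σ : ℝ, 0 < σ → σ < σ₀ →
      ∀ χ : T3 → ℝ, Continuous χ → ∀ F : ℝ × V3 × ℝ → ℝ, LipschitzWith 1 F → (∀ y, |F y| ≤ 1) →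
        ∀ δ : ℝ, 0 < δ → ∃ C : ℝ, 0 < C ∧
          ∀ (N : ℕ) (Φ : HardSphereFlow (Torus.geometry (Fin 3)) (hsDiameter σ N) (N + 1)) (t : ℝ), 0 ≤ t →
            ((localGibbsLaw σ (fun _ => a) (fun _ => u) (fun _ => θ) N Φ).prod (lambertNoise (Fin 3)))
                {p | δ < |F (empiricalDensityField
                        (lambertFlow (Torus.geometry (Fin 3)) (hsDiameter σ N) p.2 p.1 t) χ,
                      empiricalMomentumField
                        (lambertFlow (Torus.geometry (Fin 3)) (hsDiameter σ N) p.2 p.1 t) χ,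
                      empiricalEnergyField
                        (lambertFlow (Torus.geometry (Fin 3)) (hsDiameter σ N) p.2 p.1 t) χ) -
                    ∫ q, F (empiricalDensityField
                        (lambertFlow (Torus.geometry (Fin 3)) (hsDiameter σ N) q.2 q.1 t) χ,
                      empiricalMomentumField
                        (lambertFlow (Torus.geometry (Fin 3)) (hsDiameter σ N) q.2 q.1 t) χ,
                      empiricalEnergyField
                        (lambertFlow (Torus.geometry (Fin 3)) (hsDiameter σ N) q.2 q.1 t) χ)
                      ∂((localGibbsLaw σ (fun _ => a) (fun _ => u) (fun _ => θ) N Φ).prod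
                          (lambertNoise (Fin 3)))|} ≤
              ENNReal.ofReal (C * Real.exp (-(C⁻¹ * ((N : ℝ) + 1)))) :=
  _root_.Summit.AtomisticToContinuum.HydrodynamicLimit.Theorems.stub_fieldConcentration_equilibrium

/-- **R3 · THE `t = 0` INSTANCE OF S2** (`stub_fieldConcentration_zero`; helper stub — LANDED p124782 — = c0's registered sub-goal
`fieldConcentration_lambertFlow_zero`, whose cycle-1 proof never reached the tree; from R0): `Λ_0 = id` almost surely
under `P_N ⊗ γ^ℕ` (`map_lambertFlow_zero_prod`, p106360, with `P_N ≪ liouville` by `localGibbsLaw_eq_withDensity_liouville`), so at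
`t = 0` S2's deviation probability is the static one of R0: S2 holds at `t = 0` for all continuous profiles. [folklore] -/
theorem stub_fieldConcentration_zero :
    ∀ (a₀ θ₀ : T3 → ℝ) (u₀ : T3 → V3), Continuous a₀ → Continuous θ₀ → Continuous u₀ →
      (∀ x, 0 < a₀ x) → (∀ x, 0 < θ₀ x) →
      ∃ σ₀ : ℝ, 0 < σ₀ ∧ ∀ σ : ℝ, 0 < σ → σ < σ₀ →
        ∀ Φ : (N : ℕ) → HardSphereFlow (Torus.geometry (Fin 3)) (hsDiameter σ N) (N + 1),
          ∀ χ : T3 → ℝ, Continuous χ → ∀ F : ℝ × V3 × ℝ → ℝ, LipschitzWith 1 F → (∀ y, |F y| ≤ 1) →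
            ∀ δ : ℝ, 0 < δ → ∃ C : ℝ, 0 < C ∧ ∀ N : ℕ,
              ((localGibbsLaw σ a₀ u₀ θ₀ N (Φ N)).prod (lambertNoise (Fin 3)))
                  {p | δ < |F (empiricalDensityField
                          (lambertFlow (Torus.geometry (Fin 3)) (hsDiameter σ N) p.2 p.1 0) χ,
                        empiricalMomentumField
                          (lambertFlow (Torus.geometry (Fin 3)) (hsDiameter σ N) p.2 p.1 0) χ,
                        empiricalEnergyField
                          (lambertFlow (Torus.geometry (Fin 3)) (hsDiameter σ N) p.2 p.1 0) χ) -
                      ∫ q, F (empiricalDensityField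
                          (lambertFlow (Torus.geometry (Fin 3)) (hsDiameter σ N) q.2 q.1 0) χ,
                        empiricalMomentumField
                          (lambertFlow (Torus.geometry (Fin 3)) (hsDiameter σ N) q.2 q.1 0) χ,
                        empiricalEnergyField
                          (lambertFlow (Torus.geometry (Fin 3)) (hsDiameter σ N) q.2 q.1 0) χ)
                        ∂((localGibbsLaw σ a₀ u₀ θ₀ N (Φ N)).prod (lambertNoise (Fin 3)))|} ≤
                ENNReal.ofReal (C * Real.exp (-(C⁻¹ * ((N : ℝ) + 1)))) := by
  -- LANDED p124782 (`…Theorems.stub_fieldConcentration_zero`); re-proved here from R0 because that module's olean is not yet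
  -- served by the farm (2026-08-16T21:10Z, again 21:45Z); swap for the one-line import when it is.
  intro a₀ θ₀ u₀ ha hθ hu ha0 hθ0
  obtain ⟨σ₁, hσ₁, hstat⟩ :=
    _root_.Summit.AtomisticToContinuum.HydrodynamicLimit.Theorems.stub_fieldConcentration_static a₀ θ₀ u₀ ha hθ hu ha0 hθ0
  refine ⟨min 2⁻¹ σ₁, lt_min (by norm_num) hσ₁, ?_⟩
  intro σ hσ hσlt Φ χ hχ F hF hF1 δ hδ
  have hσhalf : σ < 2⁻¹ := hσlt.trans_le (min_le_left _ _)
  have hσσ₁ : σ < σ₁ := hσlt.trans_le (min_le_right _ _)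
  obtain ⟨C, hC, hCN⟩ := hstat σ hσ hσσ₁ χ hχ F hF hF1 δ hδ
  refine ⟨C, hC, fun N => ?_⟩
  set P : Measure (Config (N + 1) (Fin 3) T3) := localGibbsLaw σ a₀ u₀ θ₀ N (Φ N) with hPdef
  set Λ : Config (N + 1) (Fin 3) T3 × (ℕ → EuclideanSpace ℝ (Fin 3)) → Config (N + 1) (Fin 3) T3 :=
    fun p => lambertFlow (Torus.geometry (Fin 3)) (hsDiameter σ N) p.2 p.1 0 with hΛdef
  set G : Config (N + 1) (Fin 3) T3 → ℝ := fun z =>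
    F (empiricalDensityField z χ, empiricalMomentumField z χ, empiricalEnergyField z χ) with hGdef
  haveI hPprob : IsProbabilityMeasure P :=
    isProbabilityMeasure_localGibbsLaw ha hθ hu ha0 hθ0 (σ := σ) (by linarith) N (Φ N)
  have hPac : P ≪ liouville (Torus.geometry (Fin 3)) (N + 1) (hsDiameter σ N) := by
    rw [hPdef, localGibbsLaw, particleLaw_eq]
    exact withDensity_absolutelyContinuous _ _
  have hε : 0 < hsDiameter σ N := hsDiameter_pos hσ N
  have hε' : hsDiameter σ N < 2⁻¹ := (hsDiameter_le hσ.le N).trans_lt hσhalf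
  have hid : (P.prod (lambertNoise (Fin 3))).map Λ = P := map_lambertFlow_zero_prod hε hε' P hPac
  have hΛ : Measurable Λ := measurable_lambertFlow_hsDiameter hσ.le hσhalf N 0
  have hGm : Measurable G := hF.continuous.measurable.comp (measurable_fieldTriple hχ)
  have hmean : ∫ q, G (Λ q) ∂(P.prod (lambertNoise (Fin 3))) = ∫ w, G w ∂P := by
    rw [← integral_map hΛ.aemeasurable hGm.aestronglyMeasurable, hid]
  have hAm : MeasurableSet {z | δ < |G z - ∫ w, G w ∂P|} :=
    measurableSet_lt measurable_const (hGm.sub measurable_const).abs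
  have hev : (P.prod (lambertNoise (Fin 3))) {p | δ < |G (Λ p) - ∫ w, G w ∂P|} =
      P {z | δ < |G z - ∫ w, G w ∂P|} := by
    have h := Measure.map_apply (μ := P.prod (lambertNoise (Fin 3))) hΛ hAm
    rw [hid] at h
    exact h.symm
  show (P.prod (lambertNoise (Fin 3))) {p | δ < |G (Λ p) - ∫ q, G (Λ q) ∂(P.prod (lambertNoise (Fin 3)))|} ≤
    ENNReal.ofReal (C * Real.exp (-(C⁻¹ * ((N : ℝ) + 1))))
  rw [hmean, hev]
  exact hCN N (Φ N)

/-! ## §7 The crux versus the (unguarded) conjunct (helper of v7, p125008; v10: restated over the Literature conjunct, D-0032) -/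

/-- **`SwapGap ↔ HydrodynamicLimit` (unguarded) GIVEN `LambertianEuler`** (`stub_swapGap_iff_hydrodynamicLimit`; helper of v7, LANDED
p125008 over the then-`abbrev` summit conjunct; v10: RESTATED over the unguarded Literature conjunct
`Literature.MathematicalPhysics.KineticTheory.HydrodynamicLimit` after the D-0032 re-type of `_root_.HydrodynamicLimit` (2026-08-16T21:23Z,
packing guard) and proved from two landed, explicitly Literature-typed theorems: forward = `mergingTransfer_proof` (stmt-12099) with
`localGibbsProbability_proof` (stmt-12098), backward = `swapGap_of_hydrodynamicLimit` (p106428)).  The kernel-checked form of the refuter's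
verdict "equivalent to the conjunct modulo LambertianEuler" — for the UNGUARDED conjunct; the guarded summit conjunct is implied
(`HydrodynamicLimit.of_unguarded`) but no longer implies `SwapGap`, which still quantifies over every classical Euler solution. [folklore] -/
theorem stub_swapGap_iff_hydrodynamicLimit (hL : LambertianEuler) :
    SwapGap ↔ Literature.MathematicalPhysics.KineticTheory.HydrodynamicLimit :=
  ⟨fun hS => mergingTransfer_proof localGibbsProbability_proof hS hL,
    swapGap_of_hydrodynamicLimit localGibbsProbability_proof hL⟩

/-! ## §8 The crux from EXISTING items of route `LindebergRandomFuture` (proved) -/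

/-- **`SwapGap` ⇐ stmt-11851 ∧ stmt-11852 ∧ stmt-11853.** Route `LindebergRandomFuture` files `RandomFutureTransfer`
(stmt-AtomisticToContinuum-11853) literally as `SlabMomentumClosure → SlabEnergyClosure → SwapGap`, and its `SwapGap` is the
byte-identical copy of this crux, so the three existing items of that route close the crux by modus ponens. [folklore] -/
theorem swapGap_of_randomFutureTransfer
    (h₁ : Summit.AtomisticToContinuum.HydrodynamicLimit.Theses.LindebergRandomFuture.SlabMomentumClosure)
    (h₂ : Summit.AtomisticToContinuum.HydrodynamicLimit.Theses.LindebergRandomFuture.SlabEnergyClosure)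
    (h₃ : Summit.AtomisticToContinuum.HydrodynamicLimit.Theses.LindebergRandomFuture.RandomFutureTransfer) :
    SwapGap :=
  h₃ h₁ h₂

/-- **`SwapGap` ⇐ stmt-0766 ∧ stmt-11854** (§8b, LANDED p126998, `…Theorems.swapGap_of_relEntropyVanishing_of_lambertianEuler`):
route `TwoClocks` files the Yau form of the conjunct, `RelEntropyVanishing` (stmt-AtomisticToContinuum-0766); its landed
`entropyToHydro_proof` gives the conjunct, and `swapGap_of_hydrodynamicLimit` (p106428) with `localGibbsProbability_proof` and the
sibling crux stmt-11854 gives `SwapGap`. [folklore] -/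
theorem swapGap_of_relEntropyVanishing_of_lambertianEuler
    (hRE : Summit.AtomisticToContinuum.HydrodynamicLimit.Theses.TwoClocks.RelEntropyVanishing) (hL : LambertianEuler) :
    SwapGap :=
  -- LANDED p126998; re-derived (one line) because that module's olean is not yet served by the farm (2026-08-16T21:45Z).
  swapGap_of_hydrodynamicLimit localGibbsProbability_proof hL (entropyToHydro_proof hRE)

/-! ## §9 The interface stubs of v8 (registered; T2 LANDED p127011; T1, T3, T4 open — provable now, wave 6) -/

/-- **T1 · SMOOTH TEST FUNCTIONS SUFFICE** (`stub_swapGap_of_smoothTest`): `SwapGap` follows from its restriction to test functions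
`χ : 𝕋³ → ℝ` with smooth periodic lift (`Torus.IsSmooth χ`, i.e. `ContDiff ℝ ∞ (χ ∘ Torus.proj)`).  Proof: given a continuous `χ`, a
1-Lipschitz `F` bounded by `1` and `η > 0`, pick a smooth `χ'` with `‖χ − χ'‖_∞ ≤ η` (real parts of multiple Fourier polynomials are
dense in `C(𝕋³)`, `mFourierSubalgebra_closure_eq_top`, and smooth, `isSmooth_realTrigPoly`); the field triple is `η`-Lipschitz in `χ`
for the sup norm on `ℝ × V3 × ℝ` with constant `1 + (N+1)⁻¹∑ᵢ(‖vᵢ‖ + ‖vᵢ‖²/2) ≤ 2(1 + (N+1)⁻¹∑ᵢ‖vᵢ‖²)`, the kinetic energy is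
conserved along `Φ` on the good set (`IsHardSphereTrajectory.configEnergy_eq_holds`, `P_N ≪ liouville`) and does not increase along
`Λ` (`configEnergy_lambertFlow_le`), and `E_{P_N}[(N+1)⁻¹∑ᵢ‖vᵢ‖²] ≤ C` uniformly in `N` and the flow
(`exists_lintegral_sum_norm_sq_localGibbsLaw_le`, `σ ≤ 1/2`); so both integrals move by at most `2η(1 + C)` when `χ` is replaced by
`χ'`, uniformly in `N`, and `limsup_N |Δ_N(χ)| ≤ limsup_N |Δ_N(χ')| + 4η(1 + C) = 4η(1 + C)` for every `η` (take `σ₀ := min (1/2) σ₀'`).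
[folklore] -/
theorem stub_swapGap_of_smoothTest
    (h : ∀ (a₀ θ₀ : T3 → ℝ) (u₀ : T3 → V3), Continuous a₀ → Continuous θ₀ → Continuous u₀ →
      (∀ x, 0 < a₀ x) → (∀ x, 0 < θ₀ x) →
      ∃ σ₀ : ℝ, 0 < σ₀ ∧ ∀ σ : ℝ, 0 < σ → σ < σ₀ →
        ∀ (T : ℝ) (ρ θ : ℝ → T3 → ℝ) (u : ℝ → T3 → V3), IsHardSphereEulerSolution σ T ρ u θ →
          ∀ Φ : (N : ℕ) → HardSphereFlow (Torus.geometry (Fin 3)) (hsDiameter σ N) (N + 1),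
            TendstoHydroFieldsAt (fun N => localGibbsLaw σ a₀ u₀ θ₀ N (Φ N)) Φ ρ u θ 0 →
              ∀ t ∈ Set.Ico 0 T, ∀ χ : T3 → ℝ, Literature.Analysis.FunctionSpaces.Torus.IsSmooth χ →
                ∀ F : ℝ × V3 × ℝ → ℝ, LipschitzWith 1 F → (∀ y, |F y| ≤ 1) →
                  Tendsto (fun N : ℕ =>
                    (∫ z, F (empiricalDensityField ((Φ N).flow t z) χ,
                        empiricalMomentumField ((Φ N).flow t z) χ,
                        empiricalEnergyField ((Φ N).flow t z) χ) ∂(localGibbsLaw σ a₀ u₀ θ₀ N (Φ N))) -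
                    ∫ p, F (empiricalDensityField
                          (lambertFlow (Torus.geometry (Fin 3)) (hsDiameter σ N) p.2 p.1 t) χ,
                        empiricalMomentumField
                          (lambertFlow (Torus.geometry (Fin 3)) (hsDiameter σ N) p.2 p.1 t) χ,
                        empiricalEnergyField
                          (lambertFlow (Torus.geometry (Fin 3)) (hsDiameter σ N) p.2 p.1 t) χ)
                      ∂((localGibbsLaw σ a₀ u₀ θ₀ N (Φ N)).prod (lambertNoise (Fin 3))))
                  atTop (𝓝 0)) :
    SwapGap :=
  -- LANDED p127615 (`…Theorems.LambertianContactSwapSwapGapStubSwapGapOfSmoothTest`); imported (v15).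
  _root_.Summit.AtomisticToContinuum.HydrodynamicLimit.Theorems.stub_swapGap_of_smoothTest h

/-- (Copy of the LANDED `…Theorems.tendsto_measure_of_klDiv_div_ofReal_tendsto_zero`, p127011, kept until that olean is served.)
**Relative entropy `o(r_N)` + exponential concentration of the reference at speed `r_N` ⟹ convergence in
probability**, for a general real rate `0 < r_N → ∞` (the version `tendsto_measure_of_klDiv_div_tendsto_zero` is
`r_N = N + 1`). For finite measures `μ_N, ν_N` on arbitrary measurable spaces and arbitrary sets `A_N`: if
`ν_N(A_N) ≤ C e^{-r_N/C}` for all `N` and `KL(μ_N ‖ ν_N)/r_N → 0`, then `μ_N(A_N) → 0`. Proof: replace `A_N` by its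
`ν_N`-measurable hull and apply the entropy inequality for events (`measureReal_mul_le_toReal_klDiv_add`) with
`L_N = r_N/(2C)`, for the eventual `N` with `KL_N < ∞` and `r_N ≥ 1`:
`μ_N(A_N) ≤ 2C·KL_N/r_N + 2C²·e^{-r_N/(2C)} → 0`. [cite: KipnisLandim1999, Ch. 6 §1] -/
theorem tendsto_measure_of_klDiv_div_ofReal_tendsto_zero' {Ω : ℕ → Type*} [∀ N, MeasurableSpace (Ω N)]
    (μ ν : ∀ N, Measure (Ω N)) [∀ N, IsFiniteMeasure (μ N)] [∀ N, IsFiniteMeasure (ν N)]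
    (A : ∀ N, Set (Ω N)) {r : ℕ → ℝ} (hr : ∀ N, 0 < r N) (hr' : Tendsto r atTop atTop)
    {C : ℝ} (hC : 0 < C)
    (hconc : ∀ N : ℕ, ν N (A N) ≤ ENNReal.ofReal (C * Real.exp (-(C⁻¹ * r N))))
    (hkl : Tendsto (fun N : ℕ => klDiv (μ N) (ν N) / ENNReal.ofReal (r N)) atTop (𝓝 0)) :
    Tendsto (fun N : ℕ => μ N (A N)) atTop (𝓝 0) := by
  -- real-valued relative entropy and its normalisation by the rate
  set k : ℕ → ℝ := fun N => (klDiv (μ N) (ν N)).toReal with hk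
  have hk_tendsto : Tendsto (fun N : ℕ => k N / r N) atTop (𝓝 0) := by
    have h := (ENNReal.tendsto_toReal ENNReal.zero_ne_top).comp hkl
    rw [ENNReal.toReal_zero] at h
    refine h.congr' (Eventually.of_forall fun N => ?_)
    simp only [Function.comp_apply, hk]
    rw [ENNReal.toReal_div, ENNReal.toReal_ofReal (hr N).le]
  -- eventually the relative entropy is finite
  have hfin : ∀ᶠ N : ℕ in atTop, klDiv (μ N) (ν N) ≠ ∞ := by
    filter_upwards [hkl.eventually (gt_mem_nhds zero_lt_one)] with N hN
    intro htop
    rw [htop, ENNReal.top_div_of_ne_top ENNReal.ofReal_ne_top] at hN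
    exact absurd hN (by simp)
  -- eventually the rate is at least one
  have hr1 : ∀ᶠ N : ℕ in atTop, 1 ≤ r N := hr'.eventually_ge_atTop 1
  -- the real upper bound and its limit
  set B : ℕ → ℝ := fun N =>
    2 * C * (k N / r N) + 2 * C ^ 2 * Real.exp (-(r N / (2 * C))) with hB
  have hB_tendsto : Tendsto B atTop (𝓝 0) := by
    have h1 : Tendsto (fun N : ℕ => 2 * C * (k N / r N)) atTop (𝓝 0) := by
      simpa using hk_tendsto.const_mul (2 * C)
    have h2 : Tendsto (fun N : ℕ => 2 * C ^ 2 * Real.exp (-(r N / (2 * C)))) atTop (𝓝 0) := by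
      have hdiv : Tendsto (fun N : ℕ => r N / (2 * C)) atTop atTop :=
        hr'.atTop_div_const (by positivity)
      have hexp := Real.tendsto_exp_neg_atTop_nhds_zero.comp hdiv
      simpa using hexp.const_mul (2 * C ^ 2)
    simpa using h1.add h2
  have hB_ennreal : Tendsto (fun N => ENNReal.ofReal (B N)) atTop (𝓝 0) := by
    simpa using ENNReal.tendsto_ofReal hB_tendsto
  -- the eventual pointwise bound `μ_N(A_N) ≤ B_N`
  have hbound : ∀ᶠ N : ℕ in atTop, μ N (A N) ≤ ENNReal.ofReal (B N) := by
    filter_upwards [hfin, hr1] with N hN hrN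
    set A' : Set (Ω N) := toMeasurable (ν N) (A N) with hA'
    have hA'm : MeasurableSet A' := measurableSet_toMeasurable _ _
    have hrpos : 0 < r N := hr N
    have hr0 : r N ≠ 0 := hrpos.ne'
    set L : ℝ := r N / (2 * C) with hL
    have hLpos : 0 < L := by positivity
    -- reference mass of the hull
    have hq : (ν N).real A' ≤ C * Real.exp (-(C⁻¹ * r N)) := by
      rw [measureReal_def, hA', measure_toMeasurable]
      exact ENNReal.toReal_le_of_le_ofReal (by positivity) (hconc N)
    have hq0 : 0 ≤ (ν N).real A' := measureReal_nonneg
    -- entropy inequality for the event `A'`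
    have hent := measureReal_mul_le_toReal_klDiv_add hN hA'm L
    have hexpL : (Real.exp L - 1) * (ν N).real A' ≤ C * Real.exp (-(r N / (2 * C))) := by
      calc (Real.exp L - 1) * (ν N).real A'
          ≤ Real.exp L * (ν N).real A' := by
            apply mul_le_mul_of_nonneg_right (by linarith [Real.exp_pos L]) hq0
        _ ≤ Real.exp L * (C * Real.exp (-(C⁻¹ * r N))) :=
            mul_le_mul_of_nonneg_left hq (Real.exp_pos L).le
        _ = C * (Real.exp L * Real.exp (-(C⁻¹ * r N))) := by ring
        _ = C * Real.exp (-(r N / (2 * C))) := by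
            have hLid : L + -(C⁻¹ * r N) = -(r N / (2 * C)) := by
              rw [hL]
              field_simp
              ring
            rw [← Real.exp_add, hLid]
    have hm0 : 0 ≤ (μ N).real A' := measureReal_nonneg
    have hk0 : 0 ≤ k N := ENNReal.toReal_nonneg
    have hmain : (μ N).real A' * L ≤ k N + C * Real.exp (-(r N / (2 * C))) := by
      simp only [hk]
      linarith
    have hmB : (μ N).real A' ≤ B N := by
      have h1 : (μ N).real A' ≤ (k N + C * Real.exp (-(r N / (2 * C)))) / L :=
        (le_div_iff₀ hLpos).mpr hmain
      have h2 : (k N + C * Real.exp (-(r N / (2 * C)))) / L =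
          2 * C * (k N / r N) + 2 * C ^ 2 * Real.exp (-(r N / (2 * C))) / r N := by
        rw [hL]
        field_simp
      have h3 : 2 * C ^ 2 * Real.exp (-(r N / (2 * C))) / r N ≤
          2 * C ^ 2 * Real.exp (-(r N / (2 * C))) :=
        div_le_self (by positivity) hrN
      rw [hB]
      linarith
    calc μ N (A N) ≤ μ N A' := measure_mono (subset_toMeasurable _ _)
      _ = ENNReal.ofReal ((μ N).real A') := (ofReal_measureReal (measure_ne_top _ _)).symm
      _ ≤ ENNReal.ofReal (B N) := ENNReal.ofReal_le_ofReal hmB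
  exact tendsto_of_tendsto_of_tendsto_of_le_of_le' tendsto_const_nhds hB_ennreal
    (Eventually.of_forall fun N => zero_le) hbound

/-- **T2 · THE TRANSFER AT MATCHED RATES** (`stub_swapGap_of_rates`; LANDED p127011, `…Theorems.stub_swapGap_of_rates`, imported): for ANY rate `r_N > 0` with `r_N → ∞`, the relative entropy
swap at rate `r_N` (`KL(p_t ‖ q_t)/r_N → 0`) together with self-averaging of the Lambertian field statistics at speed `r_N`
(`(P_N ⊗ γ^ℕ){δ < |F(fld Λ_t) − mean|} ≤ C e^{−r_N/C}`) gives `SwapGap`; p106427 (`swapGap_of_relEntSwap_of_fieldConcentration`) is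
the case `r_N = N + 1`.  Same proof: the entropy inequality for events `p(A) ≤ (log 2 + KL(p‖q))/log(1 + 1/q(A))`
(`measureReal_le_klDiv_add_log_two_div_log` family behind `tendsto_measure_of_klDiv_div_tendsto_zero`), then
`tendsto_integral_sub_of_tendsto_measure`. [cite: KipnisLandim1999, Ch. 6 §1] -/
theorem stub_swapGap_of_rates (r : ℕ → ℝ) (hr : ∀ N, 0 < r N) (hr' : Tendsto r atTop atTop)
    (h1 : ∀ (a₀ θ₀ : T3 → ℝ) (u₀ : T3 → V3), Continuous a₀ → Continuous θ₀ → Continuous u₀ →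
      (∀ x, 0 < a₀ x) → (∀ x, 0 < θ₀ x) →
      ∃ σ₀ : ℝ, 0 < σ₀ ∧ ∀ σ : ℝ, 0 < σ → σ < σ₀ →
        ∀ (T : ℝ) (ρ θ : ℝ → T3 → ℝ) (u : ℝ → T3 → V3), IsHardSphereEulerSolution σ T ρ u θ →
          ∀ Φ : (N : ℕ) → HardSphereFlow (Torus.geometry (Fin 3)) (hsDiameter σ N) (N + 1),
            TendstoHydroFieldsAt (fun N => localGibbsLaw σ a₀ u₀ θ₀ N (Φ N)) Φ ρ u θ 0 →
              ∀ t ∈ Set.Ico 0 T,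
                Tendsto (fun N : ℕ =>
                  klDiv ((localGibbsLaw σ a₀ u₀ θ₀ N (Φ N)).map ((Φ N).flow t))
                    (((localGibbsLaw σ a₀ u₀ θ₀ N (Φ N)).prod (lambertNoise (Fin 3))).map
                      (fun p => lambertFlow (Torus.geometry (Fin 3)) (hsDiameter σ N) p.2 p.1 t)) /
                  ENNReal.ofReal (r N)) atTop (𝓝 0))
    (h2 : ∀ (a₀ θ₀ : T3 → ℝ) (u₀ : T3 → V3), Continuous a₀ → Continuous θ₀ → Continuous u₀ →
      (∀ x, 0 < a₀ x) → (∀ x, 0 < θ₀ x) →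
      ∃ σ₀ : ℝ, 0 < σ₀ ∧ ∀ σ : ℝ, 0 < σ → σ < σ₀ →
        ∀ (T : ℝ) (ρ θ : ℝ → T3 → ℝ) (u : ℝ → T3 → V3), IsHardSphereEulerSolution σ T ρ u θ →
          ∀ Φ : (N : ℕ) → HardSphereFlow (Torus.geometry (Fin 3)) (hsDiameter σ N) (N + 1),
            TendstoHydroFieldsAt (fun N => localGibbsLaw σ a₀ u₀ θ₀ N (Φ N)) Φ ρ u θ 0 →
              ∀ t ∈ Set.Ico 0 T, ∀ χ : T3 → ℝ, Continuous χ →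
                ∀ F : ℝ × V3 × ℝ → ℝ, LipschitzWith 1 F → (∀ y, |F y| ≤ 1) → ∀ δ : ℝ, 0 < δ →
                  ∃ C : ℝ, 0 < C ∧ ∀ N : ℕ,
                    ((localGibbsLaw σ a₀ u₀ θ₀ N (Φ N)).prod (lambertNoise (Fin 3)))
                      {p | δ < |F (empiricalDensityField
                              (lambertFlow (Torus.geometry (Fin 3)) (hsDiameter σ N) p.2 p.1 t) χ,
                            empiricalMomentumField
                              (lambertFlow (Torus.geometry (Fin 3)) (hsDiameter σ N) p.2 p.1 t) χ,
                            empiricalEnergyField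
                              (lambertFlow (Torus.geometry (Fin 3)) (hsDiameter σ N) p.2 p.1 t) χ) -
                          ∫ q, F (empiricalDensityField
                              (lambertFlow (Torus.geometry (Fin 3)) (hsDiameter σ N) q.2 q.1 t) χ,
                            empiricalMomentumField
                              (lambertFlow (Torus.geometry (Fin 3)) (hsDiameter σ N) q.2 q.1 t) χ,
                            empiricalEnergyField
                              (lambertFlow (Torus.geometry (Fin 3)) (hsDiameter σ N) q.2 q.1 t) χ)
                            ∂((localGibbsLaw σ a₀ u₀ θ₀ N (Φ N)).prod (lambertNoise (Fin 3)))|} ≤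
                      ENNReal.ofReal (C * Real.exp (-(C⁻¹ * r N)))) :
    SwapGap := by
  -- LANDED p127011 (`…Theorems.stub_swapGap_of_rates`); proof copied verbatim until that module's olean is served by the farm.
  delta Summit.AtomisticToContinuum.HydrodynamicLimit.Theses.LambertianContactSwap.SwapGap
  intro Cfg G ε τ S ldir lpair lstep lstate linst lflow noise fld a₀ θ₀ u₀ ha hθ hu ha0 hθ0
  obtain ⟨σ₁, hσ₁, h1'⟩ := h1 a₀ θ₀ u₀ ha hθ hu ha0 hθ0
  obtain ⟨σ₂, hσ₂, h2'⟩ := h2 a₀ θ₀ u₀ ha hθ hu ha0 hθ0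
  refine ⟨min 2⁻¹ (min σ₁ σ₂), lt_min (by norm_num) (lt_min hσ₁ hσ₂), ?_⟩
  intro σ hσ hσlt T ρ θ u hE Φ P h0 t ht χ hχ F hF hF1
  have hσhalf : σ < 2⁻¹ := hσlt.trans_le (min_le_left _ _)
  have hσ₁' : σ < σ₁ := hσlt.trans_le ((min_le_right _ _).trans (min_le_left _ _))
  have hσ₂' : σ < σ₂ := hσlt.trans_le ((min_le_right _ _).trans (min_le_right _ _))
  -- the laws
  have hPN : ∀ N, IsProbabilityMeasure (P N) := fun N =>
    isProbabilityMeasure_localGibbsLaw ha hθ hu ha0 hθ0 (by linarith) N (Φ N)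
  have hnoise : IsProbabilityMeasure noise := by
    show IsProbabilityMeasure (lambertNoise (Fin 3))
    infer_instance
  -- measurability of the Lambertian flow (the `let` block is the Literature API definitionally)
  have hΛ : ∀ N, Measurable fun p : Cfg N × (ℕ → EuclideanSpace ℝ (Fin 3)) => lflow σ N p.2 p.1 t :=
    fun N => measurable_lambertFlow_hsDiameter hσ.le hσhalf N t
  -- the bounded measurable statistic `G_N = F ∘ fld`
  have hfld : ∀ N, Measurable fun y : Cfg N => fld N y χ := fun N => measurable_fieldTriple hχ
  have hG : ∀ N, Measurable fun y : Cfg N => F (fld N y χ) :=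
    fun N => hF.continuous.measurable.comp (hfld N)
  -- the two image laws
  set μ : (N : ℕ) → Measure (Cfg N) := fun N => (P N).map ((Φ N).flow t) with hμ
  set ν : (N : ℕ) → Measure (Cfg N) := fun N =>
    ((P N).prod noise).map (fun p => lflow σ N p.2 p.1 t) with hν
  haveI hμfin : ∀ N, IsFiniteMeasure (μ N) := fun N => by
    haveI := hPN N
    exact Measure.isFiniteMeasure_map _ _
  haveI hνfin : ∀ N, IsFiniteMeasure (ν N) := fun N => by
    haveI := hPN N
    exact Measure.isFiniteMeasure_map _ _
  -- the Lambertian means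
  set m : ℕ → ℝ := fun N => ∫ p, F (fld N (lflow σ N p.2 p.1 t) χ) ∂((P N).prod noise) with hm
  have hm1 : ∀ N, |m N| ≤ 1 := fun N => by
    haveI := hPN N
    have h := norm_integral_le_of_norm_le_const (μ := (P N).prod noise)
      (f := fun p : Cfg N × (ℕ → EuclideanSpace ℝ (Fin 3)) => F (fld N (lflow σ N p.2 p.1 t) χ))
      (C := 1) (ae_of_all _ fun p => by
        rw [Real.norm_eq_abs]
        exact hF1 _)
    simpa [hm, Real.norm_eq_abs] using h
  -- first hypothesis: `KL(μ_N ‖ ν_N)/r_N → 0`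
  have hkl : Tendsto (fun N : ℕ => klDiv (μ N) (ν N) / ENNReal.ofReal (r N)) atTop (𝓝 0) :=
    h1' σ hσ hσ₁' T ρ θ u hE Φ h0 t ht
  -- convergence in `P_N`-probability of `G(Φ_t z)` towards the Lambertian mean
  have hprob : ∀ δ : ℝ, 0 < δ →
      Tendsto (fun N => P N {z | δ < |F (fld N ((Φ N).flow t z) χ) - m N|}) atTop (𝓝 0) := by
    intro δ hδ
    obtain ⟨C, hC, hconc⟩ := h2' σ hσ hσ₂' T ρ θ u hE Φ h0 t ht χ hχ F hF hF1 δ hδ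
    set A : (N : ℕ) → Set (Cfg N) := fun N => {y | δ < |F (fld N y χ) - m N|} with hA
    have hAm : ∀ N, MeasurableSet (A N) := fun N =>
      measurableSet_lt measurable_const ((hG N).sub measurable_const).abs
    have hνA : ∀ N, ν N (A N) ≤ ENNReal.ofReal (C * Real.exp (-(C⁻¹ * r N))) := by
      intro N
      rw [hν, Measure.map_apply (hΛ N) (hAm N)]
      exact hconc N
    have hμA := tendsto_measure_of_klDiv_div_ofReal_tendsto_zero' μ ν A hr hr' hC hνA hkl
    refine hμA.congr fun N => ?_
    rw [hμ, Measure.map_apply ((Φ N).measurable_flow t) (hAm N)]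
    rfl
  -- merging of the means
  have hmerge := tendsto_integral_sub_of_tendsto_measure P hPN
    (fun N z => F (fld N ((Φ N).flow t z) χ)) (fun N => (hG N).comp ((Φ N).measurable_flow t))
    (fun N z => hF1 _) m hm1 hprob
  exact hmerge

/-- **T3 · CONSERVED MODES: THE CRUX IS EXACT FOR CONSTANT TEST FUNCTIONS** (`stub_swapGap_constTest`): for `0 < σ < 1/2`, continuous
profiles, every `N`, every hard-sphere flow `Φ`, every `t ≥ 0`, every constant `c` and every 1-Lipschitz `F` bounded by `1`, the two
integrals of the crux COINCIDE: with `χ ≡ c` the field triple is `(c, c·(N+1)⁻¹∑ᵢvᵢ, c·(N+1)⁻¹∑ᵢ‖vᵢ‖²/2)`, a function of the total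
momentum and kinetic energy, which `Φ_t` conserves on its good set (`HardSphereFlow.configMomentum_flow`,
`IsHardSphereTrajectory.configEnergy_eq_holds`; the good set is `P_N`-conull since `P_N ≪ liouville`) and `Λ_t` conserves
`γ^ℕ`-almost surely (`configMomentum_lambertFlow`, `ae_lambertNoise_forall_configEnergy_lambertFlow`); so both integrands are a.e. the
static statistic `F(fld(z, c))`, and `γ^ℕ` is a probability measure (`integral_prod`/`Measure.fst_prod`). [folklore] -/
theorem stub_swapGap_constTest :
    ∀ σ : ℝ, 0 < σ → σ < 2⁻¹ → ∀ (a₀ θ₀ : T3 → ℝ) (u₀ : T3 → V3), Continuous a₀ → Continuous θ₀ → Continuous u₀ →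
      (∀ x, 0 < a₀ x) → (∀ x, 0 < θ₀ x) →
      ∀ (N : ℕ) (Φ : HardSphereFlow (Torus.geometry (Fin 3)) (hsDiameter σ N) (N + 1)) (t : ℝ), 0 ≤ t →
        ∀ (c : ℝ) (F : ℝ × V3 × ℝ → ℝ), LipschitzWith 1 F → (∀ y, |F y| ≤ 1) →
          ∫ z, F (empiricalDensityField (Φ.flow t z) (fun _ => c),
              empiricalMomentumField (Φ.flow t z) (fun _ => c),
              empiricalEnergyField (Φ.flow t z) (fun _ => c)) ∂(localGibbsLaw σ a₀ u₀ θ₀ N Φ) =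
          ∫ p, F (empiricalDensityField
                (lambertFlow (Torus.geometry (Fin 3)) (hsDiameter σ N) p.2 p.1 t) (fun _ => c),
              empiricalMomentumField
                (lambertFlow (Torus.geometry (Fin 3)) (hsDiameter σ N) p.2 p.1 t) (fun _ => c),
              empiricalEnergyField
                (lambertFlow (Torus.geometry (Fin 3)) (hsDiameter σ N) p.2 p.1 t) (fun _ => c))
            ∂((localGibbsLaw σ a₀ u₀ θ₀ N Φ).prod (lambertNoise (Fin 3))) :=
  -- LANDED p127472 (`…Theorems.LambertianContactSwapSwapGapStubSwapGapConstTest`); imported (v15).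
  _root_.Summit.AtomisticToContinuum.HydrodynamicLimit.Theorems.stub_swapGap_constTest

/-- **T4 · MIRROR OF THE DECIDING THEOREM** (`stub_lambertianEuler_of_swapGap_of_hydrodynamicLimit`; RESHAPED in v10 — wave-6 verdict
`stub-misstated`: the summit conjunct `_root_.HydrodynamicLimit` was RE-TYPED 2026-08-16T21:23Z (D-0032) to the packing-guarded form, which
says nothing along Euler solutions outside the guard while `LambertianEuler` is unguarded; the mirror statement is over the UNGUARDED
Literature conjunct `Literature.MathematicalPhysics.KineticTheory.HydrodynamicLimit`, exactly the conclusion type of the route's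
`MergingTransfer` (stmt-12099) — LANDED in that form, wave 6): `SwapGap` and the unguarded conjunct
`HydrodynamicLimit` give the sibling crux `LambertianEuler` (stmt-11854) — the Markov/Portmanteau transfer of `closes` run from `Φ` to
`Λ`: `σ₀ := min (σ_S, σ_H, 1/2)`; for each field and `δ > 0`, with the 1-Lipschitz cutoff `g = min 1 (max (· − δ/2) 0)` of the
deviation, `min(1,δ/2)·(P_N ⊗ γ^ℕ){δ < dev(Λ_t)} ≤ ∫ g∘dev∘Λ_t d(P_N ⊗ γ^ℕ)` (Markov; `Λ_t` jointly measurable,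
`measurable_lambertFlow_hsDiameter`; `P_N ⊗ γ^ℕ` finite) `= ∫ g∘dev∘Φ_t dP_N + o(1)` (`SwapGap`) `≤ P_N{δ/2 < dev(Φ_t)} + o(1) → 0`
(the conjunct at `δ/2`).  With `closes` (SwapGap → 11854 → conjunct) and §7: under `SwapGap`, stmt-11854 and the conjunct are
EQUIVALENT. [cite: Billingsley1999, Thm 2.1] -/
theorem stub_lambertianEuler_of_swapGap_of_hydrodynamicLimit (hS : SwapGap)
    (hH : Literature.MathematicalPhysics.KineticTheory.HydrodynamicLimit) : LambertianEuler :=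
  -- LANDED p127782 (`…Theorems.LambertianContactSwapSwapGapStubLambertianEulerOfSwapGap`); imported (v15).
  _root_.Summit.AtomisticToContinuum.HydrodynamicLimit.Theorems.stub_lambertianEuler_of_swapGap_of_hydrodynamicLimit hS hH

/-- **Under `SwapGap`, the unguarded conjunct and stmt-11854 are equivalent** (T4 and the landed `mergingTransfer_proof`,
stmt-12099, fed with `localGibbsProbability_proof`, stmt-12098; v10: stated over the Literature conjunct and without the route file's
`closes`, whose pre-retype proof term does not survive the D-0032 rebuild). The packing-guarded summit conjunct then follows from either
side by `HydrodynamicLimit.of_unguarded` (Statement.lean). [folklore] -/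
theorem hydrodynamicLimit_iff_lambertianEuler_of_swapGap (hS : SwapGap) :
    Literature.MathematicalPhysics.KineticTheory.HydrodynamicLimit ↔ LambertianEuler :=
  ⟨stub_lambertianEuler_of_swapGap_of_hydrodynamicLimit hS,
    fun hL => mergingTransfer_proof localGibbsProbability_proof hS hL⟩

/-! ## §10 The Λ-side interface stubs of v9 (registered; provable now; wave 6): S2 in the form an LD proof for `Λ` produces -/

/-- **T5 · LINEAR STATISTICS SUFFICE (smooth tests)** (`stub_fieldConcentration_smooth_of_linear`): for test functions `χ` with
smooth periodic lift, S2's speed-`N` self-averaging of EVERY bounded 1-Lipschitz statistic `F` of the `χ`-tested field triple of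
`Λ_t` follows from speed-`N` self-averaging of the five LINEAR statistics — the density field `ρ_χ`, the momentum field `m_χ ∈ V3`
and the energy field `e_χ` — about their own means.  Proof: `ℝ × V3 × ℝ` carries the sup (product) metric, so for the mean vector
`c_N := (∫ρ_χ∘Λ_t, ∫m_χ∘Λ_t, ∫e_χ∘Λ_t)` and 1-Lipschitz `F`, `|F(fld) − F(c_N)| ≤ max(|ρ_χ − c_N.1|, ‖m_χ − c_N.2.1‖, |e_χ − c_N.2.2|)`;
the union bound over the three hypotheses at level `δ` gives `(P_N ⊗ γ^ℕ){δ < |F(fld Λ_t) − F(c_N)|} ≤ 3C e^{−(N+1)/C}` (absorb `3`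
into the constant, `UniformLGC.Kexp_le_Kexp`), and `expConc_sub_integral_of_expConc_sub_const` (`|F| ≤ 1`, `|F(c_N)| ≤ 1`,
`P_N ⊗ γ^ℕ` a probability measure for `σ ≤ 1/2`, `F ∘ fld ∘ Λ_t` measurable by `measurable_fieldTriple` and
`measurable_lambertFlow_hsDiameter`) recentres at the mean of `F`; `σ₀ := min (1/2) σ₀'`. [folklore] -/
theorem stub_fieldConcentration_smooth_of_linear
    (hlin :
    ∀ (a₀ θ₀ : T3 → ℝ) (u₀ : T3 → V3), Continuous a₀ → Continuous θ₀ → Continuous u₀ →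
      (∀ x, 0 < a₀ x) → (∀ x, 0 < θ₀ x) →
      ∃ σ₀ : ℝ, 0 < σ₀ ∧ ∀ σ : ℝ, 0 < σ → σ < σ₀ →
        ∀ (T : ℝ) (ρ θ : ℝ → T3 → ℝ) (u : ℝ → T3 → V3), IsHardSphereEulerSolution σ T ρ u θ →
          ∀ Φ : (N : ℕ) → HardSphereFlow (Torus.geometry (Fin 3)) (hsDiameter σ N) (N + 1),
            TendstoHydroFieldsAt (fun N => localGibbsLaw σ a₀ u₀ θ₀ N (Φ N)) Φ ρ u θ 0 →
              ∀ t ∈ Set.Ico 0 T, ∀ χ : T3 → ℝ, Literature.Analysis.FunctionSpaces.Torus.IsSmooth χ → ∀ δ : ℝ, 0 < δ →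
                ∃ C : ℝ, 0 < C ∧ ∀ N : ℕ,
                  ((localGibbsLaw σ a₀ u₀ θ₀ N (Φ N)).prod (lambertNoise (Fin 3)))
                      {p | δ < |empiricalDensityField
                          (lambertFlow (Torus.geometry (Fin 3)) (hsDiameter σ N) p.2 p.1 t) χ -
                        ∫ q, empiricalDensityField
                          (lambertFlow (Torus.geometry (Fin 3)) (hsDiameter σ N) q.2 q.1 t) χ
                          ∂((localGibbsLaw σ a₀ u₀ θ₀ N (Φ N)).prod (lambertNoise (Fin 3)))|} ≤
                    ENNReal.ofReal (C * Real.exp (-(C⁻¹ * ((N : ℝ) + 1)))) ∧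
                  ((localGibbsLaw σ a₀ u₀ θ₀ N (Φ N)).prod (lambertNoise (Fin 3)))
                      {p | δ < ‖empiricalMomentumField
                          (lambertFlow (Torus.geometry (Fin 3)) (hsDiameter σ N) p.2 p.1 t) χ -
                        ∫ q, empiricalMomentumField
                          (lambertFlow (Torus.geometry (Fin 3)) (hsDiameter σ N) q.2 q.1 t) χ
                          ∂((localGibbsLaw σ a₀ u₀ θ₀ N (Φ N)).prod (lambertNoise (Fin 3)))‖} ≤
                    ENNReal.ofReal (C * Real.exp (-(C⁻¹ * ((N : ℝ) + 1)))) ∧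
                  ((localGibbsLaw σ a₀ u₀ θ₀ N (Φ N)).prod (lambertNoise (Fin 3)))
                      {p | δ < |empiricalEnergyField
                          (lambertFlow (Torus.geometry (Fin 3)) (hsDiameter σ N) p.2 p.1 t) χ -
                        ∫ q, empiricalEnergyField
                          (lambertFlow (Torus.geometry (Fin 3)) (hsDiameter σ N) q.2 q.1 t) χ
                          ∂((localGibbsLaw σ a₀ u₀ θ₀ N (Φ N)).prod (lambertNoise (Fin 3)))|} ≤
                    ENNReal.ofReal (C * Real.exp (-(C⁻¹ * ((N : ℝ) + 1))))) :
    ∀ (a₀ θ₀ : T3 → ℝ) (u₀ : T3 → V3), Continuous a₀ → Continuous θ₀ → Continuous u₀ →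
      (∀ x, 0 < a₀ x) → (∀ x, 0 < θ₀ x) →
      ∃ σ₀ : ℝ, 0 < σ₀ ∧ ∀ σ : ℝ, 0 < σ → σ < σ₀ →
        ∀ (T : ℝ) (ρ θ : ℝ → T3 → ℝ) (u : ℝ → T3 → V3), IsHardSphereEulerSolution σ T ρ u θ →
          ∀ Φ : (N : ℕ) → HardSphereFlow (Torus.geometry (Fin 3)) (hsDiameter σ N) (N + 1),
            TendstoHydroFieldsAt (fun N => localGibbsLaw σ a₀ u₀ θ₀ N (Φ N)) Φ ρ u θ 0 →
              ∀ t ∈ Set.Ico 0 T, ∀ χ : T3 → ℝ, Literature.Analysis.FunctionSpaces.Torus.IsSmooth χ →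
                ∀ F : ℝ × V3 × ℝ → ℝ, LipschitzWith 1 F → (∀ y, |F y| ≤ 1) → ∀ δ : ℝ, 0 < δ →
                  ∃ C : ℝ, 0 < C ∧ ∀ N : ℕ,
                    ((localGibbsLaw σ a₀ u₀ θ₀ N (Φ N)).prod (lambertNoise (Fin 3)))
                      {p | δ < |F (empiricalDensityField
                              (lambertFlow (Torus.geometry (Fin 3)) (hsDiameter σ N) p.2 p.1 t) χ,
                            empiricalMomentumField
                              (lambertFlow (Torus.geometry (Fin 3)) (hsDiameter σ N) p.2 p.1 t) χ,
                            empiricalEnergyField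
                              (lambertFlow (Torus.geometry (Fin 3)) (hsDiameter σ N) p.2 p.1 t) χ) -
                          ∫ q, F (empiricalDensityField
                              (lambertFlow (Torus.geometry (Fin 3)) (hsDiameter σ N) q.2 q.1 t) χ,
                            empiricalMomentumField
                              (lambertFlow (Torus.geometry (Fin 3)) (hsDiameter σ N) q.2 q.1 t) χ,
                            empiricalEnergyField
                              (lambertFlow (Torus.geometry (Fin 3)) (hsDiameter σ N) q.2 q.1 t) χ)
                            ∂((localGibbsLaw σ a₀ u₀ θ₀ N (Φ N)).prod (lambertNoise (Fin 3)))|} ≤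
                      ENNReal.ofReal (C * Real.exp (-(C⁻¹ * ((N : ℝ) + 1)))) :=
  -- LANDED p127332 (`…Theorems.LambertianContactSwapSwapGapStubFieldConcentrationSmoothOfLinear`); imported (v15).
  _root_.Summit.AtomisticToContinuum.HydrodynamicLimit.Theorems.stub_fieldConcentration_smooth_of_linear hlin

/-- **T7 · SMOOTH TEST FUNCTIONS SUFFICE ON THE Λ-SIDE** (`stub_fieldConcentration_of_smoothTest`): S2 follows from its restriction
to test functions `χ` with smooth periodic lift (`Torus.IsSmooth χ`).  Proof: given continuous `χ`, `F`, `δ`, pick a smooth `χ'` with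
`‖χ − χ'‖_∞ ≤ η` (real trigonometric polynomials are dense in `C(𝕋³)` and smooth, cf. T1); for every configuration `w`,
`max(|ρ_χ(w) − ρ_χ'(w)|, ‖m_χ(w) − m_χ'(w)‖, |e_χ(w) − e_χ'(w)|) ≤ η (1 + 2·e_1(w))` with `e_1(w) = (N+1)⁻¹∑ᵢ‖vᵢ‖²/2` the kinetic
energy per particle (`‖v‖ ≤ 1 + ‖v‖²/2`… i.e. `≤ 1/2 + ‖v‖²/2`); along `Λ` the kinetic energy does not increase
(`configEnergy_lambertFlow_le`), and under `P_N` it is exponentially concentrated: `P_N{K < e_1} ≤ C e^{−(N+1)/C}` for some `K`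
(R0 / `uniformLocalGibbsConcentration_proof`, stmt-14445, with `χ ≡ 1`, plus the uniform mean bound
`exists_lintegral_sum_norm_sq_localGibbsLaw_le`).  With `η (1 + 2K) ≤ δ/8`: off the exponentially small event, `F(fld_χ Λ_t)` is
within `δ/8` of `F(fld_χ' Λ_t)`, the two means differ by at most `δ/8 + 2 C e^{−(N+1)/C}`, so for `N ≥ N₀` the deviation event
of `χ` at level `δ` lies in the deviation event of `χ'` at level `δ/2` union the energy event; the finitely many `N < N₀` and the
factor are absorbed into the constant (`UniformLGC.Kexp_le_Kexp`); `σ₀ := min (1/2) (min σ₀' σ₀'')`. [folklore] -/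
theorem stub_fieldConcentration_of_smoothTest
    (hsm :
    ∀ (a₀ θ₀ : T3 → ℝ) (u₀ : T3 → V3), Continuous a₀ → Continuous θ₀ → Continuous u₀ →
      (∀ x, 0 < a₀ x) → (∀ x, 0 < θ₀ x) →
      ∃ σ₀ : ℝ, 0 < σ₀ ∧ ∀ σ : ℝ, 0 < σ → σ < σ₀ →
        ∀ (T : ℝ) (ρ θ : ℝ → T3 → ℝ) (u : ℝ → T3 → V3), IsHardSphereEulerSolution σ T ρ u θ →
          ∀ Φ : (N : ℕ) → HardSphereFlow (Torus.geometry (Fin 3)) (hsDiameter σ N) (N + 1),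
            TendstoHydroFieldsAt (fun N => localGibbsLaw σ a₀ u₀ θ₀ N (Φ N)) Φ ρ u θ 0 →
              ∀ t ∈ Set.Ico 0 T, ∀ χ : T3 → ℝ, Literature.Analysis.FunctionSpaces.Torus.IsSmooth χ →
                ∀ F : ℝ × V3 × ℝ → ℝ, LipschitzWith 1 F → (∀ y, |F y| ≤ 1) → ∀ δ : ℝ, 0 < δ →
                  ∃ C : ℝ, 0 < C ∧ ∀ N : ℕ,
                    ((localGibbsLaw σ a₀ u₀ θ₀ N (Φ N)).prod (lambertNoise (Fin 3)))
                      {p | δ < |F (empiricalDensityField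
                              (lambertFlow (Torus.geometry (Fin 3)) (hsDiameter σ N) p.2 p.1 t) χ,
                            empiricalMomentumField
                              (lambertFlow (Torus.geometry (Fin 3)) (hsDiameter σ N) p.2 p.1 t) χ,
                            empiricalEnergyField
                              (lambertFlow (Torus.geometry (Fin 3)) (hsDiameter σ N) p.2 p.1 t) χ) -
                          ∫ q, F (empiricalDensityField
                              (lambertFlow (Torus.geometry (Fin 3)) (hsDiameter σ N) q.2 q.1 t) χ,
                            empiricalMomentumField
                              (lambertFlow (Torus.geometry (Fin 3)) (hsDiameter σ N) q.2 q.1 t) χ,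
                            empiricalEnergyField
                              (lambertFlow (Torus.geometry (Fin 3)) (hsDiameter σ N) q.2 q.1 t) χ)
                            ∂((localGibbsLaw σ a₀ u₀ θ₀ N (Φ N)).prod (lambertNoise (Fin 3)))|} ≤
                      ENNReal.ofReal (C * Real.exp (-(C⁻¹ * ((N : ℝ) + 1))))) :
    ∀ (a₀ θ₀ : T3 → ℝ) (u₀ : T3 → V3), Continuous a₀ → Continuous θ₀ → Continuous u₀ →
      (∀ x, 0 < a₀ x) → (∀ x, 0 < θ₀ x) →
      ∃ σ₀ : ℝ, 0 < σ₀ ∧ ∀ σ : ℝ, 0 < σ → σ < σ₀ →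
        ∀ (T : ℝ) (ρ θ : ℝ → T3 → ℝ) (u : ℝ → T3 → V3), IsHardSphereEulerSolution σ T ρ u θ →
          ∀ Φ : (N : ℕ) → HardSphereFlow (Torus.geometry (Fin 3)) (hsDiameter σ N) (N + 1),
            TendstoHydroFieldsAt (fun N => localGibbsLaw σ a₀ u₀ θ₀ N (Φ N)) Φ ρ u θ 0 →
              ∀ t ∈ Set.Ico 0 T, ∀ χ : T3 → ℝ, Continuous χ →
                ∀ F : ℝ × V3 × ℝ → ℝ, LipschitzWith 1 F → (∀ y, |F y| ≤ 1) → ∀ δ : ℝ, 0 < δ →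
                  ∃ C : ℝ, 0 < C ∧ ∀ N : ℕ,
                    ((localGibbsLaw σ a₀ u₀ θ₀ N (Φ N)).prod (lambertNoise (Fin 3)))
                      {p | δ < |F (empiricalDensityField
                              (lambertFlow (Torus.geometry (Fin 3)) (hsDiameter σ N) p.2 p.1 t) χ,
                            empiricalMomentumField
                              (lambertFlow (Torus.geometry (Fin 3)) (hsDiameter σ N) p.2 p.1 t) χ,
                            empiricalEnergyField
                              (lambertFlow (Torus.geometry (Fin 3)) (hsDiameter σ N) p.2 p.1 t) χ) -
                          ∫ q, F (empiricalDensityField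
                              (lambertFlow (Torus.geometry (Fin 3)) (hsDiameter σ N) q.2 q.1 t) χ,
                            empiricalMomentumField
                              (lambertFlow (Torus.geometry (Fin 3)) (hsDiameter σ N) q.2 q.1 t) χ,
                            empiricalEnergyField
                              (lambertFlow (Torus.geometry (Fin 3)) (hsDiameter σ N) q.2 q.1 t) χ)
                            ∂((localGibbsLaw σ a₀ u₀ θ₀ N (Φ N)).prod (lambertNoise (Fin 3)))|} ≤
                      ENNReal.ofReal (C * Real.exp (-(C⁻¹ * ((N : ℝ) + 1)))) :=
  -- LANDED p127506 (`…Theorems.LambertianContactSwapSwapGapStubFieldConcentrationOfSmoothTest`); imported (v15).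
  _root_.Summit.AtomisticToContinuum.HydrodynamicLimit.Theorems.stub_fieldConcentration_of_smoothTest hsm

/-- **The Λ-side research obligation in reduced form** (T7 ∘ T5): speed-`N` self-averaging of the five linear statistics
`(N+1)⁻¹∑ᵢ χ(xᵢ)(1, vᵢ, ‖vᵢ‖²/2)` of the Lambertian gas about their means, for smooth `χ`, gives S2 verbatim. [folklore] -/
theorem fieldConcentration_of_linearSmooth
    (hlin :
    ∀ (a₀ θ₀ : T3 → ℝ) (u₀ : T3 → V3), Continuous a₀ → Continuous θ₀ → Continuous u₀ →
      (∀ x, 0 < a₀ x) → (∀ x, 0 < θ₀ x) →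
      ∃ σ₀ : ℝ, 0 < σ₀ ∧ ∀ σ : ℝ, 0 < σ → σ < σ₀ →
        ∀ (T : ℝ) (ρ θ : ℝ → T3 → ℝ) (u : ℝ → T3 → V3), IsHardSphereEulerSolution σ T ρ u θ →
          ∀ Φ : (N : ℕ) → HardSphereFlow (Torus.geometry (Fin 3)) (hsDiameter σ N) (N + 1),
            TendstoHydroFieldsAt (fun N => localGibbsLaw σ a₀ u₀ θ₀ N (Φ N)) Φ ρ u θ 0 →
              ∀ t ∈ Set.Ico 0 T, ∀ χ : T3 → ℝ, Literature.Analysis.FunctionSpaces.Torus.IsSmooth χ → ∀ δ : ℝ, 0 < δ →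
                ∃ C : ℝ, 0 < C ∧ ∀ N : ℕ,
                  ((localGibbsLaw σ a₀ u₀ θ₀ N (Φ N)).prod (lambertNoise (Fin 3)))
                      {p | δ < |empiricalDensityField
                          (lambertFlow (Torus.geometry (Fin 3)) (hsDiameter σ N) p.2 p.1 t) χ -
                        ∫ q, empiricalDensityField
                          (lambertFlow (Torus.geometry (Fin 3)) (hsDiameter σ N) q.2 q.1 t) χ
                          ∂((localGibbsLaw σ a₀ u₀ θ₀ N (Φ N)).prod (lambertNoise (Fin 3)))|} ≤
                    ENNReal.ofReal (C * Real.exp (-(C⁻¹ * ((N : ℝ) + 1)))) ∧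
                  ((localGibbsLaw σ a₀ u₀ θ₀ N (Φ N)).prod (lambertNoise (Fin 3)))
                      {p | δ < ‖empiricalMomentumField
                          (lambertFlow (Torus.geometry (Fin 3)) (hsDiameter σ N) p.2 p.1 t) χ -
                        ∫ q, empiricalMomentumField
                          (lambertFlow (Torus.geometry (Fin 3)) (hsDiameter σ N) q.2 q.1 t) χ
                          ∂((localGibbsLaw σ a₀ u₀ θ₀ N (Φ N)).prod (lambertNoise (Fin 3)))‖} ≤
                    ENNReal.ofReal (C * Real.exp (-(C⁻¹ * ((N : ℝ) + 1)))) ∧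
                  ((localGibbsLaw σ a₀ u₀ θ₀ N (Φ N)).prod (lambertNoise (Fin 3)))
                      {p | δ < |empiricalEnergyField
                          (lambertFlow (Torus.geometry (Fin 3)) (hsDiameter σ N) p.2 p.1 t) χ -
                        ∫ q, empiricalEnergyField
                          (lambertFlow (Torus.geometry (Fin 3)) (hsDiameter σ N) q.2 q.1 t) χ
                          ∂((localGibbsLaw σ a₀ u₀ θ₀ N (Φ N)).prod (lambertNoise (Fin 3)))|} ≤
                    ENNReal.ofReal (C * Real.exp (-(C⁻¹ * ((N : ℝ) + 1))))) :
    ∀ (a₀ θ₀ : T3 → ℝ) (u₀ : T3 → V3), Continuous a₀ → Continuous θ₀ → Continuous u₀ →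
      (∀ x, 0 < a₀ x) → (∀ x, 0 < θ₀ x) →
      ∃ σ₀ : ℝ, 0 < σ₀ ∧ ∀ σ : ℝ, 0 < σ → σ < σ₀ →
        ∀ (T : ℝ) (ρ θ : ℝ → T3 → ℝ) (u : ℝ → T3 → V3), IsHardSphereEulerSolution σ T ρ u θ →
          ∀ Φ : (N : ℕ) → HardSphereFlow (Torus.geometry (Fin 3)) (hsDiameter σ N) (N + 1),
            TendstoHydroFieldsAt (fun N => localGibbsLaw σ a₀ u₀ θ₀ N (Φ N)) Φ ρ u θ 0 →
              ∀ t ∈ Set.Ico 0 T, ∀ χ : T3 → ℝ, Continuous χ →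
                ∀ F : ℝ × V3 × ℝ → ℝ, LipschitzWith 1 F → (∀ y, |F y| ≤ 1) → ∀ δ : ℝ, 0 < δ →
                  ∃ C : ℝ, 0 < C ∧ ∀ N : ℕ,
                    ((localGibbsLaw σ a₀ u₀ θ₀ N (Φ N)).prod (lambertNoise (Fin 3)))
                      {p | δ < |F (empiricalDensityField
                              (lambertFlow (Torus.geometry (Fin 3)) (hsDiameter σ N) p.2 p.1 t) χ,
                            empiricalMomentumField
                              (lambertFlow (Torus.geometry (Fin 3)) (hsDiameter σ N) p.2 p.1 t) χ,
                            empiricalEnergyField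
                              (lambertFlow (Torus.geometry (Fin 3)) (hsDiameter σ N) p.2 p.1 t) χ) -
                          ∫ q, F (empiricalDensityField
                              (lambertFlow (Torus.geometry (Fin 3)) (hsDiameter σ N) q.2 q.1 t) χ,
                            empiricalMomentumField
                              (lambertFlow (Torus.geometry (Fin 3)) (hsDiameter σ N) q.2 q.1 t) χ,
                            empiricalEnergyField
                              (lambertFlow (Torus.geometry (Fin 3)) (hsDiameter σ N) q.2 q.1 t) χ)
                            ∂((localGibbsLaw σ a₀ u₀ θ₀ N (Φ N)).prod (lambertNoise (Fin 3)))|} ≤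
                      ENNReal.ofReal (C * Real.exp (-(C⁻¹ * ((N : ℝ) + 1)))) :=
  stub_fieldConcentration_of_smoothTest (stub_fieldConcentration_smooth_of_linear hlin)

/-- **The crux from S1 and the reduced Λ-side obligation** (p106427 ∘ T7 ∘ T5). [folklore] -/
theorem swapGap_of_relEntSwap_of_linearSmooth
    (hS1 :
    ∀ (a₀ θ₀ : T3 → ℝ) (u₀ : T3 → V3), Continuous a₀ → Continuous θ₀ → Continuous u₀ →
      (∀ x, 0 < a₀ x) → (∀ x, 0 < θ₀ x) →
      ∃ σ₀ : ℝ, 0 < σ₀ ∧ ∀ σ : ℝ, 0 < σ → σ < σ₀ →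
        ∀ (T : ℝ) (ρ θ : ℝ → T3 → ℝ) (u : ℝ → T3 → V3), IsHardSphereEulerSolution σ T ρ u θ →
          ∀ Φ : (N : ℕ) → HardSphereFlow (Torus.geometry (Fin 3)) (hsDiameter σ N) (N + 1),
            TendstoHydroFieldsAt (fun N => localGibbsLaw σ a₀ u₀ θ₀ N (Φ N)) Φ ρ u θ 0 →
              ∀ t ∈ Set.Ico 0 T,
                Tendsto (fun N : ℕ =>
                  klDiv ((localGibbsLaw σ a₀ u₀ θ₀ N (Φ N)).map ((Φ N).flow t))
                    (((localGibbsLaw σ a₀ u₀ θ₀ N (Φ N)).prod (lambertNoise (Fin 3))).map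
                      (fun p => lambertFlow (Torus.geometry (Fin 3)) (hsDiameter σ N) p.2 p.1 t)) /
                  ((N : ℝ≥0∞) + 1)) atTop (𝓝 0))
    (hlin :
    ∀ (a₀ θ₀ : T3 → ℝ) (u₀ : T3 → V3), Continuous a₀ → Continuous θ₀ → Continuous u₀ →
      (∀ x, 0 < a₀ x) → (∀ x, 0 < θ₀ x) →
      ∃ σ₀ : ℝ, 0 < σ₀ ∧ ∀ σ : ℝ, 0 < σ → σ < σ₀ →
        ∀ (T : ℝ) (ρ θ : ℝ → T3 → ℝ) (u : ℝ → T3 → V3), IsHardSphereEulerSolution σ T ρ u θ →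
          ∀ Φ : (N : ℕ) → HardSphereFlow (Torus.geometry (Fin 3)) (hsDiameter σ N) (N + 1),
            TendstoHydroFieldsAt (fun N => localGibbsLaw σ a₀ u₀ θ₀ N (Φ N)) Φ ρ u θ 0 →
              ∀ t ∈ Set.Ico 0 T, ∀ χ : T3 → ℝ, Literature.Analysis.FunctionSpaces.Torus.IsSmooth χ → ∀ δ : ℝ, 0 < δ →
                ∃ C : ℝ, 0 < C ∧ ∀ N : ℕ,
                  ((localGibbsLaw σ a₀ u₀ θ₀ N (Φ N)).prod (lambertNoise (Fin 3)))
                      {p | δ < |empiricalDensityField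
                          (lambertFlow (Torus.geometry (Fin 3)) (hsDiameter σ N) p.2 p.1 t) χ -
                        ∫ q, empiricalDensityField
                          (lambertFlow (Torus.geometry (Fin 3)) (hsDiameter σ N) q.2 q.1 t) χ
                          ∂((localGibbsLaw σ a₀ u₀ θ₀ N (Φ N)).prod (lambertNoise (Fin 3)))|} ≤
                    ENNReal.ofReal (C * Real.exp (-(C⁻¹ * ((N : ℝ) + 1)))) ∧
                  ((localGibbsLaw σ a₀ u₀ θ₀ N (Φ N)).prod (lambertNoise (Fin 3)))
                      {p | δ < ‖empiricalMomentumField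
                          (lambertFlow (Torus.geometry (Fin 3)) (hsDiameter σ N) p.2 p.1 t) χ -
                        ∫ q, empiricalMomentumField
                          (lambertFlow (Torus.geometry (Fin 3)) (hsDiameter σ N) q.2 q.1 t) χ
                          ∂((localGibbsLaw σ a₀ u₀ θ₀ N (Φ N)).prod (lambertNoise (Fin 3)))‖} ≤
                    ENNReal.ofReal (C * Real.exp (-(C⁻¹ * ((N : ℝ) + 1)))) ∧
                  ((localGibbsLaw σ a₀ u₀ θ₀ N (Φ N)).prod (lambertNoise (Fin 3)))
                      {p | δ < |empiricalEnergyField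
                          (lambertFlow (Torus.geometry (Fin 3)) (hsDiameter σ N) p.2 p.1 t) χ -
                        ∫ q, empiricalEnergyField
                          (lambertFlow (Torus.geometry (Fin 3)) (hsDiameter σ N) q.2 q.1 t) χ
                          ∂((localGibbsLaw σ a₀ u₀ θ₀ N (Φ N)).prod (lambertNoise (Fin 3)))|} ≤
                    ENNReal.ofReal (C * Real.exp (-(C⁻¹ * ((N : ℝ) + 1))))) :
    SwapGap :=
  swapGap_of_relEntSwap_of_fieldConcentration hS1 (fieldConcentration_of_linearSmooth hlin)

/-! ## §11 The interface stubs of v11 (registered; provable now; wave 7) -/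

/-- **T9 · EXPONENTIAL ENERGY TIGHTNESS OF THE LAMBERTIAN GAS, AT EVERY RATE, UNIFORMLY IN TIME** (`stub_energyTightnessLambda`;
rung R4 — ingredient (i), exponential tightness, of any large-deviation upper bound for `Λ`): for continuous profiles, `0 < σ < 1/2` and
every rate `M > 0` there are `K` and `C > 0` with `(P_N ⊗ γ^ℕ){K < e_1(Λ_t p)} ≤ C e^{−M(N+1)}` for all `N`, all flows and all real `t`,
`e_1 = empiricalEnergyField · 1 = (N+1)⁻¹ · configEnergy` the kinetic energy per particle.  Proof: the kinetic energy does not increase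
along `Λ` (`configEnergy_lambertFlow_le`, every `ξ`, every `t`), so the event lies in `{K < e_1(p.1)}`, whose `P_N ⊗ γ^ℕ`-measure is
`P_N{K < e_1}` (`γ^ℕ` a probability measure); under the local Gibbs law the velocities are, conditionally on the positions, independent
Gaussians `N(u₀(xᵢ), θ₀(xᵢ) I₃)` (`localGibbsLaw = particleLaw Φ (canonicalDensity … (localGibbsProfile a₀ u₀ θ₀))`, the hard-sphere
constraint involves positions only), so for `0 < λ < 1/(2 sup θ₀)`, `E_{P_N} e^{λ ∑ᵢ ‖vᵢ‖²/2} ≤ L(λ, sup θ₀, sup ‖u₀‖)^{N+1}` and Chernoff gives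
`P_N{∑ᵢ‖vᵢ‖²/2 > K(N+1)} ≤ e^{−(λK − log L)(N+1)}`; take `K := (M + log L)/λ`. [folklore] -/
theorem stub_energyTightnessLambda :
    ∀ (a₀ θ₀ : T3 → ℝ) (u₀ : T3 → V3), Continuous a₀ → Continuous θ₀ → Continuous u₀ →
      (∀ x, 0 < a₀ x) → (∀ x, 0 < θ₀ x) →
      ∀ σ : ℝ, 0 < σ → σ < 2⁻¹ → ∀ M : ℝ, 0 < M → ∃ K C : ℝ, 0 < C ∧
        ∀ (N : ℕ) (Φ : HardSphereFlow (Torus.geometry (Fin 3)) (hsDiameter σ N) (N + 1)) (t : ℝ),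
          ((localGibbsLaw σ a₀ u₀ θ₀ N Φ).prod (lambertNoise (Fin 3)))
              {p | K < empiricalEnergyField (lambertFlow (Torus.geometry (Fin 3)) (hsDiameter σ N) p.2 p.1 t) (fun _ => 1)} ≤
            ENNReal.ofReal (C * Real.exp (-(M * ((N : ℝ) + 1)))) :=
  -- LANDED p128287 (`…Theorems.LambertianContactSwapSwapGapStubEnergyTightnessLambda`); imported (v15).
  _root_.Summit.AtomisticToContinuum.HydrodynamicLimit.Theorems.stub_energyTightnessLambda

/-- **T13 · SMOOTH COMPACTLY SUPPORTED OBSERVABLES SUFFICE** (`stub_swapGap_of_smoothObservable`): the smooth-test form of the crux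
(hypothesis of T1) follows from its restriction to observables `F : ℝ × V3 × ℝ → ℝ` that are moreover `C^∞` with compact support.
Proof: fix smooth `χ`, a 1-Lipschitz `F` with `|F| ≤ 1`, `η > 0`.  TIGHTNESS: the density coordinate is bounded by `sup |χ|`, the
momentum/energy coordinates by `sup|χ|·(1/2 + e_1)`, `sup|χ|·e_1` (`empiricalFields_sub_le` with `ψ = 0`), and `E e_1 ≤ C'` uniformly in
`N` under both laws (`exists_lintegral_sum_norm_sq_localGibbsLaw_le`; conserved along `Φ` a.e., non-increasing along `Λ`), so both
field-triple laws give mass `≤ η` to the complement of the sup-metric box `B_R` for `R = R(η)`.  APPROXIMATION: mollify, cut off and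
renormalise — `G := F ∗ φ_ε` (`ContDiffBump` on the finite-dimensional space `ℝ × V3 × ℝ`; smooth, 1-Lipschitz, `|G| ≤ 1`,
`‖G − F‖_∞ ≤ ε`), `F̃ := (ψ_R · G)/(1 + c/R)` with a smooth cutoff `ψ_R ∈ [0,1]`, `= 1` on `B_R`, `c/R`-Lipschitz: then `F̃` is smooth,
compactly supported, 1-Lipschitz, `|F̃| ≤ 1`, and `|F̃ − F| ≤ ε + c/R ≤ η` on `B_R`.  Hence `|Δ_N(F) − Δ_N(F̃)| ≤ 2(η + 2η)` for all
`N`, and `Δ_N(F̃) → 0` by hypothesis; `η` arbitrary. [folklore] -/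
theorem stub_swapGap_of_smoothObservable
    (h :
    ∀ (a₀ θ₀ : T3 → ℝ) (u₀ : T3 → V3), Continuous a₀ → Continuous θ₀ → Continuous u₀ →
      (∀ x, 0 < a₀ x) → (∀ x, 0 < θ₀ x) →
      ∃ σ₀ : ℝ, 0 < σ₀ ∧ ∀ σ : ℝ, 0 < σ → σ < σ₀ →
        ∀ (T : ℝ) (ρ θ : ℝ → T3 → ℝ) (u : ℝ → T3 → V3), IsHardSphereEulerSolution σ T ρ u θ →
          ∀ Φ : (N : ℕ) → HardSphereFlow (Torus.geometry (Fin 3)) (hsDiameter σ N) (N + 1),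
            TendstoHydroFieldsAt (fun N => localGibbsLaw σ a₀ u₀ θ₀ N (Φ N)) Φ ρ u θ 0 →
              ∀ t ∈ Set.Ico 0 T, ∀ χ : T3 → ℝ, Literature.Analysis.FunctionSpaces.Torus.IsSmooth χ →
                ∀ F : ℝ × V3 × ℝ → ℝ, ContDiff ℝ ((⊤ : ℕ∞) : WithTop ℕ∞) F → HasCompactSupport F → LipschitzWith 1 F → (∀ y, |F y| ≤ 1) →
                  Tendsto (fun N : ℕ =>
                    (∫ z, F (empiricalDensityField ((Φ N).flow t z) χ,
                        empiricalMomentumField ((Φ N).flow t z) χ,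
                        empiricalEnergyField ((Φ N).flow t z) χ) ∂(localGibbsLaw σ a₀ u₀ θ₀ N (Φ N))) -
                    ∫ p, F (empiricalDensityField
                          (lambertFlow (Torus.geometry (Fin 3)) (hsDiameter σ N) p.2 p.1 t) χ,
                        empiricalMomentumField
                          (lambertFlow (Torus.geometry (Fin 3)) (hsDiameter σ N) p.2 p.1 t) χ,
                        empiricalEnergyField
                          (lambertFlow (Torus.geometry (Fin 3)) (hsDiameter σ N) p.2 p.1 t) χ)
                      ∂((localGibbsLaw σ a₀ u₀ θ₀ N (Φ N)).prod (lambertNoise (Fin 3))))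
                  atTop (𝓝 0)) :
    ∀ (a₀ θ₀ : T3 → ℝ) (u₀ : T3 → V3), Continuous a₀ → Continuous θ₀ → Continuous u₀ →
      (∀ x, 0 < a₀ x) → (∀ x, 0 < θ₀ x) →
      ∃ σ₀ : ℝ, 0 < σ₀ ∧ ∀ σ : ℝ, 0 < σ → σ < σ₀ →
        ∀ (T : ℝ) (ρ θ : ℝ → T3 → ℝ) (u : ℝ → T3 → V3), IsHardSphereEulerSolution σ T ρ u θ →
          ∀ Φ : (N : ℕ) → HardSphereFlow (Torus.geometry (Fin 3)) (hsDiameter σ N) (N + 1),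
            TendstoHydroFieldsAt (fun N => localGibbsLaw σ a₀ u₀ θ₀ N (Φ N)) Φ ρ u θ 0 →
              ∀ t ∈ Set.Ico 0 T, ∀ χ : T3 → ℝ, Literature.Analysis.FunctionSpaces.Torus.IsSmooth χ →
                ∀ F : ℝ × V3 × ℝ → ℝ, LipschitzWith 1 F → (∀ y, |F y| ≤ 1) →
                  Tendsto (fun N : ℕ =>
                    (∫ z, F (empiricalDensityField ((Φ N).flow t z) χ,
                        empiricalMomentumField ((Φ N).flow t z) χ,
                        empiricalEnergyField ((Φ N).flow t z) χ) ∂(localGibbsLaw σ a₀ u₀ θ₀ N (Φ N))) -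
                    ∫ p, F (empiricalDensityField
                          (lambertFlow (Torus.geometry (Fin 3)) (hsDiameter σ N) p.2 p.1 t) χ,
                        empiricalMomentumField
                          (lambertFlow (Torus.geometry (Fin 3)) (hsDiameter σ N) p.2 p.1 t) χ,
                        empiricalEnergyField
                          (lambertFlow (Torus.geometry (Fin 3)) (hsDiameter σ N) p.2 p.1 t) χ)
                      ∂((localGibbsLaw σ a₀ u₀ θ₀ N (Φ N)).prod (lambertNoise (Fin 3))))
                  atTop (𝓝 0) :=
  -- LANDED p128776 (`…Theorems.LambertianContactSwapSwapGapStubSwapGapOfSmoothObservable`); imported (v15).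
  _root_.Summit.AtomisticToContinuum.HydrodynamicLimit.Theorems.stub_swapGap_of_smoothObservable h

/-- **T15 · FOURIER MODES SUFFICE ON THE Λ-SIDE** (`stub_linearConcentration_of_fourierModes`): speed-`N` self-averaging of the five
linear statistics `ρ_χ, m_χ, e_χ` of `Λ_t` for every smooth `χ` (the hypothesis of T5) follows from the same for the countable family
`χ ∈ {Re e_k, Im e_k : k ∈ ℤ³}` (`e_k = UnitAddTorus.mFourier k`).  Proof: a smooth `χ` has rapidly decaying Fourier coefficients
(`Torus.IsSmooth.rapidDecay_mFourierCoeff`, `RapidDecay.summable_norm`) and is the sum of its Fourier series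
(`IsSmooth.fourierSynth_mFourierCoeff`, `RapidDecay.hasSum_fourierSynth`); being real, `χ = ∑_k (Re ĉ_k · Re e_k − Im ĉ_k · Im e_k)`.
Truncate at a finite set `S` of modes with `∑_{k∉S} ‖ĉ_k‖ ≤ η`; the fields are linear in `χ` and `|ρ_ψ| ≤ sup|ψ|`,
`‖m_ψ‖ ≤ sup|ψ|(1/2 + e_1)`, `|e_ψ| ≤ sup|ψ| e_1` (`empiricalFields_sub_le`), so off the exponentially small energy event `{K < e_1}`
(`uniformLocalGibbsConcentration_proof` with `χ ≡ 1`, as in T7, and `e_1(Λ_t p) ≤ e_1(p.1)`) the tail contributes `≤ 2η(1 + K) ≤ δ/4`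
to statistic and mean alike, and the finitely many modes in `S` are handled by the hypothesis at level `δ/(4 ∑_{k∈S}(|Re ĉ_k| + |Im ĉ_k|) + 1)`
and a union bound; constants absorbed as in `expConc_sub_integral_of_expConc_sub_const`. [folklore] -/
theorem stub_linearConcentration_of_fourierModes
    (hmodes :
    ∀ (a₀ θ₀ : T3 → ℝ) (u₀ : T3 → V3), Continuous a₀ → Continuous θ₀ → Continuous u₀ →
      (∀ x, 0 < a₀ x) → (∀ x, 0 < θ₀ x) →
      ∃ σ₀ : ℝ, 0 < σ₀ ∧ ∀ σ : ℝ, 0 < σ → σ < σ₀ →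
        ∀ (T : ℝ) (ρ θ : ℝ → T3 → ℝ) (u : ℝ → T3 → V3), IsHardSphereEulerSolution σ T ρ u θ →
          ∀ Φ : (N : ℕ) → HardSphereFlow (Torus.geometry (Fin 3)) (hsDiameter σ N) (N + 1),
            TendstoHydroFieldsAt (fun N => localGibbsLaw σ a₀ u₀ θ₀ N (Φ N)) Φ ρ u θ 0 →
              ∀ t ∈ Set.Ico 0 T, ∀ (k : Fin 3 → ℤ) (χ : T3 → ℝ),
                ((χ = fun x => (UnitAddTorus.mFourier k x).re) ∨ (χ = fun x => (UnitAddTorus.mFourier k x).im)) →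
              ∀ δ : ℝ, 0 < δ →
                ∃ C : ℝ, 0 < C ∧ ∀ N : ℕ,
                  ((localGibbsLaw σ a₀ u₀ θ₀ N (Φ N)).prod (lambertNoise (Fin 3)))
                      {p | δ < |empiricalDensityField
                          (lambertFlow (Torus.geometry (Fin 3)) (hsDiameter σ N) p.2 p.1 t) χ -
                        ∫ q, empiricalDensityField
                          (lambertFlow (Torus.geometry (Fin 3)) (hsDiameter σ N) q.2 q.1 t) χ
                          ∂((localGibbsLaw σ a₀ u₀ θ₀ N (Φ N)).prod (lambertNoise (Fin 3)))|} ≤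
                    ENNReal.ofReal (C * Real.exp (-(C⁻¹ * ((N : ℝ) + 1)))) ∧
                  ((localGibbsLaw σ a₀ u₀ θ₀ N (Φ N)).prod (lambertNoise (Fin 3)))
                      {p | δ < ‖empiricalMomentumField
                          (lambertFlow (Torus.geometry (Fin 3)) (hsDiameter σ N) p.2 p.1 t) χ -
                        ∫ q, empiricalMomentumField
                          (lambertFlow (Torus.geometry (Fin 3)) (hsDiameter σ N) q.2 q.1 t) χ
                          ∂((localGibbsLaw σ a₀ u₀ θ₀ N (Φ N)).prod (lambertNoise (Fin 3)))‖} ≤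
                    ENNReal.ofReal (C * Real.exp (-(C⁻¹ * ((N : ℝ) + 1)))) ∧
                  ((localGibbsLaw σ a₀ u₀ θ₀ N (Φ N)).prod (lambertNoise (Fin 3)))
                      {p | δ < |empiricalEnergyField
                          (lambertFlow (Torus.geometry (Fin 3)) (hsDiameter σ N) p.2 p.1 t) χ -
                        ∫ q, empiricalEnergyField
                          (lambertFlow (Torus.geometry (Fin 3)) (hsDiameter σ N) q.2 q.1 t) χ
                          ∂((localGibbsLaw σ a₀ u₀ θ₀ N (Φ N)).prod (lambertNoise (Fin 3)))|} ≤
                    ENNReal.ofReal (C * Real.exp (-(C⁻¹ * ((N : ℝ) + 1))))) :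
    ∀ (a₀ θ₀ : T3 → ℝ) (u₀ : T3 → V3), Continuous a₀ → Continuous θ₀ → Continuous u₀ →
      (∀ x, 0 < a₀ x) → (∀ x, 0 < θ₀ x) →
      ∃ σ₀ : ℝ, 0 < σ₀ ∧ ∀ σ : ℝ, 0 < σ → σ < σ₀ →
        ∀ (T : ℝ) (ρ θ : ℝ → T3 → ℝ) (u : ℝ → T3 → V3), IsHardSphereEulerSolution σ T ρ u θ →
          ∀ Φ : (N : ℕ) → HardSphereFlow (Torus.geometry (Fin 3)) (hsDiameter σ N) (N + 1),
            TendstoHydroFieldsAt (fun N => localGibbsLaw σ a₀ u₀ θ₀ N (Φ N)) Φ ρ u θ 0 →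
              ∀ t ∈ Set.Ico 0 T, ∀ χ : T3 → ℝ, Literature.Analysis.FunctionSpaces.Torus.IsSmooth χ → ∀ δ : ℝ, 0 < δ →
                ∃ C : ℝ, 0 < C ∧ ∀ N : ℕ,
                  ((localGibbsLaw σ a₀ u₀ θ₀ N (Φ N)).prod (lambertNoise (Fin 3)))
                      {p | δ < |empiricalDensityField
                          (lambertFlow (Torus.geometry (Fin 3)) (hsDiameter σ N) p.2 p.1 t) χ -
                        ∫ q, empiricalDensityField
                          (lambertFlow (Torus.geometry (Fin 3)) (hsDiameter σ N) q.2 q.1 t) χ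
                          ∂((localGibbsLaw σ a₀ u₀ θ₀ N (Φ N)).prod (lambertNoise (Fin 3)))|} ≤
                    ENNReal.ofReal (C * Real.exp (-(C⁻¹ * ((N : ℝ) + 1)))) ∧
                  ((localGibbsLaw σ a₀ u₀ θ₀ N (Φ N)).prod (lambertNoise (Fin 3)))
                      {p | δ < ‖empiricalMomentumField
                          (lambertFlow (Torus.geometry (Fin 3)) (hsDiameter σ N) p.2 p.1 t) χ -
                        ∫ q, empiricalMomentumField
                          (lambertFlow (Torus.geometry (Fin 3)) (hsDiameter σ N) q.2 q.1 t) χ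
                          ∂((localGibbsLaw σ a₀ u₀ θ₀ N (Φ N)).prod (lambertNoise (Fin 3)))‖} ≤
                    ENNReal.ofReal (C * Real.exp (-(C⁻¹ * ((N : ℝ) + 1)))) ∧
                  ((localGibbsLaw σ a₀ u₀ θ₀ N (Φ N)).prod (lambertNoise (Fin 3)))
                      {p | δ < |empiricalEnergyField
                          (lambertFlow (Torus.geometry (Fin 3)) (hsDiameter σ N) p.2 p.1 t) χ -
                        ∫ q, empiricalEnergyField
                          (lambertFlow (Torus.geometry (Fin 3)) (hsDiameter σ N) q.2 q.1 t) χ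
                          ∂((localGibbsLaw σ a₀ u₀ θ₀ N (Φ N)).prod (lambertNoise (Fin 3)))|} ≤
                    ENNReal.ofReal (C * Real.exp (-(C⁻¹ * ((N : ℝ) + 1)))) :=
  -- LANDED p129668 (`…Theorems.LambertianContactSwapSwapGapStubLinearConcentrationOfFourierModes`); imported (v15).
  _root_.Summit.AtomisticToContinuum.HydrodynamicLimit.Theorems.stub_linearConcentration_of_fourierModes hmodes

/-- **SwapGap from smooth tests and smooth compactly supported observables** (T1 ∘ T13). [folklore] -/
theorem swapGap_of_smoothObservable
    (h :
    ∀ (a₀ θ₀ : T3 → ℝ) (u₀ : T3 → V3), Continuous a₀ → Continuous θ₀ → Continuous u₀ →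
      (∀ x, 0 < a₀ x) → (∀ x, 0 < θ₀ x) →
      ∃ σ₀ : ℝ, 0 < σ₀ ∧ ∀ σ : ℝ, 0 < σ → σ < σ₀ →
        ∀ (T : ℝ) (ρ θ : ℝ → T3 → ℝ) (u : ℝ → T3 → V3), IsHardSphereEulerSolution σ T ρ u θ →
          ∀ Φ : (N : ℕ) → HardSphereFlow (Torus.geometry (Fin 3)) (hsDiameter σ N) (N + 1),
            TendstoHydroFieldsAt (fun N => localGibbsLaw σ a₀ u₀ θ₀ N (Φ N)) Φ ρ u θ 0 →
              ∀ t ∈ Set.Ico 0 T, ∀ χ : T3 → ℝ, Literature.Analysis.FunctionSpaces.Torus.IsSmooth χ →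
                ∀ F : ℝ × V3 × ℝ → ℝ, ContDiff ℝ ((⊤ : ℕ∞) : WithTop ℕ∞) F → HasCompactSupport F → LipschitzWith 1 F → (∀ y, |F y| ≤ 1) →
                  Tendsto (fun N : ℕ =>
                    (∫ z, F (empiricalDensityField ((Φ N).flow t z) χ,
                        empiricalMomentumField ((Φ N).flow t z) χ,
                        empiricalEnergyField ((Φ N).flow t z) χ) ∂(localGibbsLaw σ a₀ u₀ θ₀ N (Φ N))) -
                    ∫ p, F (empiricalDensityField
                          (lambertFlow (Torus.geometry (Fin 3)) (hsDiameter σ N) p.2 p.1 t) χ,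
                        empiricalMomentumField
                          (lambertFlow (Torus.geometry (Fin 3)) (hsDiameter σ N) p.2 p.1 t) χ,
                        empiricalEnergyField
                          (lambertFlow (Torus.geometry (Fin 3)) (hsDiameter σ N) p.2 p.1 t) χ)
                      ∂((localGibbsLaw σ a₀ u₀ θ₀ N (Φ N)).prod (lambertNoise (Fin 3))))
                  atTop (𝓝 0)) :
    SwapGap :=
  stub_swapGap_of_smoothTest (stub_swapGap_of_smoothObservable h)

/-- **The Λ-side research obligation in its countable form** (T7 ∘ T5 ∘ T15): speed-`N` self-averaging of the additive statistics
`(N+1)⁻¹∑ᵢ e_k(xᵢ)(1, vᵢ, ‖vᵢ‖²/2)` (real and imaginary parts), `k ∈ ℤ³`, of the Lambertian gas about their means gives S2. [folklore] -/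
theorem fieldConcentration_of_fourierModes
    (hmodes :
    ∀ (a₀ θ₀ : T3 → ℝ) (u₀ : T3 → V3), Continuous a₀ → Continuous θ₀ → Continuous u₀ →
      (∀ x, 0 < a₀ x) → (∀ x, 0 < θ₀ x) →
      ∃ σ₀ : ℝ, 0 < σ₀ ∧ ∀ σ : ℝ, 0 < σ → σ < σ₀ →
        ∀ (T : ℝ) (ρ θ : ℝ → T3 → ℝ) (u : ℝ → T3 → V3), IsHardSphereEulerSolution σ T ρ u θ →
          ∀ Φ : (N : ℕ) → HardSphereFlow (Torus.geometry (Fin 3)) (hsDiameter σ N) (N + 1),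
            TendstoHydroFieldsAt (fun N => localGibbsLaw σ a₀ u₀ θ₀ N (Φ N)) Φ ρ u θ 0 →
              ∀ t ∈ Set.Ico 0 T, ∀ (k : Fin 3 → ℤ) (χ : T3 → ℝ),
                ((χ = fun x => (UnitAddTorus.mFourier k x).re) ∨ (χ = fun x => (UnitAddTorus.mFourier k x).im)) →
              ∀ δ : ℝ, 0 < δ →
                ∃ C : ℝ, 0 < C ∧ ∀ N : ℕ,
                  ((localGibbsLaw σ a₀ u₀ θ₀ N (Φ N)).prod (lambertNoise (Fin 3)))
                      {p | δ < |empiricalDensityField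
                          (lambertFlow (Torus.geometry (Fin 3)) (hsDiameter σ N) p.2 p.1 t) χ -
                        ∫ q, empiricalDensityField
                          (lambertFlow (Torus.geometry (Fin 3)) (hsDiameter σ N) q.2 q.1 t) χ
                          ∂((localGibbsLaw σ a₀ u₀ θ₀ N (Φ N)).prod (lambertNoise (Fin 3)))|} ≤
                    ENNReal.ofReal (C * Real.exp (-(C⁻¹ * ((N : ℝ) + 1)))) ∧
                  ((localGibbsLaw σ a₀ u₀ θ₀ N (Φ N)).prod (lambertNoise (Fin 3)))
                      {p | δ < ‖empiricalMomentumField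
                          (lambertFlow (Torus.geometry (Fin 3)) (hsDiameter σ N) p.2 p.1 t) χ -
                        ∫ q, empiricalMomentumField
                          (lambertFlow (Torus.geometry (Fin 3)) (hsDiameter σ N) q.2 q.1 t) χ
                          ∂((localGibbsLaw σ a₀ u₀ θ₀ N (Φ N)).prod (lambertNoise (Fin 3)))‖} ≤
                    ENNReal.ofReal (C * Real.exp (-(C⁻¹ * ((N : ℝ) + 1)))) ∧
                  ((localGibbsLaw σ a₀ u₀ θ₀ N (Φ N)).prod (lambertNoise (Fin 3)))
                      {p | δ < |empiricalEnergyField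
                          (lambertFlow (Torus.geometry (Fin 3)) (hsDiameter σ N) p.2 p.1 t) χ -
                        ∫ q, empiricalEnergyField
                          (lambertFlow (Torus.geometry (Fin 3)) (hsDiameter σ N) q.2 q.1 t) χ
                          ∂((localGibbsLaw σ a₀ u₀ θ₀ N (Φ N)).prod (lambertNoise (Fin 3)))|} ≤
                    ENNReal.ofReal (C * Real.exp (-(C⁻¹ * ((N : ℝ) + 1))))) :
    ∀ (a₀ θ₀ : T3 → ℝ) (u₀ : T3 → V3), Continuous a₀ → Continuous θ₀ → Continuous u₀ →
      (∀ x, 0 < a₀ x) → (∀ x, 0 < θ₀ x) →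
      ∃ σ₀ : ℝ, 0 < σ₀ ∧ ∀ σ : ℝ, 0 < σ → σ < σ₀ →
        ∀ (T : ℝ) (ρ θ : ℝ → T3 → ℝ) (u : ℝ → T3 → V3), IsHardSphereEulerSolution σ T ρ u θ →
          ∀ Φ : (N : ℕ) → HardSphereFlow (Torus.geometry (Fin 3)) (hsDiameter σ N) (N + 1),
            TendstoHydroFieldsAt (fun N => localGibbsLaw σ a₀ u₀ θ₀ N (Φ N)) Φ ρ u θ 0 →
              ∀ t ∈ Set.Ico 0 T, ∀ χ : T3 → ℝ, Continuous χ →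
                ∀ F : ℝ × V3 × ℝ → ℝ, LipschitzWith 1 F → (∀ y, |F y| ≤ 1) → ∀ δ : ℝ, 0 < δ →
                  ∃ C : ℝ, 0 < C ∧ ∀ N : ℕ,
                    ((localGibbsLaw σ a₀ u₀ θ₀ N (Φ N)).prod (lambertNoise (Fin 3)))
                      {p | δ < |F (empiricalDensityField
                              (lambertFlow (Torus.geometry (Fin 3)) (hsDiameter σ N) p.2 p.1 t) χ,
                            empiricalMomentumField
                              (lambertFlow (Torus.geometry (Fin 3)) (hsDiameter σ N) p.2 p.1 t) χ,
                            empiricalEnergyField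
                              (lambertFlow (Torus.geometry (Fin 3)) (hsDiameter σ N) p.2 p.1 t) χ) -
                          ∫ q, F (empiricalDensityField
                              (lambertFlow (Torus.geometry (Fin 3)) (hsDiameter σ N) q.2 q.1 t) χ,
                            empiricalMomentumField
                              (lambertFlow (Torus.geometry (Fin 3)) (hsDiameter σ N) q.2 q.1 t) χ,
                            empiricalEnergyField
                              (lambertFlow (Torus.geometry (Fin 3)) (hsDiameter σ N) q.2 q.1 t) χ)
                            ∂((localGibbsLaw σ a₀ u₀ θ₀ N (Φ N)).prod (lambertNoise (Fin 3)))|} ≤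
                      ENNReal.ofReal (C * Real.exp (-(C⁻¹ * ((N : ℝ) + 1)))) :=
  fieldConcentration_of_linearSmooth (stub_linearConcentration_of_fourierModes hmodes)

/-! ## §12 THE REVERSED ENTROPY LINE (v12, lead c6): `KL(q_t ‖ p_t)` is an explicit Loschmidt-echo deficit

In the forward direction the likelihood gap `∫ h_t d(q_t − p_t)` involves the unknown density `h_t = llr q_t G_N` of the LAMBERTIAN
law.  In the reversed direction the density of the DETERMINISTIC law is explicit — `dp_t/dG_N = exp(L_N ∘ Φ_{-t})`, `L_N = llr P_N G_N`
(Liouville) — and the two-sidedly dominated chain rule of c1 (`toReal_klDiv_eq_of_dominated`) gives the exact identity T16.  Registered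
stubs of this section: T16 (proved, p131129), S1ʳ′ `stub_echoMeanReturn` (research), S2ʳ `stub_detFieldConcentration` (research), T18 (proved,
p131129), T17 p131474, T19 p131409, T20 p131327, T21 p131628, T22 p131463 (wave 8, ALL LANDED; proofs inlined).  StandardBorel instance:
`standardBorelSpace_config`. -/

/-- **T16 · THE REVERSED DECOMPOSITION** (`stub_reversedDecomposition`, registered stub of line `Sketch`, skeleton
v12 §12): for continuous profiles `a₀, θ₀ > 0`, `u₀`, `0 < σ < 1/2`, every `N`, every hard-sphere flow `Φ` and
every `t ≥ 0`, with `P_N`, `G_N`, `p_t`, `q_t`, `L_N = llr P_N G_N` as in the module docstring: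
`KL(q_t ‖ p_t) < ∞`, `KL(P_N ‖ G_N) < ∞`, `KL(q_t ‖ G_N) ≤ KL(P_N ‖ G_N)` (data processing along `Λ`),
`L_N` is `P_N`-integrable, the echo observable `L_N ∘ Φ_{-t} ∘ Λ_t` is `P_N ⊗ γ^ℕ`-integrable, and
`KL(q_t ‖ p_t) + [KL(P_N ‖ G_N) − KL(q_t ‖ G_N)] = ∫ L_N dP_N − ∫ L_N(Φ_{-t}(Λ_t p)) d(P_N ⊗ γ^ℕ)(p)`.
[cite: KipnisLandim1999, Ch. 6 §1] -/
theorem stub_reversedDecomposition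
    {a₀ θ₀ : T3 → ℝ} {u₀ : T3 → V3} (ha : Continuous a₀) (hθ : Continuous θ₀)
    (hu : Continuous u₀) (ha0 : ∀ x, 0 < a₀ x) (hθ0 : ∀ x, 0 < θ₀ x) {σ : ℝ} (hσ : 0 < σ)
    (hσ' : σ < 2⁻¹) (N : ℕ) (Φ : HardSphereFlow (Torus.geometry (Fin 3)) (hsDiameter σ N) (N + 1))
    {t : ℝ} (ht : 0 ≤ t) :
    klDiv (((localGibbsLaw σ a₀ u₀ θ₀ N Φ).prod (lambertNoise (Fin 3))).map
          (fun p => lambertFlow (Torus.geometry (Fin 3)) (hsDiameter σ N) p.2 p.1 t))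
        ((localGibbsLaw σ a₀ u₀ θ₀ N Φ).map (Φ.flow t)) ≠ ∞ ∧
    klDiv (localGibbsLaw σ a₀ u₀ θ₀ N Φ)
        (localGibbsLaw σ (fun _ => 1) (fun _ => 0) (fun _ => 1) N Φ) ≠ ∞ ∧
    klDiv (((localGibbsLaw σ a₀ u₀ θ₀ N Φ).prod (lambertNoise (Fin 3))).map
          (fun p => lambertFlow (Torus.geometry (Fin 3)) (hsDiameter σ N) p.2 p.1 t))
        (localGibbsLaw σ (fun _ => 1) (fun _ => 0) (fun _ => 1) N Φ) ≤
      klDiv (localGibbsLaw σ a₀ u₀ θ₀ N Φ)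
        (localGibbsLaw σ (fun _ => 1) (fun _ => 0) (fun _ => 1) N Φ) ∧
    Integrable (llr (localGibbsLaw σ a₀ u₀ θ₀ N Φ)
        (localGibbsLaw σ (fun _ => 1) (fun _ => 0) (fun _ => 1) N Φ)) (localGibbsLaw σ a₀ u₀ θ₀ N Φ) ∧
    Integrable (fun p => llr (localGibbsLaw σ a₀ u₀ θ₀ N Φ)
        (localGibbsLaw σ (fun _ => 1) (fun _ => 0) (fun _ => 1) N Φ)
        (Φ.flow (-t) (lambertFlow (Torus.geometry (Fin 3)) (hsDiameter σ N) p.2 p.1 t)))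
      ((localGibbsLaw σ a₀ u₀ θ₀ N Φ).prod (lambertNoise (Fin 3))) ∧
    (klDiv (((localGibbsLaw σ a₀ u₀ θ₀ N Φ).prod (lambertNoise (Fin 3))).map
          (fun p => lambertFlow (Torus.geometry (Fin 3)) (hsDiameter σ N) p.2 p.1 t))
        ((localGibbsLaw σ a₀ u₀ θ₀ N Φ).map (Φ.flow t))).toReal +
      ((klDiv (localGibbsLaw σ a₀ u₀ θ₀ N Φ)
          (localGibbsLaw σ (fun _ => 1) (fun _ => 0) (fun _ => 1) N Φ)).toReal -
        (klDiv (((localGibbsLaw σ a₀ u₀ θ₀ N Φ).prod (lambertNoise (Fin 3))).map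
            (fun p => lambertFlow (Torus.geometry (Fin 3)) (hsDiameter σ N) p.2 p.1 t))
          (localGibbsLaw σ (fun _ => 1) (fun _ => 0) (fun _ => 1) N Φ)).toReal) =
      (∫ z, llr (localGibbsLaw σ a₀ u₀ θ₀ N Φ)
          (localGibbsLaw σ (fun _ => 1) (fun _ => 0) (fun _ => 1) N Φ) z ∂(localGibbsLaw σ a₀ u₀ θ₀ N Φ)) -
        ∫ p, llr (localGibbsLaw σ a₀ u₀ θ₀ N Φ)
          (localGibbsLaw σ (fun _ => 1) (fun _ => 0) (fun _ => 1) N Φ)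
          (Φ.flow (-t) (lambertFlow (Torus.geometry (Fin 3)) (hsDiameter σ N) p.2 p.1 t))
          ∂((localGibbsLaw σ a₀ u₀ θ₀ N Φ).prod (lambertNoise (Fin 3))) := by
  have hσ2 : σ ≤ 1 / 2 := by rw [one_div]; exact hσ'.le
  have hLI : ∀ ε : ℝ, 0 < ε → ε < 2⁻¹ → ∀ (N : ℕ) (t : ℝ), 0 ≤ t →
      ((liouville (Torus.geometry (Fin 3)) N ε).prod (lambertNoise (Fin 3))).map
          (fun p => lambertFlow (Torus.geometry (Fin 3)) ε p.2 p.1 t) =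
        liouville (Torus.geometry (Fin 3)) N ε :=
    stub_liouvilleInvarianceLambda
  obtain ⟨A, b, hA, hb, hdom⟩ := exists_localGibbsLaw_dominated ha hθ hu ha0 hθ0 hσ2
  obtain ⟨h1, h2, h3, hEi, -⟩ := hdom N Φ
  set P := localGibbsLaw σ a₀ u₀ θ₀ N Φ with hPdef
  set Gr := localGibbsLaw σ (fun _ => (1 : ℝ)) (fun _ => (0 : V3)) (fun _ => (1 : ℝ)) N Φ with hGdef
  set Λt : Config (N + 1) (Fin 3) T3 × (ℕ → V3) → Config (N + 1) (Fin 3) T3 :=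
    fun p => lambertFlow (Torus.geometry (Fin 3)) (hsDiameter σ N) p.2 p.1 t with hΛt
  have hΛ : Measurable Λt := measurable_lambertFlow_hsDiameter hσ.le hσ' N t
  haveI : IsProbabilityMeasure P := isProbabilityMeasure_localGibbsLaw ha hθ hu ha0 hθ0 hσ2 N Φ
  haveI : IsProbabilityMeasure Gr := isProbabilityMeasure_localGibbsLaw (a₀ := fun _ => (1 : ℝ))
    (θ₀ := fun _ => (1 : ℝ)) (u₀ := fun _ => (0 : V3)) continuous_const continuous_const
    continuous_const (fun _ => one_pos) (fun _ => one_pos) hσ2 N Φ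
  haveI : StandardBorelSpace (Config (N + 1) (Fin 3) T3) := standardBorelSpace_config (N + 1)
  set μ := P.map (Φ.flow t) with hμ
  set ν := (P.prod (lambertNoise (Fin 3))).map Λt with hν
  set r := ν.map (Φ.flow (-t)) with hr
  haveI : IsProbabilityMeasure μ :=
    Measure.isProbabilityMeasure_map (Φ.measurable_flow t).aemeasurable
  haveI : IsProbabilityMeasure ν := Measure.isProbabilityMeasure_map hΛ.aemeasurable
  haveI : IsProbabilityMeasure r :=
    Measure.isProbabilityMeasure_map (Φ.measurable_flow (-t)).aemeasurable
  -- invariances of the homogeneous Gibbs law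
  have hGinv : ∀ s : ℝ, Gr.map (Φ.flow s) = Gr := fun s =>
    map_flow_localGibbsLaw_const σ 1 1 0 N Φ s
  have hGΛ : (Gr.prod (lambertNoise (Fin 3))).map Λt = Gr :=
    gibbsInvariance_of_liouvilleInvariance hLI hσ hσ' N 1 1 0 Φ ht
  -- the tilt `V = A(N+1) + b E`
  set V : Config (N + 1) (Fin 3) T3 → ℝ := fun z => A * ((N : ℝ) + 1) + b * configEnergy z with hV
  have hEm : Measurable (configEnergy : Config (N + 1) (Fin 3) T3 → ℝ) := by
    unfold configEnergy
    exact measurable_const.mul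
      (Finset.measurable_sum _ fun i _ => ((measurable_pi_apply i).snd).norm.pow_const 2)
  have hVm : Measurable V := (measurable_const.mul hEm).const_add _
  -- laws carried by the good set
  have hPL : P ≪ liouville (Torus.geometry (Fin 3)) (N + 1) (hsDiameter σ N) :=
    withDensity_absolutelyContinuous _ _
  have hGL : Gr ≪ liouville (Torus.geometry (Fin 3)) (N + 1) (hsDiameter σ N) :=
    withDensity_absolutelyContinuous _ _
  have hPgood : P Φ.goodᶜ = 0 := measure_compl_good_eq_zero_of_absolutelyContinuous Φ hPL
  have hGgood : Gr Φ.goodᶜ = 0 := measure_compl_good_eq_zero_of_absolutelyContinuous Φ hGL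
  -- the Lambertian law is two-sidedly dominated (static domination transported along `Λ`)
  obtain ⟨hlow, hup⟩ := withDensity_le_map_prod_lambertFlow_le_withDensity hLI hσ hσ' N Φ ht
    (P := P) (F₁ := fun e => ENNReal.ofReal (Real.exp (-(A * ((N : ℝ) + 1) + b * e))))
    (F₂ := fun e => ENNReal.ofReal (Real.exp (A * ((N : ℝ) + 1) + b * e)))
    ((Real.measurable_exp.comp ((measurable_const.mul measurable_id).const_add _).neg).ennreal_ofReal)
    ((Real.measurable_exp.comp ((measurable_const.mul measurable_id).const_add _)).ennreal_ofReal)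
    h2 h1
  have hνG : ν ≪ Gr :=
    (Measure.absolutelyContinuous_of_le hup).trans (withDensity_absolutelyContinuous _ _)
  have hνgood : ν Φ.goodᶜ = 0 := measure_compl_good_eq_zero_of_absolutelyContinuous Φ (hνG.trans hGL)
  -- `KL(q_t ‖ G)` is finite
  obtain ⟨-, hbdν, -⟩ := llr_ae_of_dominated (μ := ν) hνG hVm hlow hup
  have hEΛ : ∀ᵐ p ∂(P.prod (lambertNoise (Fin 3))), configEnergy (Λt p) = configEnergy p.1 := by
    refine (Measure.ae_prod_iff_ae_ae ?_).2 (ae_of_all _ fun z =>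
      (ae_lambertNoise_forall_configEnergy_lambertFlow_hsDiameter hσ.le hσ' N z).mono
        fun ξs h => h t)
    exact measurableSet_eq_fun (hEm.comp hΛ) (hEm.comp measurable_fst)
  have hEiν : Integrable (configEnergy : Config (N + 1) (Fin 3) T3 → ℝ) ν := by
    rw [hν, integrable_map_measure hEm.aestronglyMeasurable hΛ.aemeasurable]
    exact (hEi.comp_fst (lambertNoise (Fin 3))).congr (hEΛ.mono fun p hp => hp.symm)
  have hViν : Integrable V ν := (integrable_const _).add (hEiν.const_mul b)
  have hiν : Integrable (llr ν Gr) ν := by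
    refine Integrable.mono' hViν (measurable_llr _ _).aestronglyMeasurable ?_
    filter_upwards [hbdν] with x hx
    rw [Real.norm_eq_abs]
    exact abs_le.2 hx
  have hfinνG : klDiv ν Gr ≠ ∞ := klDiv_ne_top hνG hiν
  -- transport of both arguments of a relative entropy by `Φ_{-t}` (a.e. inverse `Φ_t` on the good set)
  have key : ∀ (a c : Measure (Config (N + 1) (Fin 3) T3)) [IsFiniteMeasure a] [IsFiniteMeasure c],
      a Φ.goodᶜ = 0 → c Φ.goodᶜ = 0 →
        klDiv (a.map (Φ.flow (-t))) (c.map (Φ.flow (-t))) = klDiv a c :=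
    fun a c _ _ hag hcg =>
      Literature.MathematicalPhysics.StatisticalMechanics.klDiv_map_eq_of_leftInvOn
        (Φ.measurable_flow (-t)) (Φ.measurable_flow t) Φ.measurableSet_good hag hcg
        (fun z hz => Φ.flow_flow_neg t hz)
  have hgoodP : ∀ᵐ z ∂P, z ∈ Φ.good := by rw [ae_iff]; exact hPgood
  have hμback : μ.map (Φ.flow (-t)) = P := by
    rw [hμ, Measure.map_map (Φ.measurable_flow (-t)) (Φ.measurable_flow t),
      Measure.map_congr (show (Φ.flow (-t) ∘ Φ.flow t) =ᵐ[P] id from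
        hgoodP.mono fun z hz => Φ.flow_neg_flow t hz), Measure.map_id]
  have hμgood : μ Φ.goodᶜ = 0 := by
    rw [hμ, Measure.map_apply (Φ.measurable_flow t) Φ.measurableSet_good.compl]
    refine measure_mono_null (fun z hz => ?_) hPgood
    intro hzg
    exact hz (Φ.mapsTo_good t hzg)
  have hklνμ : klDiv ν μ = klDiv r P := by
    rw [← key ν μ hνgood hμgood, hμback]
  have hklrG : klDiv r Gr = klDiv ν Gr := by
    have h := key ν Gr hνgood hGgood
    rwa [hGinv (-t)] at h
  have hrG : r ≪ Gr := by
    have h := hνG.map (Φ.measurable_flow (-t))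
    rwa [hGinv (-t)] at h
  have hfinrG : klDiv r Gr ≠ ∞ := by rw [hklrG]; exact hfinνG
  -- `V` is `r`-integrable (energy conserved along `Φ`)
  have hgoodν : ∀ᵐ z ∂ν, z ∈ Φ.good := by rw [ae_iff]; exact hνgood
  have hEr : Integrable (configEnergy : Config (N + 1) (Fin 3) T3 → ℝ) r := by
    rw [hr, integrable_map_measure hEm.aestronglyMeasurable (Φ.measurable_flow (-t)).aemeasurable]
    exact hEiν.congr (hgoodν.mono fun z hz => (Φ.configEnergy_flow hz (-t)).symm)
  have hVr : Integrable V r := (integrable_const _).add (hEr.const_mul b)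
  -- the dominated chain rule for `KL(r_t ‖ P_N)` against the STATIC domination of `P_N`
  obtain ⟨hfinrP, hirP, heqr, -⟩ := toReal_klDiv_eq_of_dominated hrG hfinrG hVm hVr hVr h2 h1
  -- `KL(P_N ‖ G_N) = ∫ L_N dP_N`
  have hPG : P ≪ Gr := (Measure.absolutelyContinuous_of_le h1).trans (withDensity_absolutelyContinuous _ _)
  obtain ⟨-, hbdP, -⟩ := llr_ae_of_dominated (μ := P) hPG hVm h2 h1
  have hViP : Integrable V P := (integrable_const _).add (hEi.const_mul b)
  have hiP : Integrable (llr P Gr) P := by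
    refine Integrable.mono' hViP (measurable_llr _ _).aestronglyMeasurable ?_
    filter_upwards [hbdP] with x hx
    rw [Real.norm_eq_abs]
    exact abs_le.2 hx
  have hklP : (klDiv P Gr).toReal = ∫ z, llr P Gr z ∂P := toReal_klDiv_of_measure_eq hPG (by simp)
  -- the echo integral
  have hmeas : AEStronglyMeasurable (fun z => llr P Gr (Φ.flow (-t) z))
      ((P.prod (lambertNoise (Fin 3))).map Λt) :=
    ((measurable_llr _ _).comp (Φ.measurable_flow (-t))).aestronglyMeasurable
  have hintr : ∫ x, llr P Gr x ∂r = ∫ p, llr P Gr (Φ.flow (-t) (Λt p)) ∂(P.prod (lambertNoise (Fin 3))) := by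
    rw [hr, integral_map (Φ.measurable_flow (-t)).aemeasurable (measurable_llr _ _).aestronglyMeasurable,
      hν, integral_map hΛ.aemeasurable hmeas]
  have hiecho : Integrable (fun p => llr P Gr (Φ.flow (-t) (Λt p))) (P.prod (lambertNoise (Fin 3))) := by
    have h := hirP
    rw [hr, integrable_map_measure (measurable_llr _ _).aestronglyMeasurable
      (Φ.measurable_flow (-t)).aemeasurable] at h
    have h2 : Integrable (fun z => llr P Gr (Φ.flow (-t) z)) ((P.prod (lambertNoise (Fin 3))).map Λt) := h
    rw [integrable_map_measure hmeas hΛ.aemeasurable] at h2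
    exact h2
  refine ⟨?_, ne_top_of_le_ne_top ENNReal.ofReal_ne_top h3, ?_, hiP, hiecho, ?_⟩
  · rw [hklνμ]; exact hfinrP
  · exact klDiv_map_prod_le_of_invariant P Gr (lambertNoise (Fin 3)) hΛ hGΛ
  · rw [hklνμ, heqr, hklrG, hklP, hintr]
    ring

/-- **T18 · ECHO MEAN RETURN ⟹ REVERSED ENTROPY SWAP** (`stub_revRelEntSwap_of_echoMeanReturn`, registered stub of line
`Sketch`, skeleton v12 §12): with the crux's quantifier prefix, if the Loschmidt-echo deficit of the log-likelihood
observable `L_N = llr P_N G_N` is `o(N)` pre-shock (ECHO MEAN RETURN, the research stub S1ʳ′ `stub_echoMeanReturn`), then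
`KL(q_t ‖ p_t)/(N+1) → 0` in `ℝ≥0∞` pre-shock (S1ʳ, `RevRelEntSwap`) — because
`KL(q_t ‖ p_t) ≤ KL(q_t ‖ p_t) + [KL(P_N ‖ G_N) − KL(q_t ‖ G_N)] = (N+1)·deficit_N(t)` (`stub_reversedDecomposition`).
Threshold `σ₀ := min (1/2) σ_E`. [cite: KipnisLandim1999, Ch. 6 §1] -/
theorem stub_revRelEntSwap_of_echoMeanReturn
    (hE : ∀ (a₀ θ₀ : T3 → ℝ) (u₀ : T3 → V3), Continuous a₀ → Continuous θ₀ → Continuous u₀ →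
      (∀ x, 0 < a₀ x) → (∀ x, 0 < θ₀ x) →
      ∃ σ₀ : ℝ, 0 < σ₀ ∧ ∀ σ : ℝ, 0 < σ → σ < σ₀ →
        ∀ (T : ℝ) (ρ θ : ℝ → T3 → ℝ) (u : ℝ → T3 → V3), IsHardSphereEulerSolution σ T ρ u θ →
          ∀ Φ : (N : ℕ) → HardSphereFlow (Torus.geometry (Fin 3)) (hsDiameter σ N) (N + 1),
            TendstoHydroFieldsAt (fun N => localGibbsLaw σ a₀ u₀ θ₀ N (Φ N)) Φ ρ u θ 0 →
              ∀ t ∈ Set.Ico 0 T,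
                Tendsto (fun N : ℕ =>
                  ((∫ z, llr (localGibbsLaw σ a₀ u₀ θ₀ N (Φ N))
                      (localGibbsLaw σ (fun _ => 1) (fun _ => 0) (fun _ => 1) N (Φ N)) z
                      ∂(localGibbsLaw σ a₀ u₀ θ₀ N (Φ N))) -
                    ∫ p, llr (localGibbsLaw σ a₀ u₀ θ₀ N (Φ N))
                      (localGibbsLaw σ (fun _ => 1) (fun _ => 0) (fun _ => 1) N (Φ N))
                      ((Φ N).flow (-t) (lambertFlow (Torus.geometry (Fin 3)) (hsDiameter σ N) p.2 p.1 t))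
                      ∂((localGibbsLaw σ a₀ u₀ θ₀ N (Φ N)).prod (lambertNoise (Fin 3)))) /
                    ((N : ℝ) + 1)) atTop (𝓝 0)) :
    ∀ (a₀ θ₀ : T3 → ℝ) (u₀ : T3 → V3), Continuous a₀ → Continuous θ₀ → Continuous u₀ →
      (∀ x, 0 < a₀ x) → (∀ x, 0 < θ₀ x) →
      ∃ σ₀ : ℝ, 0 < σ₀ ∧ ∀ σ : ℝ, 0 < σ → σ < σ₀ →
        ∀ (T : ℝ) (ρ θ : ℝ → T3 → ℝ) (u : ℝ → T3 → V3), IsHardSphereEulerSolution σ T ρ u θ →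
          ∀ Φ : (N : ℕ) → HardSphereFlow (Torus.geometry (Fin 3)) (hsDiameter σ N) (N + 1),
            TendstoHydroFieldsAt (fun N => localGibbsLaw σ a₀ u₀ θ₀ N (Φ N)) Φ ρ u θ 0 →
              ∀ t ∈ Set.Ico 0 T,
                Tendsto (fun N : ℕ =>
                  klDiv (((localGibbsLaw σ a₀ u₀ θ₀ N (Φ N)).prod (lambertNoise (Fin 3))).map
                      (fun p => lambertFlow (Torus.geometry (Fin 3)) (hsDiameter σ N) p.2 p.1 t))
                    ((localGibbsLaw σ a₀ u₀ θ₀ N (Φ N)).map ((Φ N).flow t)) /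
                  ((N : ℝ≥0∞) + 1)) atTop (𝓝 0) := by
  intro a₀ θ₀ u₀ ha hθ hu ha0 hθ0
  obtain ⟨σE, hσE, hE'⟩ := hE a₀ θ₀ u₀ ha hθ hu ha0 hθ0
  refine ⟨min 2⁻¹ σE, lt_min (by norm_num) hσE, ?_⟩
  intro σ hσ hσlt T ρ θ u hEul Φ h0 t ht
  have hσhalf : σ < 2⁻¹ := hσlt.trans_le (min_le_left _ _)
  have hσE' : σ < σE := hσlt.trans_le (min_le_right _ _)
  have hD := hE' σ hσ hσE' T ρ θ u hEul Φ h0 t ht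
  -- names
  set k : ℕ → ℝ≥0∞ := fun N =>
    klDiv (((localGibbsLaw σ a₀ u₀ θ₀ N (Φ N)).prod (lambertNoise (Fin 3))).map
        (fun p => lambertFlow (Torus.geometry (Fin 3)) (hsDiameter σ N) p.2 p.1 t))
      ((localGibbsLaw σ a₀ u₀ θ₀ N (Φ N)).map ((Φ N).flow t)) with hk
  set D : ℕ → ℝ := fun N =>
    (∫ z, llr (localGibbsLaw σ a₀ u₀ θ₀ N (Φ N))
        (localGibbsLaw σ (fun _ => 1) (fun _ => 0) (fun _ => 1) N (Φ N)) z
        ∂(localGibbsLaw σ a₀ u₀ θ₀ N (Φ N))) -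
      ∫ p, llr (localGibbsLaw σ a₀ u₀ θ₀ N (Φ N))
        (localGibbsLaw σ (fun _ => 1) (fun _ => 0) (fun _ => 1) N (Φ N))
        ((Φ N).flow (-t) (lambertFlow (Torus.geometry (Fin 3)) (hsDiameter σ N) p.2 p.1 t))
        ∂((localGibbsLaw σ a₀ u₀ θ₀ N (Φ N)).prod (lambertNoise (Fin 3))) with hDdef
  -- per `N`: `k_N` finite and `k_N.toReal ≤ D_N`
  have hle : ∀ N, k N ≠ ∞ ∧ (k N).toReal ≤ D N := by
    intro N
    obtain ⟨hfin, hfinP, hdp, -, -, heq⟩ :=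
      stub_reversedDecomposition ha hθ hu ha0 hθ0 hσ hσhalf N (Φ N) ht.1
    refine ⟨hfin, ?_⟩
    have hbr : 0 ≤ (klDiv (localGibbsLaw σ a₀ u₀ θ₀ N (Φ N))
          (localGibbsLaw σ (fun _ => 1) (fun _ => 0) (fun _ => 1) N (Φ N))).toReal -
        (klDiv (((localGibbsLaw σ a₀ u₀ θ₀ N (Φ N)).prod (lambertNoise (Fin 3))).map
            (fun p => lambertFlow (Torus.geometry (Fin 3)) (hsDiameter σ N) p.2 p.1 t))
          (localGibbsLaw σ (fun _ => 1) (fun _ => 0) (fun _ => 1) N (Φ N))).toReal :=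
      sub_nonneg.2 (ENNReal.toReal_mono hfinP hdp)
    have h := heq
    change (k N).toReal + _ = D N at h
    linarith
  -- squeeze in `ℝ≥0∞`
  have hcast : ∀ N : ℕ, ENNReal.ofReal ((N : ℝ) + 1) = (N : ℝ≥0∞) + 1 := fun N => by
    rw [ENNReal.ofReal_add (by positivity) zero_le_one, ENNReal.ofReal_natCast, ENNReal.ofReal_one]
  have hbound : ∀ N : ℕ, k N / ((N : ℝ≥0∞) + 1) ≤ ENNReal.ofReal (D N / ((N : ℝ) + 1)) := by
    intro N
    obtain ⟨hfin, hleN⟩ := hle N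
    rw [ENNReal.ofReal_div_of_pos (by positivity), hcast N]
    gcongr
    rw [← ENNReal.ofReal_toReal hfin]
    exact ENNReal.ofReal_le_ofReal hleN
  have hlim : Tendsto (fun N : ℕ => ENNReal.ofReal (D N / ((N : ℝ) + 1))) atTop (𝓝 0) := by
    rw [← ENNReal.ofReal_zero]
    exact ENNReal.tendsto_ofReal hD
  exact tendsto_of_tendsto_of_tendsto_of_le_of_le tendsto_const_nhds hlim (fun N => zero_le) hbound

/-- **S1ʳ′ · ECHO MEAN RETURN** (`stub_echoMeanReturn`; NEW RESEARCH stub of v12 — the EXPLICIT p-side obligation of the reversed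
line; open): with the crux's quantifier prefix, for every `t ∈ [0, T)` (pre-shock) the Loschmidt-echo deficit PER PARTICLE of the
log-likelihood observable `L_N = llr P_N G_N` vanishes as `N → ∞`:
`[E_{P_N} L_N − E_{P_N ⊗ γ^ℕ} L_N(Φ_{-t}(Λ_t(z, ξ)))]/(N+1) → 0` — Lambertian gas forward for time `t`, deterministic gas BACKWARD
for time `t`, and the mean of ONE explicit additive statistic returns.  By `llr_localGibbsLaw_ae_eq`, `L_N = ∑ᵢ φ(xᵢ, vᵢ) + c_N` with
`φ(x, v) = log a₀(x) − ‖v − u₀(x)‖²/(2θ₀(x)) − (3/2) log θ₀(x) + ‖v‖²/2`, so `L_N/(N+1)` is a fixed linear combination of the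
profile-tested empirical density, momentum and energy fields: the statement asks that the echo state have, IN MEAN, the hydrodynamic
fields of the datum tested against three fixed smooth functions — a hydrodynamic-limit statement for the DETERMINISTIC gas started
from the velocity-reversed Lambertian-evolved law (anti-Euler back to the initial profile).  By `stub_reversedDecomposition` the
deficit is `≥ 0` and equals `[KL(q_t ‖ p_t) + KL(P_N ‖ G_N) − KL(q_t ‖ G_N)]/(N+1)`, so S1ʳ′ ⟺ [S1ʳ `KL(q_t ‖ p_t) = o(N)`] ∧
[Λ-adiabaticity `a_N → 0`]; heuristic size `N·Kn²/(N+1) = Θ(N^{-2/3})` (Chapman–Enskog, as for S1).  TRUE at `t = 0`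
(`stub_echoMeanReturn_zero`) and at equilibrium (`stub_echoMeanReturn_equilibrium`).  WAVE-9 VERDICT (cycle 8, independent
worker, signature audited clean): `stub-blocked: Literature.MathematicalPhysics.KineticTheory.HydrodynamicLimit` — the irreducible
content is the hs-Euler limit of the DETERMINISTIC gas from the velocity-reversed time-`t` data; corrected size `≍ Kn = Θ(N^{-1/3})`
(the Λ-production term `a_N` is itself `Θ(Kn)`); a restart/echo proof would moreover need profile-class-uniform `σ₀` and backward
classical continuation of the Euler solution (neither in the statement family as typed). -/
theorem stub_echoMeanReturn :
    ∀ (a₀ θ₀ : T3 → ℝ) (u₀ : T3 → V3), Continuous a₀ → Continuous θ₀ → Continuous u₀ →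
      (∀ x, 0 < a₀ x) → (∀ x, 0 < θ₀ x) →
      ∃ σ₀ : ℝ, 0 < σ₀ ∧ ∀ σ : ℝ, 0 < σ → σ < σ₀ →
        ∀ (T : ℝ) (ρ θ : ℝ → T3 → ℝ) (u : ℝ → T3 → V3), IsHardSphereEulerSolution σ T ρ u θ →
          ∀ Φ : (N : ℕ) → HardSphereFlow (Torus.geometry (Fin 3)) (hsDiameter σ N) (N + 1),
            TendstoHydroFieldsAt (fun N => localGibbsLaw σ a₀ u₀ θ₀ N (Φ N)) Φ ρ u θ 0 →
              ∀ t ∈ Set.Ico 0 T,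
                Tendsto (fun N : ℕ =>
                  ((∫ z, llr (localGibbsLaw σ a₀ u₀ θ₀ N (Φ N))
                      (localGibbsLaw σ (fun _ => 1) (fun _ => 0) (fun _ => 1) N (Φ N)) z
                      ∂(localGibbsLaw σ a₀ u₀ θ₀ N (Φ N))) -
                    ∫ p, llr (localGibbsLaw σ a₀ u₀ θ₀ N (Φ N))
                      (localGibbsLaw σ (fun _ => 1) (fun _ => 0) (fun _ => 1) N (Φ N))
                      ((Φ N).flow (-t) (lambertFlow (Torus.geometry (Fin 3)) (hsDiameter σ N) p.2 p.1 t))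
                      ∂((localGibbsLaw σ a₀ u₀ θ₀ N (Φ N)).prod (lambertNoise (Fin 3)))) /
                    ((N : ℝ) + 1)) atTop (𝓝 0) := by
  sorry

/-- **S2ʳ · FIELD CONCENTRATION FOR THE DETERMINISTIC GAS** (`stub_detFieldConcentration`; NEW RESEARCH stub of v12 — the Φ-side
obligation of the reversed line; open): with the crux's quantifier prefix, for every continuous `χ`, every 1-Lipschitz `F` bounded
by `1` and every `δ > 0` there is `C > 0` such that for all `N` the `P_N`-probability that `F` of the `χ`-tested field triple of
`Φ_t z` deviates by more than `δ` from ITS OWN MEAN is at most `C e^{-(N+1)/C}` (speed-`N` self-averaging of the deterministic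
hard-sphere gas, pre-shock; no hydrodynamic equation mentioned).  The mirror image of S2 with `Λ` replaced by `Φ`: a dynamical
large-deviation upper bound for deterministic hard spheres at fixed reduced density — open (harder than S2: no noise); TRUE at
`t = 0` (`stub_detFieldConcentration_zero`) and at equilibrium (`stub_detFieldConcentration_equilibrium`), both from R0.
WAVE-9 VERDICT (cycle 8, independent worker, signature audited clean): `stub-blocked: none` — strictly LD-strength, the exact
Φ-twin of S2; no inventory item implies it (HydrodynamicLimit / stmt-11854 are o(1)-in-probability, stmt-0766 gives `p_t(E) → 0`
only for reference-rare `E`); the Gibbs-domination route (`dp_t/dG_N = exp(L_N∘Φ_{-t})`, `|L_N| ≤ A(N+1) + b·KE`) reaches only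
events of `G_N`-rate `> A`, never small `δ` about the moving mean. -/
theorem stub_detFieldConcentration :
    ∀ (a₀ θ₀ : T3 → ℝ) (u₀ : T3 → V3), Continuous a₀ → Continuous θ₀ → Continuous u₀ →
      (∀ x, 0 < a₀ x) → (∀ x, 0 < θ₀ x) →
      ∃ σ₀ : ℝ, 0 < σ₀ ∧ ∀ σ : ℝ, 0 < σ → σ < σ₀ →
        ∀ (T : ℝ) (ρ θ : ℝ → T3 → ℝ) (u : ℝ → T3 → V3), IsHardSphereEulerSolution σ T ρ u θ →
          ∀ Φ : (N : ℕ) → HardSphereFlow (Torus.geometry (Fin 3)) (hsDiameter σ N) (N + 1),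
            TendstoHydroFieldsAt (fun N => localGibbsLaw σ a₀ u₀ θ₀ N (Φ N)) Φ ρ u θ 0 →
              ∀ t ∈ Set.Ico 0 T, ∀ χ : T3 → ℝ, Continuous χ →
                ∀ F : ℝ × V3 × ℝ → ℝ, LipschitzWith 1 F → (∀ y, |F y| ≤ 1) → ∀ δ : ℝ, 0 < δ →
                  ∃ C : ℝ, 0 < C ∧ ∀ N : ℕ,
                    (localGibbsLaw σ a₀ u₀ θ₀ N (Φ N))
                      {z | δ < |F (empiricalDensityField ((Φ N).flow t z) χ,
                            empiricalMomentumField ((Φ N).flow t z) χ,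
                            empiricalEnergyField ((Φ N).flow t z) χ) -
                          ∫ w, F (empiricalDensityField ((Φ N).flow t w) χ,
                            empiricalMomentumField ((Φ N).flow t w) χ,
                            empiricalEnergyField ((Φ N).flow t w) χ)
                            ∂(localGibbsLaw σ a₀ u₀ θ₀ N (Φ N))|} ≤
                      ENNReal.ofReal (C * Real.exp (-(C⁻¹ * ((N : ℝ) + 1)))) := by
  sorry

/-- **T17 · THE REVERSED TRANSFER: S1ʳ ∧ S2ʳ ⟹ SwapGap** (`stub_swapGap_of_revRelEntSwap_of_detFieldConcentration`; NEW interface stub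
of v12, provable now — the mirror image of the landed composition `swapGap_of_relEntSwap_of_fieldConcentration`, p106427, with the
roles of the two gases exchanged): with `σ₀ := min (1/2) (min σ₁ σ₂)`, for `σ < σ₀`, Euler data, flows, the `t = 0` hypothesis,
`t < T`, `χ`, `F`: put `G := F ∘ fld(·, χ)` (measurable, `|G| ≤ 1`), `μ_N := (Λ_N,t)_* (P_N ⊗ γ^ℕ)`, `ν_N := (Φ_N,t)_* P_N`,
`m_N := ∫ G dν_N = ∫ G(Φ_t z) dP_N` (the crux's DETERMINISTIC term).  S2ʳ gives `ν_N{δ < |G − m_N|} ≤ C e^{−(N+1)/C}`, S1ʳ gives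
`KL(μ_N ‖ ν_N)/(N+1) → 0`, so the entropy inequality for events (`tendsto_measure_of_klDiv_div_tendsto_zero`) gives
`μ_N{δ < |G − m_N|} → 0`, i.e. `(P_N ⊗ γ^ℕ){δ < |G(Λ_t p) − m_N|} → 0` for every `δ > 0`; boundedness
(`tendsto_integral_sub_of_tendsto_measure`) gives `∫ G(Λ_t p) d(P_N ⊗ γ^ℕ) − m_N → 0`, which is the crux up to sign
(`tendsto_neg` / `neg_sub`). [cite: KipnisLandim1999, Ch. 6 §1] -/
theorem stub_swapGap_of_revRelEntSwap_of_detFieldConcentration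
    (h1 : ∀ (a₀ θ₀ : T3 → ℝ) (u₀ : T3 → V3), Continuous a₀ → Continuous θ₀ → Continuous u₀ →
      (∀ x, 0 < a₀ x) → (∀ x, 0 < θ₀ x) →
      ∃ σ₀ : ℝ, 0 < σ₀ ∧ ∀ σ : ℝ, 0 < σ → σ < σ₀ →
        ∀ (T : ℝ) (ρ θ : ℝ → T3 → ℝ) (u : ℝ → T3 → V3), IsHardSphereEulerSolution σ T ρ u θ →
          ∀ Φ : (N : ℕ) → HardSphereFlow (Torus.geometry (Fin 3)) (hsDiameter σ N) (N + 1),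
            TendstoHydroFieldsAt (fun N => localGibbsLaw σ a₀ u₀ θ₀ N (Φ N)) Φ ρ u θ 0 →
              ∀ t ∈ Set.Ico 0 T,
                Tendsto (fun N : ℕ =>
                  klDiv (((localGibbsLaw σ a₀ u₀ θ₀ N (Φ N)).prod (lambertNoise (Fin 3))).map
                      (fun p => lambertFlow (Torus.geometry (Fin 3)) (hsDiameter σ N) p.2 p.1 t))
                    ((localGibbsLaw σ a₀ u₀ θ₀ N (Φ N)).map ((Φ N).flow t)) /
                  ((N : ℝ≥0∞) + 1)) atTop (𝓝 0))
    (h2 : ∀ (a₀ θ₀ : T3 → ℝ) (u₀ : T3 → V3), Continuous a₀ → Continuous θ₀ → Continuous u₀ →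
      (∀ x, 0 < a₀ x) → (∀ x, 0 < θ₀ x) →
      ∃ σ₀ : ℝ, 0 < σ₀ ∧ ∀ σ : ℝ, 0 < σ → σ < σ₀ →
        ∀ (T : ℝ) (ρ θ : ℝ → T3 → ℝ) (u : ℝ → T3 → V3), IsHardSphereEulerSolution σ T ρ u θ →
          ∀ Φ : (N : ℕ) → HardSphereFlow (Torus.geometry (Fin 3)) (hsDiameter σ N) (N + 1),
            TendstoHydroFieldsAt (fun N => localGibbsLaw σ a₀ u₀ θ₀ N (Φ N)) Φ ρ u θ 0 →
              ∀ t ∈ Set.Ico 0 T, ∀ χ : T3 → ℝ, Continuous χ →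
                ∀ F : ℝ × V3 × ℝ → ℝ, LipschitzWith 1 F → (∀ y, |F y| ≤ 1) → ∀ δ : ℝ, 0 < δ →
                  ∃ C : ℝ, 0 < C ∧ ∀ N : ℕ,
                    (localGibbsLaw σ a₀ u₀ θ₀ N (Φ N))
                      {z | δ < |F (empiricalDensityField ((Φ N).flow t z) χ,
                            empiricalMomentumField ((Φ N).flow t z) χ,
                            empiricalEnergyField ((Φ N).flow t z) χ) -
                          ∫ w, F (empiricalDensityField ((Φ N).flow t w) χ,
                            empiricalMomentumField ((Φ N).flow t w) χ,
                            empiricalEnergyField ((Φ N).flow t w) χ)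
                            ∂(localGibbsLaw σ a₀ u₀ θ₀ N (Φ N))|} ≤
                      ENNReal.ofReal (C * Real.exp (-(C⁻¹ * ((N : ℝ) + 1))))) :
    SwapGap := by
  -- LANDED p131474 (`…Theorems.stub_swapGap_of_revRelEntSwap_of_detFieldConcentration`, wave 8); proof inlined because that module's olean cannot be served yet (BUILD-BLOCKER.md)
  delta Summit.AtomisticToContinuum.HydrodynamicLimit.Theses.LambertianContactSwap.SwapGap
  intro Cfg G ε τ S ldir lpair lstep lstate linst lflow noise fld a₀ θ₀ u₀ ha hθ hu ha0 hθ0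
  obtain ⟨σ₁, hσ₁, h1'⟩ := h1 a₀ θ₀ u₀ ha hθ hu ha0 hθ0
  obtain ⟨σ₂, hσ₂, h2'⟩ := h2 a₀ θ₀ u₀ ha hθ hu ha0 hθ0
  refine ⟨min 2⁻¹ (min σ₁ σ₂), lt_min (by norm_num) (lt_min hσ₁ hσ₂), ?_⟩
  intro σ hσ hσlt T ρ θ u hE Φ P h0 t ht χ hχ F hF hF1
  have hσhalf : σ < 2⁻¹ := hσlt.trans_le (min_le_left _ _)
  have hσ₁' : σ < σ₁ := hσlt.trans_le ((min_le_right _ _).trans (min_le_left _ _))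
  have hσ₂' : σ < σ₂ := hσlt.trans_le ((min_le_right _ _).trans (min_le_right _ _))
  -- the laws
  have hPN : ∀ N, IsProbabilityMeasure (P N) := fun N =>
    isProbabilityMeasure_localGibbsLaw ha hθ hu ha0 hθ0 (by linarith) N (Φ N)
  have hnoise : IsProbabilityMeasure noise := by
    show IsProbabilityMeasure (lambertNoise (Fin 3))
    infer_instance
  have hPn : ∀ N, IsProbabilityMeasure ((P N).prod noise) := fun N => by
    haveI := hPN N
    haveI := hnoise
    infer_instance
  -- measurability of the Lambertian flow (the `let` block is the Literature API definitionally)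
  have hΛ : ∀ N, Measurable fun p : Cfg N × (ℕ → EuclideanSpace ℝ (Fin 3)) => lflow σ N p.2 p.1 t :=
    fun N => measurable_lambertFlow_hsDiameter hσ.le hσhalf N t
  -- the bounded measurable statistic `G_N = F ∘ fld`
  have hfld : ∀ N, Measurable fun y : Cfg N => fld N y χ := fun N => measurable_fieldTriple hχ
  have hG : ∀ N, Measurable fun y : Cfg N => F (fld N y χ) :=
    fun N => hF.continuous.measurable.comp (hfld N)
  -- the two image laws (roles exchanged: `μ` Lambertian, `ν` deterministic)
  set μ : (N : ℕ) → Measure (Cfg N) := fun N =>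
    ((P N).prod noise).map (fun p => lflow σ N p.2 p.1 t) with hμ
  set ν : (N : ℕ) → Measure (Cfg N) := fun N => (P N).map ((Φ N).flow t) with hν
  haveI hμfin : ∀ N, IsFiniteMeasure (μ N) := fun N => by
    haveI := hPN N
    exact Measure.isFiniteMeasure_map _ _
  haveI hνfin : ∀ N, IsFiniteMeasure (ν N) := fun N => by
    haveI := hPN N
    exact Measure.isFiniteMeasure_map _ _
  -- the deterministic means
  set m : ℕ → ℝ := fun N => ∫ z, F (fld N ((Φ N).flow t z) χ) ∂(P N) with hm
  have hm1 : ∀ N, |m N| ≤ 1 := fun N => by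
    haveI := hPN N
    have h := norm_integral_le_of_norm_le_const (μ := P N)
      (f := fun z : Cfg N => F (fld N ((Φ N).flow t z) χ))
      (C := 1) (ae_of_all _ fun z => by
        rw [Real.norm_eq_abs]
        exact hF1 _)
    simpa [hm, Real.norm_eq_abs] using h
  -- S1ʳ: `KL(μ_N ‖ ν_N)/(N+1) → 0`
  have hkl : Tendsto (fun N : ℕ => klDiv (μ N) (ν N) / ((N : ℝ≥0∞) + 1)) atTop (𝓝 0) :=
    h1' σ hσ hσ₁' T ρ θ u hE Φ h0 t ht
  -- convergence in `P_N ⊗ γ^ℕ`-probability of `G(Λ_t p)` towards the deterministic mean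
  have hprob : ∀ δ : ℝ, 0 < δ →
      Tendsto (fun N => ((P N).prod noise)
        {p | δ < |F (fld N (lflow σ N p.2 p.1 t) χ) - m N|}) atTop (𝓝 0) := by
    intro δ hδ
    obtain ⟨C, hC, hconc⟩ := h2' σ hσ hσ₂' T ρ θ u hE Φ h0 t ht χ hχ F hF hF1 δ hδ
    set A : (N : ℕ) → Set (Cfg N) := fun N => {y | δ < |F (fld N y χ) - m N|} with hA
    have hAm : ∀ N, MeasurableSet (A N) := fun N =>
      measurableSet_lt measurable_const ((hG N).sub measurable_const).abs
    have hνA : ∀ N, ν N (A N) ≤ ENNReal.ofReal (C * Real.exp (-(C⁻¹ * ((N : ℝ) + 1)))) := by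
      intro N
      rw [hν, Measure.map_apply ((Φ N).measurable_flow t) (hAm N)]
      exact hconc N
    have hμA := tendsto_measure_of_klDiv_div_tendsto_zero μ ν A hC hνA hkl
    refine hμA.congr fun N => ?_
    rw [hμ, Measure.map_apply (hΛ N) (hAm N)]
    rfl
  -- merging of the means
  have hmerge := tendsto_integral_sub_of_tendsto_measure
    (Ω := fun N => Cfg N × (ℕ → EuclideanSpace ℝ (Fin 3))) (fun N => (P N).prod noise) hPn
    (fun N p => F (fld N (lflow σ N p.2 p.1 t) χ)) (fun N => (hG N).comp (hΛ N))
    (fun N p => hF1 _) m hm1 hprob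
  -- the crux is the sign-flipped statement
  have hfinal := hmerge.neg
  rw [neg_zero] at hfinal
  refine hfinal.congr fun N => ?_
  exact neg_sub _ _

/-- **T19 · ECHO MEAN RETURN HOLDS EXACTLY AT `t = 0`** (`stub_echoMeanReturn_zero`; NEW rung of v12, provable now): for
`0 < σ < 1/2`, continuous positive profiles, every `N` and every flow, the `t = 0` echo deficit of `stub_echoMeanReturn` is ZERO:
`Λ_0 = id` almost surely under `P_N ⊗ γ^ℕ` (`ae_lambertFlow_zero_eq`, with `P_N ≪ liouville`), `Φ_{-0} = Φ_0 = id` on the good set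
(`neg_zero`, `HardSphereFlow.flow_zero`; `P_N` gives no mass to the bad set, `measure_compl_good_eq_zero_of_absolutelyContinuous`), so the
echo integrand equals `L_N(p.1)` almost surely and `∫ L_N(p.1) d(P_N ⊗ γ^ℕ) = ∫ L_N dP_N` (`γ^ℕ` is a probability measure,
`integral_prod`/`Measure.integral_fst`-type marginalisation, or `integral_map` of `Prod.fst`). [folklore] -/
theorem stub_echoMeanReturn_zero :
    ∀ (a₀ θ₀ : T3 → ℝ) (u₀ : T3 → V3), Continuous a₀ → Continuous θ₀ → Continuous u₀ →
      (∀ x, 0 < a₀ x) → (∀ x, 0 < θ₀ x) → ∀ σ : ℝ, 0 < σ → σ < 2⁻¹ →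
        ∀ (N : ℕ) (Φ : HardSphereFlow (Torus.geometry (Fin 3)) (hsDiameter σ N) (N + 1)),
          (∫ z, llr (localGibbsLaw σ a₀ u₀ θ₀ N Φ)
              (localGibbsLaw σ (fun _ => 1) (fun _ => 0) (fun _ => 1) N Φ) z ∂(localGibbsLaw σ a₀ u₀ θ₀ N Φ)) -
            ∫ p, llr (localGibbsLaw σ a₀ u₀ θ₀ N Φ)
              (localGibbsLaw σ (fun _ => 1) (fun _ => 0) (fun _ => 1) N Φ)
              (Φ.flow (-0) (lambertFlow (Torus.geometry (Fin 3)) (hsDiameter σ N) p.2 p.1 0))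
              ∂((localGibbsLaw σ a₀ u₀ θ₀ N Φ).prod (lambertNoise (Fin 3))) = 0 := by
  -- LANDED p131409 (`…Theorems.stub_echoMeanReturn_zero`, wave 8); proof inlined because that module's olean cannot be served yet (BUILD-BLOCKER.md)
  intro a₀ θ₀ u₀ ha hθ hu ha0 hθ0 σ hσ hσ' N Φ
  haveI := isProbabilityMeasure_localGibbsLaw ha hθ hu ha0 hθ0 (by linarith : σ ≤ 1 / 2) N Φ
  set P := localGibbsLaw σ a₀ u₀ θ₀ N Φ with hPdef
  set L := llr P (localGibbsLaw σ (fun _ => 1) (fun _ => 0) (fun _ => 1) N Φ)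
  have hLm : Measurable L := measurable_llr _ _
  -- `P_N ≪ Liouville`
  have hP : P ≪ liouville (Torus.geometry (Fin 3)) (N + 1) (hsDiameter σ N) := by
    rw [hPdef, localGibbsLaw, particleLaw_eq]
    exact withDensity_absolutelyContinuous _ _
  have hε : 0 < hsDiameter σ N := hsDiameter_pos hσ N
  have hε' : hsDiameter σ N < 2⁻¹ := (hsDiameter_le hσ.le N).trans_lt hσ'
  -- `Λ_0 p = p.1` almost surely
  have h1 : ∀ᵐ p ∂(P.prod (lambertNoise (Fin 3))),
      lambertFlow (Torus.geometry (Fin 3)) (hsDiameter σ N) p.2 p.1 0 = p.1 :=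
    ae_lambertFlow_zero_eq hε hε' P hP
  -- `P_N`-a.e. configuration is good, hence so is the first coordinate under `P_N ⊗ γ^ℕ`
  have hgood : ∀ᵐ z ∂P, z ∈ Φ.good := by
    rw [ae_iff]
    exact measure_compl_good_eq_zero_of_absolutelyContinuous Φ hP
  have h2 : ∀ᵐ p ∂(P.prod (lambertNoise (Fin 3))), p.1 ∈ Φ.good :=
    (Measure.quasiMeasurePreserving_fst (μ := P) (ν := lambertNoise (Fin 3))).ae hgood
  -- the echo integrand is a.s. `L (p.1)`
  have hae : (fun p : Config (N + 1) (Fin 3) T3 × (ℕ → EuclideanSpace ℝ (Fin 3)) =>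
      L (Φ.flow (-0) (lambertFlow (Torus.geometry (Fin 3)) (hsDiameter σ N) p.2 p.1 0))) =ᵐ[
        P.prod (lambertNoise (Fin 3))] fun p => L p.1 := by
    filter_upwards [h1, h2] with p hp1 hp2
    rw [hp1, neg_zero, Φ.flow_zero _ hp2]
  rw [integral_congr_ae hae]
  -- marginalise the probability noise
  have hmap : (P.prod (lambertNoise (Fin 3))).map Prod.fst = P := by
    rw [Measure.map_fst_prod, measure_univ, one_smul]
  have hint : ∫ p, L p.1 ∂(P.prod (lambertNoise (Fin 3))) = ∫ z, L z ∂P :=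
    calc ∫ p, L p.1 ∂(P.prod (lambertNoise (Fin 3)))
          = ∫ z, L z ∂((P.prod (lambertNoise (Fin 3))).map Prod.fst) :=
            (integral_map measurable_fst.aemeasurable hLm.aestronglyMeasurable).symm
      _ = ∫ z, L z ∂P := by rw [hmap]
  rw [hint, sub_self]

/-- **Mean of an observable along a law-preserving two-step echo.** If `g` pushes `μ` to `ν` and
`φ` preserves `ν`, then `∫ f(φ(g x)) dμ = ∫ f dν` for every measurable real `f` (two changes of
variables, `integral_map`). [folklore] -/
theorem integral_comp_comp_eq_of_map_eq {α β : Type*} [MeasurableSpace α] [MeasurableSpace β]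
    {μ : Measure α} {ν : Measure β} {g : α → β} {φ : β → β} {f : β → ℝ}
    (hg : Measurable g) (hφ : Measurable φ) (hf : Measurable f)
    (hμ : μ.map g = ν) (hν : ν.map φ = ν) :
    ∫ x, f (φ (g x)) ∂μ = ∫ y, f y ∂ν :=
  calc ∫ x, f (φ (g x)) ∂μ = ∫ y, f (φ y) ∂(μ.map g) :=
        (integral_map hg.aemeasurable (hf.comp hφ).aestronglyMeasurable).symm
    _ = ∫ y, f y ∂(ν.map φ) := by
        rw [hμ]
        exact (integral_map hφ.aemeasurable hf.aestronglyMeasurable).symm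
    _ = ∫ y, f y ∂ν := by rw [hν]

/-- **T20 · ECHO MEAN RETURN HOLDS EXACTLY AT EQUILIBRIUM** (`stub_echoMeanReturn_equilibrium`; NEW rung of v12, provable now):
for CONSTANT profiles `a₀ ≡ a > 0`, `θ₀ ≡ θ > 0`, `u₀ ≡ u`, `0 < σ < 1/2`, every `N`, flow and `t ≥ 0`, the echo deficit is ZERO.
Mechanism: by `llr_localGibbsLaw_ae_eq` + `log_canonicalDensity_localGibbsProfile_eq`-type statics, `L_N = llr P_N G_N` is
`G_N`-a.e. a function of the total momentum `configMomentum` and the kinetic energy `configEnergy` only (constant profiles: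
`∑ᵢ [‖vᵢ‖²/2 − ‖vᵢ − u‖²/(2θ)] + const`), both conserved along `Λ` (`configMomentum_lambertFlow`, every noise;
`ae_lambertNoise_forall_configEnergy_lambertFlow_hsDiameter`, a.e. noise) and along `Φ` on the good set
(`HardSphereFlow.configEnergy_flow`, `configMomentum` via `IsHardSphereTrajectory`/`configMomentum_eq`); the echo law is `≪ G_N`
(it is dominated by an energy tilt of `G_N`, `withDensity_le_map_prod_lambertFlow_le_withDensity` + `Φ`-invariance of tilts), so the
`G_N`-a.e. identity transfers, the echo integrand equals `L_N(p.1)` a.s., and the two integrals coincide.  ALTERNATIVE one-line route: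
at equilibrium `p_t = q_t = P_N` (`map_flow_localGibbsLaw_const`, `gibbsInvariance_of_liouvilleInvariance` with
`stub_liouvilleInvarianceLambda`), so the echo law `(Φ_{-t})_* q_t` is `P_N` itself and the deficit is `∫ L_N dP_N − ∫ L_N dP_N`
(`integral_map` twice). [folklore] -/
theorem stub_echoMeanReturn_equilibrium :
    ∀ (a θ : ℝ) (u : V3), 0 < a → 0 < θ → ∀ σ : ℝ, 0 < σ → σ < 2⁻¹ →
      ∀ (N : ℕ) (Φ : HardSphereFlow (Torus.geometry (Fin 3)) (hsDiameter σ N) (N + 1)) (t : ℝ), 0 ≤ t →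
        (∫ z, llr (localGibbsLaw σ (fun _ => a) (fun _ => u) (fun _ => θ) N Φ)
            (localGibbsLaw σ (fun _ => 1) (fun _ => 0) (fun _ => 1) N Φ) z
            ∂(localGibbsLaw σ (fun _ => a) (fun _ => u) (fun _ => θ) N Φ)) -
          ∫ p, llr (localGibbsLaw σ (fun _ => a) (fun _ => u) (fun _ => θ) N Φ)
            (localGibbsLaw σ (fun _ => 1) (fun _ => 0) (fun _ => 1) N Φ)
            (Φ.flow (-t) (lambertFlow (Torus.geometry (Fin 3)) (hsDiameter σ N) p.2 p.1 t))
            ∂((localGibbsLaw σ (fun _ => a) (fun _ => u) (fun _ => θ) N Φ).prod (lambertNoise (Fin 3))) = 0 := by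
  -- LANDED p131327 (`…Theorems.stub_echoMeanReturn_equilibrium`, wave 8); proof inlined because that module's olean cannot be served yet (BUILD-BLOCKER.md)
  intro a θ u _ _ σ hσ hσ' N Φ t ht
  rw [sub_eq_zero]
  exact (integral_comp_comp_eq_of_map_eq (measurable_lambertFlow_hsDiameter hσ.le hσ' N t)
    (Φ.measurable_flow (-t)) (measurable_llr _ _)
    (LambertianContactSwapLambertianEulerGibbsInvariance.gibbsInvariance_of_liouvilleInvariance
      LambertianContactSwapSwapGapLiouvilleInvarianceLambda.stub_liouvilleInvarianceLambda
      hσ hσ' N a θ u Φ ht)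
    (map_flow_localGibbsLaw_const σ a θ u N Φ (-t))).symm

/-- **T21 · THE `t = 0` INSTANCE OF S2ʳ** (`stub_detFieldConcentration_zero`; NEW rung of v12, provable now, from R0): for
continuous profiles there is `σ₀ > 0` (`:= min (1/2) σ_R0`) such that for `0 < σ < σ₀`, all flows, `χ`, `F`, `δ` there is `C > 0`
with `P_N{δ < |F(fld(Φ_0 z)) − ∫ F(fld(Φ_0 w)) dP_N|} ≤ C e^{−(N+1)/C}` for all `N`: `Φ_0 = id` on the good set (`HardSphereFlow.flow_zero`),
which carries `P_N` (`measure_compl_good_eq_zero_of_absolutelyContinuous`), so the event and the mean are the static ones of R0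
(`stub_fieldConcentration_static`) up to a null set (`measure_congr` / `integral_congr_ae`). [folklore] -/
theorem stub_detFieldConcentration_zero :
    ∀ (a₀ θ₀ : T3 → ℝ) (u₀ : T3 → V3), Continuous a₀ → Continuous θ₀ → Continuous u₀ →
      (∀ x, 0 < a₀ x) → (∀ x, 0 < θ₀ x) →
      ∃ σ₀ : ℝ, 0 < σ₀ ∧ ∀ σ : ℝ, 0 < σ → σ < σ₀ →
        ∀ Φ : (N : ℕ) → HardSphereFlow (Torus.geometry (Fin 3)) (hsDiameter σ N) (N + 1),
          ∀ χ : T3 → ℝ, Continuous χ → ∀ F : ℝ × V3 × ℝ → ℝ, LipschitzWith 1 F → (∀ y, |F y| ≤ 1) →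
            ∀ δ : ℝ, 0 < δ → ∃ C : ℝ, 0 < C ∧ ∀ N : ℕ,
              (localGibbsLaw σ a₀ u₀ θ₀ N (Φ N))
                {z | δ < |F (empiricalDensityField ((Φ N).flow 0 z) χ,
                      empiricalMomentumField ((Φ N).flow 0 z) χ,
                      empiricalEnergyField ((Φ N).flow 0 z) χ) -
                    ∫ w, F (empiricalDensityField ((Φ N).flow 0 w) χ,
                      empiricalMomentumField ((Φ N).flow 0 w) χ,
                      empiricalEnergyField ((Φ N).flow 0 w) χ)
                      ∂(localGibbsLaw σ a₀ u₀ θ₀ N (Φ N))|} ≤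
                ENNReal.ofReal (C * Real.exp (-(C⁻¹ * ((N : ℝ) + 1)))) := by
  -- LANDED p131628 (`…Theorems.stub_detFieldConcentration_zero`, wave 8); proof inlined because that module's olean cannot be served yet (BUILD-BLOCKER.md)
  intro a₀ θ₀ u₀ ha hθ hu ha0 hθ0
  obtain ⟨σ₁, hσ₁, hstat⟩ := stub_fieldConcentration_static a₀ θ₀ u₀ ha hθ hu ha0 hθ0
  refine ⟨σ₁, hσ₁, ?_⟩
  intro σ hσ hσlt Φ χ hχ F hF hF1 δ hδ
  obtain ⟨C, hC, hCN⟩ := hstat σ hσ hσlt χ hχ F hF hF1 δ hδ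
  refine ⟨C, hC, fun N => ?_⟩
  set P : Measure (Config (N + 1) (Fin 3) T3) := localGibbsLaw σ a₀ u₀ θ₀ N (Φ N) with hPdef
  set G : Config (N + 1) (Fin 3) T3 → ℝ := fun z =>
    F (empiricalDensityField z χ, empiricalMomentumField z χ, empiricalEnergyField z χ)
  -- the local Gibbs law is absolutely continuous w.r.t. Liouville, hence carried by the good set
  have hPac : P ≪ liouville (Torus.geometry (Fin 3)) (N + 1) (hsDiameter σ N) := by
    rw [hPdef, localGibbsLaw, particleLaw_eq]
    exact withDensity_absolutelyContinuous _ _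
  have hgood : ∀ᵐ z ∂P, z ∈ (Φ N).good := by
    rw [ae_iff]
    exact measure_compl_good_eq_zero_of_absolutelyContinuous (Φ N) hPac
  -- `Φ_0 = id` almost surely
  have hflow : ∀ᵐ z ∂P, (Φ N).flow 0 z = z := hgood.mono fun z hz => (Φ N).flow_zero z hz
  -- the mean and the event are the static ones
  have hmean : ∫ w, G ((Φ N).flow 0 w) ∂P = ∫ w, G w ∂P :=
    integral_congr_ae (hflow.mono fun z hz => by
      show G ((Φ N).flow 0 z) = G z
      rw [hz])
  have hev : P {z | δ < |G ((Φ N).flow 0 z) - ∫ w, G w ∂P|} = P {z | δ < |G z - ∫ w, G w ∂P|} :=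
    measure_congr (Filter.eventuallyEq_set.2 (hflow.mono fun z hz => by
      rw [mem_setOf_eq, mem_setOf_eq, hz]))
  show P {z | δ < |G ((Φ N).flow 0 z) - ∫ w, G ((Φ N).flow 0 w) ∂P|} ≤
    ENNReal.ofReal (C * Real.exp (-(C⁻¹ * ((N : ℝ) + 1))))
  rw [hmean, hev]
  exact hCN N (Φ N)

/-- **Invariant measures do not see the dynamics in deviation events.** If `μ.map T = μ` for a
measurable self-map `T` and `g` is a real measurable statistic, then the `μ`-measure of the deviation
event `{δ < |g ∘ T − ∫ g ∘ T dμ|}` equals that of the static event `{δ < |g − ∫ g dμ|}`: the mean is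
unchanged (`integral_map`) and the event is the `T`-preimage of the static one (`Measure.map_apply`).
[folklore] -/
private theorem measure_setOf_lt_abs_comp_sub_integral_eq_of_map_eq {α : Type*} [MeasurableSpace α]
    {μ : Measure α} {T : α → α} (hT : Measurable T) (hinv : μ.map T = μ) {g : α → ℝ}
    (hg : Measurable g) (δ : ℝ) :
    μ {z | δ < |g (T z) - ∫ w, g (T w) ∂μ|} = μ {z | δ < |g z - ∫ w, g w ∂μ|} := by
  have hmean : ∫ w, g (T w) ∂μ = ∫ w, g w ∂μ := by
    rw [← integral_map hT.aemeasurable hg.aestronglyMeasurable, hinv]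
  have hA : MeasurableSet {y | δ < |g y - ∫ w, g w ∂μ|} :=
    measurableSet_lt measurable_const (hg.sub measurable_const).abs
  have hpre : {z | δ < |g (T z) - ∫ w, g w ∂μ|} = T ⁻¹' {y | δ < |g y - ∫ w, g w ∂μ|} := rfl
  rw [hmean, hpre, ← Measure.map_apply hT hA, hinv]

/-- **T22 · THE EQUILIBRIUM RUNG OF S2ʳ** (`stub_detFieldConcentration_equilibrium`; NEW rung of v12, provable now, from R0): for
CONSTANT profiles `a, θ > 0`, `u` there is `σ₀ > 0` such that for `0 < σ < σ₀`, all `χ`, `F`, `δ` there is `C > 0` with, for all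
`N`, all flows `Φ` and ALL real `t`, `G_N{δ < |F(fld(Φ_t z)) − ∫ F(fld(Φ_t w)) dG_N|} ≤ C e^{−(N+1)/C}`: the homogeneous Gibbs law
`G_N = localGibbsLaw σ a u θ` is invariant under every hard-sphere flow (`map_flow_localGibbsLaw_const`), so the event's measure and
the mean are the static ones of R0 (`Measure.map_apply`, `integral_map`). [folklore] -/
theorem stub_detFieldConcentration_equilibrium :
    ∀ (a θ : ℝ) (u : V3), 0 < a → 0 < θ → ∃ σ₀ : ℝ, 0 < σ₀ ∧ ∀ σ : ℝ, 0 < σ → σ < σ₀ →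
      ∀ χ : T3 → ℝ, Continuous χ → ∀ F : ℝ × V3 × ℝ → ℝ, LipschitzWith 1 F → (∀ y, |F y| ≤ 1) →
        ∀ δ : ℝ, 0 < δ → ∃ C : ℝ, 0 < C ∧
          ∀ (N : ℕ) (Φ : HardSphereFlow (Torus.geometry (Fin 3)) (hsDiameter σ N) (N + 1)) (t : ℝ),
            (localGibbsLaw σ (fun _ => a) (fun _ => u) (fun _ => θ) N Φ)
                {z | δ < |F (empiricalDensityField (Φ.flow t z) χ,
                      empiricalMomentumField (Φ.flow t z) χ,
                      empiricalEnergyField (Φ.flow t z) χ) -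
                    ∫ w, F (empiricalDensityField (Φ.flow t w) χ,
                      empiricalMomentumField (Φ.flow t w) χ,
                      empiricalEnergyField (Φ.flow t w) χ)
                      ∂(localGibbsLaw σ (fun _ => a) (fun _ => u) (fun _ => θ) N Φ)|} ≤
              ENNReal.ofReal (C * Real.exp (-(C⁻¹ * ((N : ℝ) + 1)))) := by
  -- LANDED p131463 (`…Theorems.stub_detFieldConcentration_equilibrium`, wave 8); proof inlined because that module's olean cannot be served yet (BUILD-BLOCKER.md)
  intro a θ u ha hθ
  obtain ⟨σ₀, hσ₀, h⟩ := stub_fieldConcentration_static (fun _ => a) (fun _ => θ) (fun _ => u)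
    continuous_const continuous_const continuous_const (fun _ => ha) (fun _ => hθ)
  refine ⟨σ₀, hσ₀, fun σ hσ hσlt χ hχ F hF hF1 δ hδ => ?_⟩
  obtain ⟨C, hC, hCN⟩ := h σ hσ hσlt χ hχ F hF hF1 δ hδ
  refine ⟨C, hC, fun N Φ t => ?_⟩
  exact (measure_setOf_lt_abs_comp_sub_integral_eq_of_map_eq (Φ.measurable_flow t)
    (map_flow_localGibbsLaw_const σ a θ u N Φ t)
    (g := fun y => F (empiricalDensityField y χ, empiricalMomentumField y χ,
      empiricalEnergyField y χ))
    (hF.continuous.measurable.comp (measurable_fieldTriple hχ)) δ).trans_le (hCN N Φ)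

/-- **SwapGap from the REVERSED line** (v12): S1ʳ′ `stub_echoMeanReturn` (explicit echo deficit → 0) gives S1ʳ (T18), and with S2ʳ
`stub_detFieldConcentration` the reversed transfer T17 closes the crux. -/
theorem swapGap_of_stubs_reversed : SwapGap :=
  stub_swapGap_of_revRelEntSwap_of_detFieldConcentration
    (stub_revRelEntSwap_of_echoMeanReturn stub_echoMeanReturn) stub_detFieldConcentration

/-! ## §5 The compositions -/

/-- **The crux modulo the two research stubs** (11854-free): the landed composition `swapGap_of_relEntSwap_of_fieldConcentration`
(p106427) fed with S1 (`stub_relEntSwap`) and S2 (`stub_fieldConcentration`); it checks that the registered signatures compose literally. -/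
theorem swapGap_of_stubs : SwapGap :=
  swapGap_of_relEntSwap_of_fieldConcentration stub_relEntSwap stub_fieldConcentration

/-- **The crux through the field-level entropy S1″** (G2 ∘ G3): the same conclusion consuming only `FieldRelEntSwap` on the p-side. -/
theorem swapGap_of_stubs_via_fields : SwapGap :=
  stub_swapGap_of_fieldRelEntSwap_of_fieldConcentration fieldRelEntSwap_of_stubs stub_fieldConcentration

/-- **The shared item's other copy.** Crux stmt-AtomisticToContinuum-11850 is wanted by two routes; route `LindebergRandomFuture`
declares `SwapGap` with the byte-identical `let` block, so the two decls are definitionally equal and the same term closes both. -/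
theorem SwapGap_proof :
    Summit.AtomisticToContinuum.HydrodynamicLimit.Theses.LindebergRandomFuture.SwapGap :=
  swapGap_of_stubs

end Summit.AtomisticToContinuum.HydrodynamicLimit.Cruxes.SwapGap.EntropyLine
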